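import Mathlib
import Summits.ResolutionOfSingularities.ResolutionOfSingularities.Theorems.RadicialJungCleanModelsLens5PRankTwoPort5
import Literature.FieldTheory.Separability.PDegreeSeparablyGenerated
import HarnessLib

/-!
# Lens 5 — THEOREM T″ ⊃ T′_∞ ⊃ T′_fin ⊃ T′₁: the (P2)-slice of `stub_cleanLU3DefectNonDiscrete` over ARBITRARY ground fields with
# `κ_v/k` separable (rev 2: the residual-independence family is DISCHARGED in kernel by Mac Lane's criterion, §I)

OURS · CANDIDATE · counted 0.  Crux workfile on `stmt-ResolutionOfSingularities-0549` (`Theses.Descent.DescentPerfectToAll`); customer =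
the lead's research stub `stub_cleanLU3DefectNonDiscrete` of `Cruxes/CleanModels/Lines/Sketch.lean` (rev 28 :279), whose residual after
THEOREM T (✓ `Theorems/RadicialJungCleanModelsLens5PRankTwoPort5.lean`, slice {`PerfectField k`, `[Γ : pΓ] = p²`}) and THEOREM T′_fin
(`Lens5_TPrime.lean` rev 3, slice {`[Γ : pΓ] = p²`, `K/k` separably generated, `[k : k^p] < ∞` with a residually `p`-independent
`p`-spanning family}) contained EVERY ground field of INFINITE `p`-rank (`k = 𝔽_p(t₁, t₂, …)`, `k = 𝔽_p((s))(t_i)_{i ∈ ℕ}`, …).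
Nothing here proves resolution in char `p`; resolution in char p NOT proved.  Four levels below the crux:
T′₁ ⊂ T′_fin ⊂ T′_∞ ⊂ :279 ⊂ :219 ⊂ `CleanModels|_{dim ≥ 4}` ⊂ 0549.

## What is new (res-B-lens-5 g14): the finiteness `[k : k^p] < ∞` of T′_fin is REMOVED
`CleanLU3DefectPRankTwoSepInfAt p` (§B″): the binders of T′_fin with the finite family `{S} [Fintype S] (b : S → k)` replaced by an
ARBITRARY family `(S : Type) (b : S → k)` which is `p`-spanning with FINITELY SUPPORTED sums (`IsPSpanningFamilyInf`: every `c ∈ k` is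
`Σ_{s ∈ s₀} d_s^p b_s` for some finite `s₀`) and residually `p`-independent along `v` on every finite subfamily
(`ResiduallyPIndependentFamilyInf`).  WHEN DOES SUCH A FAMILY EXIST?  (rev 1: by hand; rev 2, §I: the useful direction IN KERNEL —
`residuallyPIndependentFamilyInf_of_isSeparable` + `exists_pBasisFamilyInf`, via Mathlib's linear disjointness of a separable and a purely
inseparable extension.)  A residually
`p`-independent `p`-spanning family is a `k^p`-vector-space BASIS of `k` (the `d_s ∈ k` are `v`-units) whose residues stay
`κ_v^p`-linearly independent in `κ_v`; one (equivalently every) `k^p`-basis of `k` has this property iff `k` and `κ_v^p` are linearly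
disjoint over `k^p`, i.e. iff `κ_v/k` is SEPARABLE (MacLane's criterion).  So T′_∞ is the slice {`[Γ : pΓ] = p²`, `K/k` separably
generated, `κ_v/k` separable} of the stub for an ARBITRARY ground field `k` of characteristic `p` — `k` perfect (T, `b = 1`), of finite
`p`-rank (T′_fin) or of infinite `p`-rank alike.
Final theorem: `cleanLU3DefectPRankTwoSepInf_of_cossartPiltant2019 : CossartPiltant2019 → F-32 → CleanLU3DefectPRankTwoSepInfAt p`;
corollaries (same statements and names as rev 3): `cleanLU3DefectPRankTwoSepFin_of_cossartPiltant2019` (T′_fin, via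
`cleanLU3DefectPRankTwoSepFin_of_sepInf`) and `cleanLU3DefectPRankTwoSepRkOne_of_cossartPiltant2019` (T′₁).
**rev 2 (§I) THEOREM T″** `cleanLU3DefectPRankTwoSepRes_of_cossartPiltant2019 : CossartPiltant2019 → F-32 → CleanLU3DefectPRankTwoSepResAt p`
— the slice {`[Γ : pΓ] = p²`, `K/k` separably generated, `κ_v/k` SEPARABLE (`Algebra.IsSeparable k (IsLocalRing.ResidueField O)` for any
compatible `k`-algebra structure)} with NO auxiliary family: the honest statement-level form of what T′_∞ proves, for the lead's re-cut of :279.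

## Why there is NO statement-level reduction T′_∞ ⟸ T′_fin (and what replaces it)
Only finitely many `b_s` occur in the generators of `A`, but the slice cannot be re-based on a subfield `k₁ ⊆ k` generated by them: either
`k₁ ⊇ k^p` (then `[k₁ : k₁^p]` is still infinite) or `k₁` is small (then `A` is not of finite type over `k₁`, `Frac` and `SepGenerated`
change, and `[K : k₁ K^p] = ∞` kills the degree count of PORT 1′).  Instead the architecture is re-plumbed with TWO fields: `A` stays a
`k`-algebra, while F-02/F-32 (PORT 2′) run over an ABSTRACT small field `k₀` (`[Algebra k₀ k] [IsScalarTower k₀ k K]`, every `c^p`, `c ∈ k`,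
in the image of `k₀`, every element of `k₀` a `p`-th power in `K`), instantiated at `k₀ := k^p = ↥(frobenius k p).fieldRange`; and every
sum over the family is FINITELY SUPPORTED, the supports being collected ONCE per port into a common finite `S₀ ⊆ S`:
* PORT 1′_∞ (§D∞): rev 3's dimension count `[K : M] = |S| p²` is meaningless; replaced by: `k·K^p` IS the `K^p`-span of `B` (a subfield —
  `x⁻¹ = (x^p)⁻¹ x^{p-1}`), the `p³` monomials `g₀^i x^a y^b` are `k·K^p`-linearly independent (RG + DG on a finite common support and the
  `K^p`-independence of `1, g₀, …, g₀^{p-1}`, `pthPowers_linearIndependent_powers`), hence a basis by `[K : k·K^p] = p³` (§A); expanding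
  the `k·K^p`-coefficients over `B` gives the doubly graded representation of the generators on a common finite `S₀`.
* PORT 2′_∞ (§E∞): the two-field M-side (`TwoField.*`, the rev 3 / Port 2b core re-proved with `k₀ ≠ k`; F-02 consumed at the field `k^p`).
* §F∞: `A₂ = k[G₂]` is the `C`-span of `B` (`C = k^p[G₂]`; closed under products since `B_s B_t ∈ k = Σ_fin k^p b_u`), so
  `T⁺ = Σ_fin B_s T` and `𝔪_{T⁺} = (z)` by RG on finite supports; regular of dimension `3`.
* PORT 4′_∞ (§G∞): Port 4′ with the graded-descent tail run on the common support of the coefficients `λ_e ∈ T⁺` of the regular parameter.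
* §H∞: composition; PORT 3 (toric chart) and the exit lemma VERBATIM (✓ Theorems).

## Status (rev 3, res-B-lens-5 g14): SORRY-FREE, LINT-CLEAN (rc 0, 0 sorries, 0 warnings; only `dupNamespace` off as in ✓ Theorems; axioms = Lean's
three).  rev 3 = rev 2 (TRIAGE-141 PASS 34580cd59639e156) + port caveat discharged (linters re-enabled, 4 `omit … in`, 4 unused binders `_`-renamed); no
mathematical change, decl names/statements identical.
§A (`[K : k K^p] = p³`, copy of ✓ `Lens5_PDegreeSep.lean`), §B/§B′ (rev 3 slices, kept for the corollaries), §B″ (NEW currency + conversions),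
§C (rev 3: RPI from a non-`p`-th-power residue, RG, IR — verbatim), §D (rev 3's DG lemma verbatim) + §D∞ PORT 1′_∞ (NEW), §E∞ PORT 2′_∞ (NEW,
two-field), §F∞ (NEW), §G∞ PORT 4′_∞ (rev 3 body + NEW tail), §H∞ composition (NEW) + corollaries T′_fin, T′₁, §I (rev 2, NEW: Mac Lane
bridge B1 in kernel + THEOREM T″).  `Lens5_TPrime.lean` rev 3
is left untouched (its theorems are re-derived here as corollaries; porters may port EITHER file — this one subsumes rev 3).
NOT counted (crux workfile, four levels below 0549); resolution in char p NOT proved.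

## Residual of the lead's stub :279 after T ∪ T′_∞ ∪ T″ (honest; T″ makes the region {P2} × {SEP-K} × {`κ_v/k` separable} a theorem BY NAME)
{`[Γ : pΓ] ≤ p`} (no `M`-grading lever; lens-5 NULL of record, memo §16) ∪ {`K/k` NOT separably generated} ∪ {`κ_v/k` INSEPARABLE}
(one imperfect-field phenomenon seen from `K` and from `κ_v`, memo §§10, 21).  On these T′_∞ says nothing.
-/

set_option linter.dupNamespace false

/-! ## §A `[K : k·K^p] = p³` for `K/k` separably generated of transcendence degree 3 (copy of the crux workfile
`Lens5_PDegreeSep.lean`, ✓ there; crux workfiles are not importable modules, hence the verbatim copy) -/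

namespace Summit.ResolutionOfSingularities.ResolutionOfSingularities.Cruxes.DescentPerfectToAll.CpSibling.TPrimeInf.PDegreeSep

open IntermediateField Module Literature.FieldTheory.Separability Literature.AlgebraicGeometry.Resolution

variable {k : Type} {K : Type} [Field k] [Field K] [Algebra k K] (p : ℕ) [Fact p.Prime] [CharP K p]

/-- A `k`-derivation of `K` that kills the subfield `F` and the set `t` kills `F(t)`. [folklore] -/
theorem derivation_eq_zero_of_mem_adjoin (F : Subfield K) (hFD : ∀ (D : Derivation k K K) (x : K), x ∈ F → D x = 0)
    (D : Derivation k K K) {t : Set K} (ht : ∀ b ∈ t, D b = 0) {x : K} (hx : x ∈ adjoin F t) : D x = 0 := by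
  have hx' : x ∈ Subfield.closure (Set.range (algebraMap F K) ∪ t) := by
    rwa [← adjoin_toSubfield]
  have h := Derivation.eqOn_subfieldClosure (D₁ := D.restrictScalars ℤ) (D₂ := 0)
    (s := Set.range (algebraMap F K) ∪ t) ?_ hx'
  · simpa using h
  · rintro y (⟨c, rfl⟩ | hy)
    · change D (c : K) = (0 : Derivation ℤ K K) _
      rw [Derivation.zero_apply]
      exact hFD D c c.2
    · change D y = (0 : Derivation ℤ K K) y
      rw [Derivation.zero_apply]
      exact ht y hy

/-- A separating transcendence basis of `K/k` is `p`-independent over any subfield `F ⊇ K^p` killed by all `k`-derivations.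
[cite: Matsumura1987, §26 p. 202 and Thm. 26.5] -/
theorem isPIndependent_of_sepTrBasis (F : Subfield K) (hFp : ∀ x : K, x ^ p ∈ F)
    (hFD : ∀ (D : Derivation k K K) (x : K), x ∈ F → D x = 0) (s : Finset K)
    (hs : AlgebraicIndependent k ((↑) : s → K)) (hsep : Algebra.IsSeparable (adjoin k (s : Set K)) K) :
    IsPIndependent (F := F) p (s : Set K) := by
  classical
  suffices h : ∀ t : Finset K, t ⊆ s → IsPIndependent (F := F) p (t : Set K) from
    fun t ht => (h t (fun x hx => ht hx)) t subset_rfl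
  intro t
  induction t using Finset.induction_on with
  | empty =>
    intro _
    rw [Finset.coe_empty]
    exact isPIndependent_empty _ p
  | insert a t hat ih =>
    intro hts
    have hts' : t ⊆ s := fun x hx => hts (Finset.mem_insert_of_mem hx)
    have has : a ∈ s := hts (Finset.mem_insert_self a t)
    rw [Finset.coe_insert]
    refine isPIndependent_insert (ih hts') ?_ ⟨⟨a ^ p, hFp a⟩, rfl⟩
    intro hmem
    obtain ⟨D, hDa, hDb⟩ := exists_derivation_dual s hs hsep ⟨a, has⟩
    have hDt : ∀ b ∈ (t : Set K), D b = 0 := fun b hb => by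
      have hbs : b ∈ s := hts' hb
      have hba : (⟨b, hbs⟩ : s) ≠ ⟨a, has⟩ := fun h => hat (by
        rw [← show b = a from congrArg Subtype.val h]; exact hb)
      exact hDb ⟨b, hbs⟩ hba
    have := derivation_eq_zero_of_mem_adjoin F hFD D hDt hmem
    rw [hDa] at this
    exact one_ne_zero this

/-- `K = F(s)` for a separating transcendence basis `s` of `K/k` and any subfield `F` containing (the image of) `k` and `K^p`.
[cite: Matsumura1987, §26 p. 202 and Thm. 26.5] -/
theorem adjoin_eq_top_of_sepTrBasis (F : Subfield K) (hFk : ∀ c : k, algebraMap k K c ∈ F) (hFp : ∀ x : K, x ^ p ∈ F)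
    (s : Finset K) (hsep : Algebra.IsSeparable (adjoin k (s : Set K)) K) :
    adjoin F (s : Set K) = ⊤ := by
  classical
  set M : IntermediateField F K := adjoin F (s : Set K) with hM
  have hle : ∀ y : adjoin k (s : Set K), (y : K) ∈ M := by
    intro y
    have hy : (y : K) ∈ Subfield.closure (Set.range (algebraMap k K) ∪ (s : Set K)) := by
      rw [← adjoin_toSubfield]; exact y.2
    have hsub : Set.range (algebraMap k K) ∪ (s : Set K) ⊆ (M.toSubfield : Set K) := by
      rintro z (⟨c, rfl⟩ | hz)
      · exact M.algebraMap_mem ⟨algebraMap k K c, hFk c⟩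
      · exact subset_adjoin F (s : Set K) hz
    exact Subfield.closure_le.mpr hsub hy
  let f : adjoin k (s : Set K) →+* M := (algebraMap (adjoin k (s : Set K)) K).codRestrict M hle
  have hf : (algebraMap M K).comp f = algebraMap (adjoin k (s : Set K)) K := RingHom.ext fun _ => rfl
  haveI : ExpChar M p := by
    haveI : CharP M p := (algebraMap M K).charP (algebraMap M K).injective p
    exact ExpChar.prime Fact.out
  rw [eq_top_iff]
  intro x _
  have hxsep : IsSeparable M x :=
    isSeparable_of_ringHom_comp_eq f hf (Algebra.IsSeparable.isSeparable (adjoin k (s : Set K)) x)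
  have hxperf : x ∈ perfectClosure M K := by
    rw [mem_perfectClosure_iff_pow_mem p]
    refine ⟨1, ⟨⟨x ^ p, M.algebraMap_mem ⟨x ^ p, hFp x⟩⟩, ?_⟩⟩
    rw [pow_one]
    rfl
  have hxbot : x ∈ (⊥ : IntermediateField M K) := by
    rw [← separableClosure_inf_perfectClosure M K]
    exact ⟨mem_separableClosure_iff.mpr hxsep, hxperf⟩
  obtain ⟨y, hy⟩ := IntermediateField.mem_bot.mp hxbot
  rw [← hy]
  exact y.2

/-- `[K : F] = p^{#s}` for a separating transcendence basis `s` of `K/k` and a subfield `F` with `k ⊆ F`, `K^p ⊆ F`, killed by every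
`k`-derivation. [cite: Matsumura1987, §26 p. 202 and Thm. 26.5] -/
theorem finrank_eq_pow_card_of_sepTrBasis (F : Subfield K) (hFk : ∀ c : k, algebraMap k K c ∈ F) (hFp : ∀ x : K, x ^ p ∈ F)
    (hFD : ∀ (D : Derivation k K K) (x : K), x ∈ F → D x = 0) (s : Finset K)
    (hs : AlgebraicIndependent k ((↑) : s → K)) (hsep : Algebra.IsSeparable (adjoin k (s : Set K)) K) :
    finrank F K = p ^ s.card := by
  have h1 := (isPIndependent_of_sepTrBasis p F hFp hFD s hs hsep).finrank_eq s subset_rfl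
  rwa [adjoin_eq_top_of_sepTrBasis p F hFk hFp s hsep, finrank_top'] at h1

/-- `k ⊆ k·K^p`. -/
theorem composite_algebraMap_mem (c : k) :
    algebraMap k K c ∈ Subfield.closure (Set.range (algebraMap k K) ∪ Set.range (frobenius K p)) :=
  Subfield.subset_closure (Or.inl ⟨c, rfl⟩)

/-- `K^p ⊆ k·K^p`. -/
theorem composite_pow_mem (x : K) :
    x ^ p ∈ Subfield.closure (Set.range (algebraMap k K) ∪ Set.range (frobenius K p)) :=
  Subfield.subset_closure (Or.inr ⟨x, frobenius_def ..⟩)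

/-- Every `k`-derivation of `K` kills `k·K^p`. [folklore] -/
theorem composite_derivation_eq_zero (D : Derivation k K K) (x : K)
    (hx : x ∈ Subfield.closure (Set.range (algebraMap k K) ∪ Set.range (frobenius K p))) : D x = 0 := by
  have h := Derivation.eqOn_subfieldClosure (D₁ := D.restrictScalars ℤ) (D₂ := 0)
    (s := Set.range (algebraMap k K) ∪ Set.range (frobenius K p)) ?_ hx
  · simpa using h
  · rintro y (⟨c, rfl⟩ | ⟨z, rfl⟩)
    · change D (algebraMap k K c) = (0 : Derivation ℤ K K) _
      rw [Derivation.zero_apply, Derivation.map_algebraMap]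
    · change D (frobenius K p z) = (0 : Derivation ℤ K K) _
      rw [Derivation.zero_apply, frobenius_def]
      exact Derivation.apply_pow_char (p := p) (D.restrictScalars ℤ) z

/-- `[K : k·K^p] = p^{#s}` for a finite separating transcendence basis `s` of `K/k`, ANY ground field `k` of characteristic `p`.
[cite: Matsumura1987, §26 p. 202 and Thm. 26.5] -/
theorem finrank_composite_eq_pow_card (s : Finset K) (hs : AlgebraicIndependent k ((↑) : s → K))
    (hsep : Algebra.IsSeparable (adjoin k (s : Set K)) K) :
    finrank (Subfield.closure (Set.range (algebraMap k K) ∪ Set.range (frobenius K p))) K = p ^ s.card :=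
  finrank_eq_pow_card_of_sepTrBasis p _ (composite_algebraMap_mem p) (composite_pow_mem p)
    (composite_derivation_eq_zero p) s hs hsep

omit [CharP K p] in
/-- `[K : k·K^p] = p³` for `K = Frac A`, `A` a finitely generated `k`-algebra of Krull dimension `3` over ANY field `k` of
characteristic `p`, `K/k` separably generated. [cite: Matsumura1987, Thm. 26.5] -/
theorem pDegreeThreeOfSepGenerated :
    ∀ (k : Type) [Field k] [CharP k p] (K : Type) [Field K] [Algebra k K] [CharP K p] (A : Subalgebra k K),
      A.FG → IsFractionRing A K → ringKrullDim A = 3 →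
        (∃ (n : ℕ) (s : Fin n → K), AlgebraicIndependent k s ∧ Algebra.IsSeparable (IntermediateField.adjoin k (Set.range s)) K) →
        Module.finrank (Subfield.closure (Set.range (algebraMap k K) ∪ Set.range (frobenius K p))) K = p ^ 3 := by
  intro k _ _ K _ _ _ A hAfg hfrac hdim hsg
  classical
  obtain ⟨n, s, hs, hsep⟩ := hsg
  haveI : Algebra.FiniteType k A := A.fg_iff_finiteType.mp hAfg
  haveI : Algebra.EssFiniteType A K := Algebra.EssFiniteType.of_isLocalization K (nonZeroDivisors A)
  haveI : Algebra.EssFiniteType k K := Algebra.EssFiniteType.comp k A K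
  obtain ⟨d, hd, htr⟩ := Literature.RingTheory.KrullDimension.exists_ringKrullDim_eq_and_trdeg_eq k A
  have hd3 : d = 3 := by
    rw [hd] at hdim
    exact_mod_cast hdim
  haveI : FaithfulSMul k A := (faithfulSMul_iff_algebraMap_injective k A).mpr (algebraMap k A).injective
  haveI : FaithfulSMul A K := (faithfulSMul_iff_algebraMap_injective A K).mpr (IsFractionRing.injective A K)
  haveI : Algebra.IsAlgebraic A K := IsLocalization.isAlgebraic K (nonZeroDivisors A)
  have htrK : Algebra.trdeg k K = (3 : ℕ) := by
    rw [← trdeg_add_eq k A (A := K), trdeg_eq_zero (R := A) (A := K), add_zero, htr, hd3]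
  haveI := hsep
  have halg : Algebra.IsAlgebraic (IntermediateField.adjoin k (Set.range s)) K := inferInstance
  have htb : IsTranscendenceBasis k s :=
    hs.isTranscendenceBasis_iff_isAlgebraic.mpr (IntermediateField.isAlgebraic_adjoin_iff_top.mp halg)
  have hn : n = 3 := by
    have h := htb.cardinalMk_eq_trdeg
    rw [Cardinal.mk_fin, htrK] at h
    exact_mod_cast h
  set s' : Finset K := Finset.univ.image s with hs'
  have hcoe : (s' : Set K) = Set.range s := by
    rw [hs', Finset.coe_image, Finset.coe_univ, Set.image_univ]
  have hs'' : AlgebraicIndependent k ((↑) : s' → K) := by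
    have := hs.to_subtype_range' hcoe.symm
    exact this
  have hsep' : Algebra.IsSeparable (adjoin k (s' : Set K)) K := by
    rw [hcoe]; exact hsep
  have hcard : s'.card = 3 := by
    rw [hs', Finset.card_image_of_injective _ hs.injective, Finset.card_univ, Fintype.card_fin, hn]
  rw [finrank_composite_eq_pow_card p s' hs'' hsep', hcard]

end Summit.ResolutionOfSingularities.ResolutionOfSingularities.Cruxes.DescentPerfectToAll.CpSibling.TPrimeInf.PDegreeSep

section

open IsLocalRing
open Literature.AlgebraicGeometry.Resolution
open Summit.ResolutionOfSingularities.ResolutionOfSingularities.Theorems.RadicialJung.CleanModels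
open Summit.ResolutionOfSingularities.ResolutionOfSingularities.Theorems.RadicialJung.CleanModels.Lens5
open Summit.ResolutionOfSingularities.ResolutionOfSingularities.Theorems.RadicialJung.CleanModels.Lens5.PRankTwoCurrency
open Summit.ResolutionOfSingularities.ResolutionOfSingularities.Theorems.RadicialJung.CleanModels.Lens5.PRankTwoAssembly
open Summit.ResolutionOfSingularities.ResolutionOfSingularities.Theorems.RadicialJungCleanModels.Lens5RegularityCriterion
open Summit.ResolutionOfSingularities.ResolutionOfSingularities.Theorems.RadicialJungCleanModels.Lens5ChartSurjection

namespace Summit.ResolutionOfSingularities.ResolutionOfSingularities.Cruxes.DescentPerfectToAll.CpSibling.TPrimeInf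


/-! ## §B Currency of T′₁ (`p`-rank one; kept — T′₁ is the corollary `S := Fin p`, `b i := θ^i` of T′_fin, §H) -/

/-- `K/k` separably generated (census `Census_lens5_pRankTwo.lean` def, verbatim). [folklore] -/
def SepGenerated (k K : Type) [Field k] [Field K] [Algebra k K] : Prop :=
    ∃ (n : ℕ) (s : Fin n → K), AlgebraicIndependent k s ∧ Algebra.IsSeparable (IntermediateField.adjoin k (Set.range s)) K

/-- **`θ` is a `p`-generator of `k`**: `k = k^p[θ] = Σ_{i<p} k^p θ^i`, i.e. `[k : k^p] ≤ p` (`p`-rank ≤ 1). [folklore] -/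
def IsPGenerator (p : ℕ) {k : Type} [Field k] (θ : k) : Prop :=
    ∀ c : k, ∃ d : Fin p → k, c = ∑ i : Fin p, d i ^ p * θ ^ (i : ℕ)

/-- **Residual `p`-independence of `1, Θ, …, Θ^{p-1}`** along `v` (in-`K` form): a combination `Σ_{i<p} w_i^p Θ^i` with integral
coefficients one of which is a unit is a unit.  For `Θ ∈ k` and `κ_v/k` algebraic this says that the `p`-basis `{θ}` of `k` stays
`p`-independent in `κ_v`, i.e. `κ_v/k` is separable. [folklore] -/
def ResiduallyPIndependent (p : ℕ) {K : Type} [Field K] (O : ValuationSubring K) (Θ : K) : Prop :=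
    ∀ w : Fin p → K, (∀ i, w i ∈ O) → (∃ i, O.valuation (w i) = 1) →
      O.valuation (∑ i : Fin p, w i ^ p * Θ ^ (i : ℕ)) = 1

/-- **THEOREM T′₁'s slice**: `stub_cleanLU3DefectNonDiscrete` at `p` on {`[Γ : pΓ] = p²`, `K/k` separably generated, `k` of
`p`-rank ≤ 1 with `p`-generator `θ` residually `p`-independent along `v`} — NO `PerfectField k`. [folklore] -/
def CleanLU3DefectPRankTwoSepRkOneAt (p : ℕ) : Prop :=
    ∀ (k : Type) [Field k] [CharP k p] (K : Type) [Field K] [Algebra k K]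
    (O : ValuationSubring K) (A : Subalgebra k K), A.toSubring ≤ O.toSubring → A.FG → IsFractionRing A K →
    ringKrullDim A ≤ 3 → IsRegularLocalRing (locAtCentre A.toSubring O) →
    ringKrullDim (locAtCentre A.toSubring O) = 3 →
    (∀ (T : Subring K) (hT : T ≤ O.toSubring), A.toSubring ≤ T → (subringCentre T O hT).IsMaximal) →
    ∀ g₀ : K, (∀ c : K, c ^ p ≠ g₀) →
    (∀ f₀ : K, ∃ f₁ : K, O.valuation (g₀ - f₁ ^ p) < O.valuation (g₀ - f₀ ^ p)) →
    (∀ hk : ∀ c : k, algebraMap k K c ∈ O, transcendenceDefect k O hk ≠ 0) →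
    ¬ (∃ π : K, π ≠ 0 ∧ (∀ x : K, O.valuation x < 1 → O.valuation x ≤ O.valuation π) ∧
      (∀ x : K, x ≠ 0 → ∃ n : ℕ, O.valuation π ^ n ≤ O.valuation x)) →
    PRankTwoAt p O → SepGenerated k K →
    ∀ θ : k, IsPGenerator p θ → ResiduallyPIndependent p O (algebraMap k K θ) →
    CleanLUConcl p k K O A g₀

/-! ### §B′ Currency of T′_fin (finite `p`-rank): a finite `p`-spanning family of `k`, residually `p`-independent along `v` -/

/-- **A finite `p`-spanning family of `k`**: `k = Σ_{s ∈ S} k^p · b_s` (`S` finite).  Any field of FINITE `p`-rank `e` has one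
(the `p^e` monomials in a `p`-basis); `p`-rank one = the family `1, θ, …, θ^{p-1}`. [folklore] -/
def IsPSpanningFamily (p : ℕ) {k : Type} [Field k] {S : Type} [Fintype S] (b : S → k) : Prop :=
    ∀ c : k, ∃ d : S → k, c = ∑ s : S, d s ^ p * b s

/-- **Residual `p`-independence of a finite family** `B : S → K` along `v` (in-`K` form): `Σ_s w_s^p B_s` is a `v`-unit whenever the
`w_s ∈ O` are not all in `𝔪_v`.  For `B = b` a `p`-spanning family of `k ⊆ O` and `κ_v/k` algebraic this says that the `p`-basis of `k`
extracted from `b` stays `p`-independent in `κ_v`, i.e. (MacLane) `κ_v/k` is SEPARABLE. [folklore] -/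
def ResiduallyPIndependentFamily (p : ℕ) {K : Type} [Field K] (O : ValuationSubring K) {S : Type} [Fintype S]
    (B : S → K) : Prop :=
    ∀ w : S → K, (∀ s, w s ∈ O) → (∃ s, O.valuation (w s) = 1) → O.valuation (∑ s : S, w s ^ p * B s) = 1

/-- **THEOREM T′_fin's slice**: `stub_cleanLU3DefectNonDiscrete` at `p` on {`[Γ : pΓ] = p²`, `K/k` separably generated, `k` with a
FINITE `p`-spanning family (finite `p`-rank) residually `p`-independent along `v`} — NO `PerfectField k`. [folklore] -/
def CleanLU3DefectPRankTwoSepFinAt (p : ℕ) : Prop :=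
    ∀ (k : Type) [Field k] [CharP k p] (K : Type) [Field K] [Algebra k K]
    (O : ValuationSubring K) (A : Subalgebra k K), A.toSubring ≤ O.toSubring → A.FG → IsFractionRing A K →
    ringKrullDim A ≤ 3 → IsRegularLocalRing (locAtCentre A.toSubring O) →
    ringKrullDim (locAtCentre A.toSubring O) = 3 →
    (∀ (T : Subring K) (hT : T ≤ O.toSubring), A.toSubring ≤ T → (subringCentre T O hT).IsMaximal) →
    ∀ g₀ : K, (∀ c : K, c ^ p ≠ g₀) →
    (∀ f₀ : K, ∃ f₁ : K, O.valuation (g₀ - f₁ ^ p) < O.valuation (g₀ - f₀ ^ p)) →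
    (∀ hk : ∀ c : k, algebraMap k K c ∈ O, transcendenceDefect k O hk ≠ 0) →
    ¬ (∃ π : K, π ≠ 0 ∧ (∀ x : K, O.valuation x < 1 → O.valuation x ≤ O.valuation π) ∧
      (∀ x : K, x ≠ 0 → ∃ n : ℕ, O.valuation π ^ n ≤ O.valuation x)) →
    PRankTwoAt p O → SepGenerated k K →
    ∀ (S : Type) [Fintype S] (b : S → k), IsPSpanningFamily p b →
    ResiduallyPIndependentFamily p O (fun s => algebraMap k K (b s)) →
    CleanLUConcl p k K O A g₀

/-! ## §C The new valuation input: residual gradedness RG from immediate residues IR -/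

/-- Residual `p`-independence makes `Θ` a unit of `v` (take `w = e₁`; `p ≥ 2`). [folklore] -/
theorem valuation_eq_one_of_residuallyPIndependent {p : ℕ} [Fact p.Prime] {K : Type} [Field K] (O : ValuationSubring K)
    (Θ : K) (hPI : ResiduallyPIndependent p O Θ) : O.valuation Θ = 1 := by
  classical
  have hp : p.Prime := Fact.out
  have h1 : (1 : ℕ) < p := hp.one_lt
  have h := hPI (Pi.single (⟨1, h1⟩ : Fin p) 1) (fun i => by
    by_cases hi : i = ⟨1, h1⟩
    · subst hi; simp [O.one_mem]
    · simp [Pi.single_eq_of_ne hi, O.zero_mem]) ⟨⟨1, h1⟩, by simp⟩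
  rw [Finset.sum_eq_single (⟨1, h1⟩ : Fin p)] at h
  · simpa using h
  · intro i _ hi; simp [Pi.single_eq_of_ne hi, zero_pow hp.ne_zero]
  · intro h0; exact absurd (Finset.mem_univ _) h0

/-- **RG (residual gradedness).**  If every unit of the subfield `M` is residually a `p`-th power (IR) and `1, Θ, …, Θ^{p-1}` are
residually `p`-independent, then `v(Σ_{i<p} c_i Θ^i) = max_i v(c_i)` for `c_i ∈ M`.  PROVED (normalise by the
maximal coefficient, replace each `c_i/c_{i₀}` by a `p`-th power modulo `𝔪_v`, apply residual `p`-independence). [folklore] -/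
theorem valuation_sum_mul_pow_eq_sup {p : ℕ} [Fact p.Prime] {K : Type} [Field K] (O : ValuationSubring K) (M : Subfield K)
    (hIR : ∀ m : K, m ∈ M → O.valuation m = 1 → ∃ w : K, O.valuation (m - w ^ p) < 1)
    (Θ : K) (hPI : ResiduallyPIndependent p O Θ) (c : Fin p → K) (hc : ∀ i, c i ∈ M) :
    O.valuation (∑ i : Fin p, c i * Θ ^ (i : ℕ)) = Finset.univ.sup (fun i => O.valuation (c i)) := by
  classical
  have hp : p.Prime := Fact.out
  haveI : NeZero p := ⟨hp.ne_zero⟩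
  have hΘv := valuation_eq_one_of_residuallyPIndependent O Θ hPI
  by_cases h0 : ∀ i, c i = 0
  · have hf : (fun i => O.valuation (c i)) = fun _ : Fin p => (0 : O.ValueGroup) := by
      funext i; rw [h0 i, map_zero]
    rw [hf, Finset.sup_const Finset.univ_nonempty]
    simp [h0]
  push Not at h0
  obtain ⟨i₁, hi₁⟩ := h0
  obtain ⟨i₀, -, hi₀⟩ := Finset.exists_max_image Finset.univ (fun i => O.valuation (c i)) ⟨i₁, Finset.mem_univ _⟩
  have hsup : Finset.univ.sup (fun i => O.valuation (c i)) = O.valuation (c i₀) :=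
    le_antisymm (Finset.sup_le fun i hi => hi₀ i hi) (Finset.le_sup (f := fun i => O.valuation (c i)) (Finset.mem_univ i₀))
  have hc0 : c i₀ ≠ 0 := by
    intro h
    have h1 := hi₀ i₁ (Finset.mem_univ _)
    rw [h, map_zero, le_zero_iff, map_eq_zero] at h1
    exact hi₁ h1
  set d : Fin p → K := fun i => c i / c i₀ with hd
  have hdM : ∀ i, d i ∈ M := fun i => div_mem (hc i) (hc i₀)
  have hvc0 : O.valuation (c i₀) ≠ 0 := by rwa [ne_eq, map_eq_zero]
  have hdv : ∀ i, O.valuation (d i) ≤ 1 := fun i => by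
    simp only [hd, map_div₀]
    exact div_le_one_of_le₀ (hi₀ i (Finset.mem_univ _)) zero_le
  have hdi₀ : d i₀ = 1 := div_self hc0
  -- each `d_i` is a `p`-th power modulo `𝔪_v` (IR for the units, `0` for the others)
  have hw : ∀ i, ∃ w : K, O.valuation (d i - w ^ p) < 1 := by
    intro i
    rcases (hdv i).lt_or_eq with hlt | heq
    · exact ⟨0, by rw [zero_pow hp.ne_zero, sub_zero]; exact hlt⟩
    · exact hIR (d i) (hdM i) heq
  choose w hw using hw
  have hwO : ∀ i, w i ∈ O := by
    intro i
    rw [← O.valuation_le_one_iff]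
    by_contra hgt
    push Not at hgt
    have hwp : 1 < O.valuation (w i ^ p) := by rw [map_pow]; exact one_lt_pow₀ hgt hp.ne_zero
    have hlt : O.valuation (d i) < O.valuation (w i ^ p) := lt_of_le_of_lt (hdv i) hwp
    have heq : O.valuation (d i - w i ^ p) = O.valuation (w i ^ p) := Valuation.map_sub_eq_of_lt_right _ hlt
    exact lt_irrefl _ ((heq ▸ hw i).trans hwp)
  have hwi₀ : O.valuation (w i₀) = 1 := by
    have h := hw i₀
    rw [hdi₀] at h
    have h' : O.valuation (w i₀ ^ p - 1) < O.valuation (1 : K) := by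
      rw [← Valuation.map_neg, neg_sub, map_one]; exact h
    have h1 : O.valuation (w i₀ ^ p) = 1 := by
      have := Valuation.map_eq_of_sub_lt _ h'
      rwa [map_one] at this
    rw [map_pow] at h1
    rcases pow_eq_one_iff.mp h1 with h | h
    · exact h
    · exact absurd h hp.ne_zero
  -- the decomposition `Σ d_i Θ^i = Σ w_i^p Θ^i + Σ (d_i - w_i^p) Θ^i`: a unit plus an element of `𝔪_v`
  have hsplit : ∑ i : Fin p, d i * Θ ^ (i : ℕ) =
      ∑ i : Fin p, w i ^ p * Θ ^ (i : ℕ) + ∑ i : Fin p, (d i - w i ^ p) * Θ ^ (i : ℕ) := by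
    rw [← Finset.sum_add_distrib]; exact Finset.sum_congr rfl fun i _ => by ring
  have h1 : O.valuation (∑ i : Fin p, w i ^ p * Θ ^ (i : ℕ)) = 1 := hPI w hwO ⟨i₀, hwi₀⟩
  have h2 : O.valuation (∑ i : Fin p, (d i - w i ^ p) * Θ ^ (i : ℕ)) < 1 := by
    refine Valuation.map_sum_lt _ one_ne_zero fun i _ => ?_
    rw [map_mul, map_pow, hΘv, one_pow, mul_one]; exact hw i
  have hdsum : O.valuation (∑ i : Fin p, d i * Θ ^ (i : ℕ)) = 1 := by
    rw [hsplit, Valuation.map_add_eq_of_lt_left]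
    · exact h1
    · rw [h1]; exact h2
  have hcsum : ∑ i : Fin p, c i * Θ ^ (i : ℕ) = c i₀ * ∑ i : Fin p, d i * Θ ^ (i : ℕ) := by
    rw [Finset.mul_sum]
    exact Finset.sum_congr rfl fun i _ => by simp only [hd]; rw [← mul_assoc, mul_div_cancel₀ _ hc0]
  rw [hcsum, map_mul, hdsum, mul_one, hsup]

/-- Residual `p`-independence of a family makes each member a `v`-unit (take `w = e_s`). [folklore] -/
theorem valuation_eq_one_of_residuallyPIndependentFamily {p : ℕ} [Fact p.Prime] {K : Type} [Field K] (O : ValuationSubring K)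
    {S : Type} [Fintype S] (B : S → K) (hPI : ResiduallyPIndependentFamily p O B) (s : S) : O.valuation (B s) = 1 := by
  classical
  have hp : p.Prime := Fact.out
  have h := hPI (Pi.single s 1) (fun t => by
    by_cases ht : t = s
    · subst ht; simp [O.one_mem]
    · simp [Pi.single_eq_of_ne ht, O.zero_mem]) ⟨s, by simp⟩
  rw [Finset.sum_eq_single s] at h
  · simpa using h
  · intro t _ ht; simp [Pi.single_eq_of_ne ht, zero_pow hp.ne_zero]
  · intro h0; exact absurd (Finset.mem_univ _) h0

/-- **RG for a family (residual gradedness).**  If every unit of the subfield `M` is residually a `p`-th power (IR) and the finite family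
`B` is residually `p`-independent, then `v(Σ_s c_s B_s) = max_s v(c_s)` for `c_s ∈ M`.  PROVED (as the power version). [folklore] -/
theorem valuation_sum_mul_family_eq_sup {p : ℕ} [Fact p.Prime] {K : Type} [Field K] (O : ValuationSubring K) (M : Subfield K)
    (hIR : ∀ m : K, m ∈ M → O.valuation m = 1 → ∃ w : K, O.valuation (m - w ^ p) < 1)
    {S : Type} [Fintype S] (B : S → K) (hPI : ResiduallyPIndependentFamily p O B) (c : S → K) (hc : ∀ i, c i ∈ M) :
    O.valuation (∑ i : S, c i * B i) = Finset.univ.sup (fun i => O.valuation (c i)) := by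
  classical
  have hp : p.Prime := Fact.out
  have hBv := valuation_eq_one_of_residuallyPIndependentFamily O B hPI
  by_cases h0 : ∀ i, c i = 0
  · have hsup0 : Finset.univ.sup (fun i => O.valuation (c i)) = 0 :=
      le_antisymm (Finset.sup_le fun i _ => by rw [h0 i, map_zero]) zero_le
    rw [hsup0]
    have : ∑ i : S, c i * B i = 0 := Finset.sum_eq_zero fun i _ => by rw [h0 i, zero_mul]
    rw [this, map_zero]
  push Not at h0
  obtain ⟨i₁, hi₁⟩ := h0
  obtain ⟨i₀, -, hi₀⟩ := Finset.exists_max_image Finset.univ (fun i => O.valuation (c i)) ⟨i₁, Finset.mem_univ _⟩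
  have hsup : Finset.univ.sup (fun i => O.valuation (c i)) = O.valuation (c i₀) :=
    le_antisymm (Finset.sup_le fun i hi => hi₀ i hi) (Finset.le_sup (f := fun i => O.valuation (c i)) (Finset.mem_univ i₀))
  have hc0 : c i₀ ≠ 0 := by
    intro h
    have h1 := hi₀ i₁ (Finset.mem_univ _)
    rw [h, map_zero, le_zero_iff, map_eq_zero] at h1
    exact hi₁ h1
  set d : S → K := fun i => c i / c i₀ with hd
  have hdM : ∀ i, d i ∈ M := fun i => div_mem (hc i) (hc i₀)
  have hvc0 : O.valuation (c i₀) ≠ 0 := by rwa [ne_eq, map_eq_zero]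
  have hdv : ∀ i, O.valuation (d i) ≤ 1 := fun i => by
    simp only [hd, map_div₀]
    exact div_le_one_of_le₀ (hi₀ i (Finset.mem_univ _)) zero_le
  have hdi₀ : d i₀ = 1 := div_self hc0
  have hw : ∀ i, ∃ w : K, O.valuation (d i - w ^ p) < 1 := by
    intro i
    rcases (hdv i).lt_or_eq with hlt | heq
    · exact ⟨0, by rw [zero_pow hp.ne_zero, sub_zero]; exact hlt⟩
    · exact hIR (d i) (hdM i) heq
  choose w hw using hw
  have hwO : ∀ i, w i ∈ O := by
    intro i
    rw [← O.valuation_le_one_iff]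
    by_contra hgt
    push Not at hgt
    have hwp : 1 < O.valuation (w i ^ p) := by rw [map_pow]; exact one_lt_pow₀ hgt hp.ne_zero
    have hlt : O.valuation (d i) < O.valuation (w i ^ p) := lt_of_le_of_lt (hdv i) hwp
    have heq : O.valuation (d i - w i ^ p) = O.valuation (w i ^ p) := Valuation.map_sub_eq_of_lt_right _ hlt
    exact lt_irrefl _ ((heq ▸ hw i).trans hwp)
  have hwi₀ : O.valuation (w i₀) = 1 := by
    have h := hw i₀
    rw [hdi₀] at h
    have h' : O.valuation (w i₀ ^ p - 1) < O.valuation (1 : K) := by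
      rw [← Valuation.map_neg, neg_sub, map_one]; exact h
    have h1 : O.valuation (w i₀ ^ p) = 1 := by
      have := Valuation.map_eq_of_sub_lt _ h'
      rwa [map_one] at this
    rw [map_pow] at h1
    rcases pow_eq_one_iff.mp h1 with h | h
    · exact h
    · exact absurd h hp.ne_zero
  have hsplit : ∑ i : S, d i * B i = ∑ i : S, w i ^ p * B i + ∑ i : S, (d i - w i ^ p) * B i := by
    rw [← Finset.sum_add_distrib]; exact Finset.sum_congr rfl fun i _ => by ring
  have h1 : O.valuation (∑ i : S, w i ^ p * B i) = 1 := hPI w hwO ⟨i₀, hwi₀⟩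
  have h2 : O.valuation (∑ i : S, (d i - w i ^ p) * B i) < 1 := by
    refine Valuation.map_sum_lt _ one_ne_zero fun i _ => ?_
    rw [map_mul, hBv i, mul_one]; exact hw i
  have hdsum : O.valuation (∑ i : S, d i * B i) = 1 := by
    rw [hsplit, Valuation.map_add_eq_of_lt_left]
    · exact h1
    · rw [h1]; exact h2
  have hcsum : ∑ i : S, c i * B i = c i₀ * ∑ i : S, d i * B i := by
    rw [Finset.mul_sum]
    exact Finset.sum_congr rfl fun i _ => by simp only [hd]; rw [← mul_assoc, mul_div_cancel₀ _ hc0]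
  rw [hcsum, map_mul, hdsum, mul_one, hsup]

/-- **Residual `p`-independence from a non-`p`-th-power residue.**  If the `v`-unit `m` is NOT congruent to a `p`-th power modulo
`𝔪_v`, then `1, m, …, m^{p-1}` are residually `p`-independent: in the residue field `κ` the class `m̄ ∉ κ^p` has minimal polynomial
`X^p - m̄^p` over `κ^p` (✓ `ImmediateValues.minpoly_eq_X_pow_sub_C` applied to the field `κ`), so no non-trivial `κ^p`-relation of
degree `< p` exists. [folklore] -/
theorem residuallyPIndependent_of_not_residue_pthPower {p : ℕ} [Fact p.Prime] {K : Type} [Field K] [CharP K p]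
    (O : ValuationSubring K) (m : K) (hvm : O.valuation m = 1) (H : ∀ w : K, 1 ≤ O.valuation (m - w ^ p)) :
    ResiduallyPIndependent p O m := by
  classical
  have hp : p.Prime := Fact.out
  intro w hwO hunit
  obtain ⟨i₁, hi₁⟩ := hunit
  -- the residue field `κ` of `O`, of characteristic `p`
  haveI hOchar : CharP O p := (O.subtype).charP Subtype.val_injective p
  haveI : CharP (IsLocalRing.ResidueField O) p :=
    (RingHom.charP_iff_charP ((IsLocalRing.residue O).comp (ZMod.castHom (dvd_refl p) O)) p).mp (ZMod.charP p)
  have hmO : m ∈ O := (O.valuation_le_one_iff m).mp hvm.le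
  set mO : O := ⟨m, hmO⟩ with hmOdef
  set wO : Fin p → O := fun i => ⟨w i, hwO i⟩ with hwOdef
  set mbar : IsLocalRing.ResidueField O := IsLocalRing.residue O mO with hmbar
  -- `m̄` is not a `p`-th power in `κ`
  have hmnp : ∀ c : IsLocalRing.ResidueField O, c ^ p ≠ mbar := by
    intro c hc
    obtain ⟨cO, rfl⟩ := IsLocalRing.residue_surjective c
    have h0 : IsLocalRing.residue O (mO - cO ^ p) = 0 := by rw [map_sub, map_pow, hc, hmbar, sub_self]
    rw [IsLocalRing.residue_eq_zero_iff] at h0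
    have hlt : O.valuation (((mO - cO ^ p : O)) : K) < 1 := (O.valuation_lt_one_iff _).mp h0
    have hlt' : O.valuation (m - (cO : K) ^ p) < 1 := by
      have : (((mO - cO ^ p : O)) : K) = m - (cO : K) ^ p := by rw [hmOdef]; push_cast; rfl
      rw [← this]; exact hlt
    exact absurd (H (cO : K)) (not_le.mpr hlt')
  -- the element `S = Σ w_i^p m^i ∈ O`; suppose `v S < 1`
  set SO : O := ∑ i : Fin p, wO i ^ p * mO ^ (i : ℕ) with hSOdef
  have hS : ((SO : O) : K) = ∑ i : Fin p, w i ^ p * m ^ (i : ℕ) := by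
    rw [hSOdef]; push_cast; rfl
  have hle : O.valuation (∑ i : Fin p, w i ^ p * m ^ (i : ℕ)) ≤ 1 := by
    rw [← hS]; exact (O.valuation_le_one_iff _).mpr SO.2
  by_contra hne
  have hlt : O.valuation (∑ i : Fin p, w i ^ p * m ^ (i : ℕ)) < 1 := lt_of_le_of_ne hle hne
  rw [← hS, ← O.valuation_lt_one_iff] at hlt
  have hres : IsLocalRing.residue O SO = 0 := (IsLocalRing.residue_eq_zero_iff _).mpr hlt
  have hsum : ∑ i : Fin p, IsLocalRing.residue O (wO i) ^ p * mbar ^ (i : ℕ) = 0 := by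
    rw [← hres, hSOdef, map_sum]
    exact Finset.sum_congr rfl fun i _ => by rw [map_mul, map_pow, map_pow, hmbar]
  -- the `κ^p`-polynomial of degree `< p` killing `m̄`
  set Fκ : Subfield (IsLocalRing.ResidueField O) := (frobenius (IsLocalRing.ResidueField O) p).fieldRange with hFκ
  let coef : Fin p → Fκ := fun i =>
    ⟨IsLocalRing.residue O (wO i) ^ p, RingHom.mem_fieldRange.mpr ⟨IsLocalRing.residue O (wO i), frobenius_def _ _⟩⟩
  set P : Polynomial Fκ := ∑ i : Fin p, Polynomial.C (coef i) * Polynomial.X ^ (i : ℕ) with hPdef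
  have hPeval : Polynomial.aeval mbar P = 0 := by
    rw [hPdef, map_sum]
    rw [← hsum]
    refine Finset.sum_congr rfl fun i _ => ?_
    rw [map_mul, map_pow, Polynomial.aeval_C, Polynomial.aeval_X]
    rfl
  have hcoef : ∀ i : Fin p, P.coeff (i : ℕ) = coef i := by
    intro i
    rw [hPdef, Polynomial.finsetSum_coeff]
    rw [Finset.sum_eq_single i]
    · rw [Polynomial.coeff_C_mul_X_pow, if_pos rfl]
    · intro j _ hji
      rw [Polynomial.coeff_C_mul_X_pow, if_neg]
      exact fun h => hji (Fin.ext h).symm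
    · intro h; exact absurd (Finset.mem_univ i) h
  have hP0 : P ≠ 0 := by
    intro h
    have h1 := hcoef i₁
    rw [h, Polynomial.coeff_zero] at h1
    have h2 : IsLocalRing.residue O (wO i₁) ^ p = 0 := by
      have := congrArg Subtype.val h1.symm
      simpa [coef] using this
    have h3 : IsLocalRing.residue O (wO i₁) = 0 := (pow_eq_zero_iff hp.ne_zero).mp h2
    rw [IsLocalRing.residue_eq_zero_iff] at h3
    have h4 : O.valuation ((wO i₁ : O) : K) < 1 := (O.valuation_lt_one_iff _).mp h3
    have : ((wO i₁ : O) : K) = w i₁ := rfl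
    rw [this, hi₁] at h4
    exact lt_irrefl _ h4
  have hPdeg : P.natDegree < p := by
    have hd : P.degree < p := by rw [hPdef]; exact Polynomial.degree_sum_fin_lt coef
    exact (Polynomial.natDegree_lt_iff_degree_lt hP0).mpr hd
  -- the minimal polynomial of `m̄` over `κ^p` has degree `p` and divides `P`: contradiction
  have hmin := ImmediateValues.minpoly_eq_X_pow_sub_C (p := p) mbar hmnp
  have hdvd := minpoly.dvd Fκ mbar hPeval
  have hdeg := Polynomial.natDegree_le_of_dvd hdvd hP0
  rw [hmin, Polynomial.natDegree_X_pow_sub_C] at hdeg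
  exact absurd hPdeg (not_lt.mpr hdeg)

/-- **IR (immediate residues of `K^p(g₀)`).**  If `g₀` has no best `p`-th-power approximation (`hdefect`: the radicial extension
`K(g₀^{1/p})/K` is immediate for `v`), every `v`-unit of `M = K^p(g₀)` is congruent to a `p`-th power modulo `𝔪_v`.  PROVED:
if not, `1, m, …, m^{p-1}` are residually `p`-independent (previous lemma), hence RG holds for `m` over `K^p` (§C); then, exactly as in
✓ `ImmediateValues.exists_valuation_eq_pthPower_of_noBestApprox`, `g₀ = Σ a_i m^i` over `K^p` and `a₀ = α₀^p` is a BEST `p`-th-power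
approximation of `g₀`, contradicting `hdefect`. [folklore] -/
theorem immediateResidues_of_noBestApprox {p : ℕ} [Fact p.Prime] {K : Type} [Field K] [CharP K p] (O : ValuationSubring K)
    (g₀ : K)
    (hdefect : ∀ f₀ : K, ∃ f₁ : K, O.valuation (g₀ - f₁ ^ p) < O.valuation (g₀ - f₀ ^ p))
    (M : Subfield K) (hM : ∀ x : K, x ∈ M ↔ ∃ c : Fin p → K, ∑ j, c j ^ p * g₀ ^ (j : ℕ) = x)
    (m : K) (hm : m ∈ M) (hvm : O.valuation m = 1) : ∃ w : K, O.valuation (m - w ^ p) < 1 := by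
  classical
  have hpp : p.Prime := Fact.out
  haveI : NeZero p := ⟨hpp.ne_zero⟩
  by_contra Hn
  push Not at Hn
  have hPI := residuallyPIndependent_of_not_residue_pthPower O m hvm Hn
  have hm0 : m ≠ 0 := fun h => by rw [h, map_zero] at hvm; exact zero_ne_one hvm
  set F : Subfield K := (frobenius K p).fieldRange with hF_def
  have hpowF : ∀ x : K, x ^ p ∈ F := fun x => RingHom.mem_fieldRange.mpr ⟨x, frobenius_def p x⟩
  have hFpow : ∀ a : K, a ∈ F → ∃ α : K, α ^ p = a := fun a ha => by
    obtain ⟨α, hα⟩ := RingHom.mem_fieldRange.mp ha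
    exact ⟨α, by rw [← hα, frobenius_def]⟩
  -- RG for `m` over `K^p` (§C with IR for `K^p` trivial)
  have hIRF : ∀ a : K, a ∈ F → O.valuation a = 1 → ∃ w : K, O.valuation (a - w ^ p) < 1 := by
    intro a ha _
    obtain ⟨α, rfl⟩ := hFpow a ha
    exact ⟨α, by rw [sub_self, map_zero]; exact zero_lt_one⟩
  have hRGm : ∀ c : Fin p → K, (∀ i, c i ∈ F) →
      O.valuation (∑ i : Fin p, c i * m ^ (i : ℕ)) = Finset.univ.sup (fun i => O.valuation (c i)) :=
    fun c hc => valuation_sum_mul_pow_eq_sup O F hIRF m hPI c hc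
  have hLI : LinearIndependent F (fun i : Fin p => m ^ (i : ℕ)) := by
    rw [Fintype.linearIndependent_iff]
    intro g hg i
    have hsum : ∑ i, (g i : K) * m ^ (i : ℕ) = 0 := by
      have : ∑ i, (g i : K) * m ^ (i : ℕ) = ∑ i, g i • m ^ (i : ℕ) :=
        Finset.sum_congr rfl fun i _ => (Subfield.smul_def (g i) _).symm
      rw [this, hg]
    have hv := hRGm (fun i => (g i : K)) (fun i => (g i).2)
    rw [hsum, map_zero] at hv
    have hle : O.valuation (g i : K) ≤ Finset.univ.sup (fun i => O.valuation (g i : K)) :=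
      Finset.le_sup (f := fun i => O.valuation (g i : K)) (Finset.mem_univ i)
    rw [← hv, le_zero_iff, map_eq_zero] at hle
    exact_mod_cast hle
  -- `g₀` in the `K^p`-basis `1, m, …, m^{p-1}` of `V(g₀)` (verbatim from ✓ `exists_valuation_eq_pthPower_of_noBestApprox`)
  set V : Submodule F K := Submodule.span F (Set.range fun j : Fin p => g₀ ^ (j : ℕ)) with hV_def
  haveI : Module.Finite F V := Module.Finite.span_of_finite F (Set.finite_range _)
  have hVfin : Module.finrank F V ≤ p := ImmediateValues.finrank_span_powers_le g₀
  have hg₀V : g₀ ∈ V := ImmediateValues.self_mem_span_powers g₀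
  have hmV : m ∈ V := by
    obtain ⟨c, rfl⟩ := (hM m).mp hm
    exact (ImmediateValues.mem_span_powers_iff g₀ _).mpr ⟨c, rfl⟩
  have hmpow : ∀ n : ℕ, m ^ n ∈ V := by
    intro n
    induction n with
    | zero => simpa using ImmediateValues.one_mem_span_powers (p := p) g₀
    | succ n ih => rw [pow_succ]; exact ImmediateValues.mul_mem_span_powers g₀ ih hmV
  set b : Fin p → V := fun i => ⟨m ^ (i : ℕ), hmpow i⟩ with hb_def
  have hbLI : LinearIndependent F b := by apply LinearIndependent.of_comp V.subtype; exact hLI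
  have hcard : Fintype.card (Fin p) = Module.finrank F V :=
    le_antisymm (hbLI.fintype_card_le_finrank) (by simpa using hVfin)
  haveI : Nonempty (Fin p) := ⟨⟨0, hpp.pos⟩⟩
  have hspan : Submodule.span F (Set.range b) = ⊤ := hbLI.span_eq_top_of_card_eq_finrank hcard
  have hg₀span : (⟨g₀, hg₀V⟩ : V) ∈ Submodule.span F (Set.range b) := by rw [hspan]; exact Submodule.mem_top
  obtain ⟨a, ha⟩ := (Submodule.mem_span_range_iff_exists_fun F).mp hg₀span
  have haK : ∑ i, (a i : K) * m ^ (i : ℕ) = g₀ := by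
    have := congrArg Subtype.val ha; simpa [hb_def, Subfield.smul_def] using this
  set j0 : Fin p := ⟨0, hpp.pos⟩ with hj0_def
  obtain ⟨α₀, hα₀⟩ := hFpow (a j0) (a j0).2
  set T := ∑ i ∈ (Finset.univ : Finset (Fin p)).erase j0, (a i : K) * m ^ (i : ℕ) with hT_def
  have hgT : g₀ - α₀ ^ p = T := by
    rw [← haK, ← Finset.add_sum_erase Finset.univ (fun i => (a i : K) * m ^ (i : ℕ)) (Finset.mem_univ j0), hα₀]
    simp [hj0_def, hT_def]
  -- `α₀` is a best approximation: by RG over `K^p`, `v (g₀ - f^p) = sup (v ((α₀ - f)^p), v (a_i), i ≥ 1) ≥ v T`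
  have hbound : ∀ f : K, O.valuation T ≤ O.valuation (g₀ - f ^ p) := by
    intro f
    let a' : Fin p → K := fun i => if i = j0 then (α₀ - f) ^ p else (a i : K)
    have ha'F : ∀ i, a' i ∈ F := by
      intro i; by_cases hi : i = j0 <;> simp only [a', hi, if_true, if_false]; exact hpowF _; exact (a i).2
    let a'' : Fin p → K := fun i => if i = j0 then 0 else (a i : K)
    have ha''F : ∀ i, a'' i ∈ F := by
      intro i; by_cases hi : i = j0 <;> simp only [a'', hi, if_true, if_false]; exact F.zero_mem; exact (a i).2
    have hTsum : T = ∑ i ∈ (Finset.univ : Finset (Fin p)).erase j0, a' i * m ^ (i : ℕ) := by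
      refine Finset.sum_congr rfl fun i hi => ?_
      have hij : i ≠ j0 := Finset.ne_of_mem_erase hi
      simp only [a', hij, if_false]
    have hTsum' : T = ∑ i, a'' i * m ^ (i : ℕ) := by
      rw [← Finset.add_sum_erase Finset.univ (fun i => a'' i * m ^ (i : ℕ)) (Finset.mem_univ j0)]
      have hrest : ∑ i ∈ (Finset.univ : Finset (Fin p)).erase j0, a'' i * m ^ (i : ℕ) = T := by
        refine Finset.sum_congr rfl fun i hi => ?_
        have hij : i ≠ j0 := Finset.ne_of_mem_erase hi
        simp only [a'', hij, if_false]
      rw [hrest]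
      simp only [a'', if_true, zero_mul, zero_add]
    have hdiff : g₀ - f ^ p = ∑ i, a' i * m ^ (i : ℕ) := by
      rw [← Finset.add_sum_erase Finset.univ (fun i => a' i * m ^ (i : ℕ)) (Finset.mem_univ j0), ← hTsum, ← hgT]
      simp only [a', if_true, hj0_def]; rw [sub_pow_char]; ring
    rw [hdiff, hRGm a' ha'F, hTsum', hRGm a'' ha''F]
    refine Finset.sup_mono_fun fun i _ => ?_
    by_cases hi : i = j0
    · simp only [a', a'', hi, if_true, map_zero]; exact zero_le
    · simp only [a', a'', hi, if_false]; exact le_rfl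
  obtain ⟨f₁, hf₁⟩ := hdefect α₀
  rw [hgT] at hf₁
  exact absurd (hbound f₁) (not_le.mpr hf₁)

/-! ### §C′ Bridge B1 in the `k`-RATIONAL case: for a valuation with residue field `k` (every element of `O` is congruent to a constant),
residual `p`-independence of `b` read in `K` is just `k^p`-linear independence of `b` in `k` (so (FIN)+(RPI-fam) = «`b` is a `p`-basis-monomial
basis of `k` over `k^p`»).  The general bridge («`κ_v/k` separable algebraic», Mac Lane) is by hand in the memo (§17/§18), not formalised. -/

/-- Constants are `v`-units. [folklore] -/
theorem valuation_algebraMap_eq_one {k K : Type} [Field k] [Field K] [Algebra k K] (O : ValuationSubring K)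
    (hk : ∀ c : k, algebraMap k K c ∈ O) {c : k} (hc : c ≠ 0) : O.valuation (algebraMap k K c) = 1 := by
  have h1 : O.valuation (algebraMap k K c) ≤ 1 := (O.valuation_le_one_iff _).mpr (hk c)
  have h2 : O.valuation (algebraMap k K c⁻¹) ≤ 1 := (O.valuation_le_one_iff _).mpr (hk c⁻¹)
  have hprod : O.valuation (algebraMap k K c) * O.valuation (algebraMap k K c⁻¹) = 1 := by
    rw [← map_mul, ← map_mul, mul_inv_cancel₀ hc, map_one, map_one]
  refine le_antisymm h1 ?_
  calc (1 : _) = O.valuation (algebraMap k K c) * O.valuation (algebraMap k K c⁻¹) := hprod.symm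
    _ ≤ O.valuation (algebraMap k K c) * 1 := by gcongr
    _ = O.valuation (algebraMap k K c) := mul_one _

/-- **Bridge B1, `k`-rational case.**  If the residue field of `v` is `k` (`hrat`: every `x ∈ O` is `≡` a constant mod `𝔪_v`) and the finite
family `b` is `k^p`-linearly independent in `k` (`hbli`, in-`k` elementary form), then `b` is residually `p`-independent along `v`. [folklore] -/
theorem residuallyPIndependentFamily_of_rational (p : ℕ) [Fact p.Prime] {k K : Type} [Field k] [CharP k p] [Field K] [Algebra k K]
    (O : ValuationSubring K) (hk : ∀ c : k, algebraMap k K c ∈ O)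
    (hrat : ∀ x : K, x ∈ O → ∃ c : k, O.valuation (x - algebraMap k K c) < 1)
    {S : Type} [Fintype S] (b : S → k) (hbli : ∀ d : S → k, ∑ s, d s ^ p * b s = 0 → ∀ s, d s = 0) :
    ResiduallyPIndependentFamily p O (fun s => algebraMap k K (b s)) := by
  classical
  have hp : p.Prime := Fact.out
  haveI : CharP K p := charP_of_injective_algebraMap (algebraMap k K).injective p
  intro w hw hw1
  obtain ⟨s₀, hs₀⟩ := hw1
  choose c hc using fun s => hrat (w s) (hw s)
  -- the unit coefficient has a non-zero constant
  have hc₀ : c s₀ ≠ 0 := by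
    intro h0
    have := hc s₀
    rw [h0, map_zero, sub_zero, hs₀] at this
    exact lt_irrefl _ this
  -- hence the constant combination is a non-zero constant, a `v`-unit
  have hsum0 : ∑ s, c s ^ p * b s ≠ 0 := fun h0 => hc₀ (hbli c h0 s₀)
  have hunit : O.valuation (algebraMap k K (∑ s, c s ^ p * b s)) = 1 := valuation_algebraMap_eq_one O hk hsum0
  -- the difference lies in `𝔪_v`
  set D : K := ∑ s, (w s ^ p - algebraMap k K (c s) ^ p) * algebraMap k K (b s) with hD
  have hDlt : O.valuation D < 1 := by
    refine Valuation.map_sum_lt _ one_ne_zero fun s _ => ?_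
    rw [← sub_pow_char, map_mul, map_pow]
    have hb1 : O.valuation (algebraMap k K (b s)) ≤ 1 := (O.valuation_le_one_iff _).mpr (hk _)
    calc O.valuation (w s - algebraMap k K (c s)) ^ p * O.valuation (algebraMap k K (b s))
        ≤ O.valuation (w s - algebraMap k K (c s)) ^ p * 1 := by gcongr
      _ = O.valuation (w s - algebraMap k K (c s)) ^ p := mul_one _
      _ < 1 := pow_lt_one₀ zero_le (hc s) hp.ne_zero
  have hsplit : ∑ s, w s ^ p * algebraMap k K (b s) = algebraMap k K (∑ s, c s ^ p * b s) + D := by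
    rw [hD, map_sum, ← Finset.sum_add_distrib]
    refine Finset.sum_congr rfl fun s _ => ?_
    rw [map_mul, map_pow]; ring
  rw [hsplit, Valuation.map_add_eq_of_lt_left _ (by rw [hunit]; exact hDlt), hunit]

/-! ### §B″ Currency of T′_∞ (ARBITRARY `p`-rank, new in this file): a `p`-spanning family of `k` indexed by ANY type `S`, residually
`p`-independent along `v` on every finite subfamily; all sums finitely supported -/

/-- **A `p`-spanning family of `k` indexed by an arbitrary type**: every `c ∈ k` is a FINITE sum `Σ_{s ∈ s₀} d_s^p b_s`.  EVERY field of
characteristic `p` has one (the monomials with exponents `< p` in a `p`-basis — or simply `b := id`); `S` must be infinite iff `[k : k^p] = ∞`. [folklore] -/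
def IsPSpanningFamilyInf (p : ℕ) {k : Type} [Field k] {S : Type} (b : S → k) : Prop :=
    ∀ c : k, ∃ (s : Finset S) (d : S → k), c = ∑ i ∈ s, d i ^ p * b i

/-- **Residual `p`-independence of an arbitrary family** `B : S → K` along `v` (in-`K` form): on every finite `s₀ ⊆ S`,
`Σ_{s ∈ s₀} w_s^p B_s` is a `v`-unit whenever the `w_s ∈ O` are not all in `𝔪_v` on `s₀`.  For `B = b` a `p`-spanning family of `k ⊆ O`
this says (MacLane) that `κ_v/k` is SEPARABLE and `b` stays `p`-independent in `κ_v`. [folklore] -/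
def ResiduallyPIndependentFamilyInf (p : ℕ) {K : Type} [Field K] (O : ValuationSubring K) {S : Type} (B : S → K) : Prop :=
    ∀ (s : Finset S) (w : S → K), (∀ i, w i ∈ O) → (∃ i ∈ s, O.valuation (w i) = 1) →
      O.valuation (∑ i ∈ s, w i ^ p * B i) = 1

/-- **THEOREM T′_∞'s slice**: `stub_cleanLU3DefectNonDiscrete` at `p` on {`[Γ : pΓ] = p²`, `K/k` separably generated, `k` of ARBITRARY
(possibly infinite) `p`-rank carrying a `p`-spanning family residually `p`-independent along `v`} — NO `PerfectField k`, NO finiteness of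
`[k : k^p]`. [folklore] -/
def CleanLU3DefectPRankTwoSepInfAt (p : ℕ) : Prop :=
    ∀ (k : Type) [Field k] [CharP k p] (K : Type) [Field K] [Algebra k K]
    (O : ValuationSubring K) (A : Subalgebra k K), A.toSubring ≤ O.toSubring → A.FG → IsFractionRing A K →
    ringKrullDim A ≤ 3 → IsRegularLocalRing (locAtCentre A.toSubring O) →
    ringKrullDim (locAtCentre A.toSubring O) = 3 →
    (∀ (T : Subring K) (hT : T ≤ O.toSubring), A.toSubring ≤ T → (subringCentre T O hT).IsMaximal) →
    ∀ g₀ : K, (∀ c : K, c ^ p ≠ g₀) →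
    (∀ f₀ : K, ∃ f₁ : K, O.valuation (g₀ - f₁ ^ p) < O.valuation (g₀ - f₀ ^ p)) →
    (∀ hk : ∀ c : k, algebraMap k K c ∈ O, transcendenceDefect k O hk ≠ 0) →
    ¬ (∃ π : K, π ≠ 0 ∧ (∀ x : K, O.valuation x < 1 → O.valuation x ≤ O.valuation π) ∧
      (∀ x : K, x ≠ 0 → ∃ n : ℕ, O.valuation π ^ n ≤ O.valuation x)) →
    PRankTwoAt p O → SepGenerated k K →
    ∀ (S : Type) (b : S → k), IsPSpanningFamilyInf p b →
    ResiduallyPIndependentFamilyInf p O (fun s => algebraMap k K (b s)) →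
    CleanLUConcl p k K O A g₀

/-- Restriction of a residually `p`-independent family to a finite subfamily (the finite notion of §B′ on the subtype `↥s`). [folklore] -/
theorem residuallyPIndependentFamily_restrict {p : ℕ} {K : Type} [Field K] (O : ValuationSubring K) {S : Type} (B : S → K)
    (hPI : ResiduallyPIndependentFamilyInf p O B) (s : Finset S) :
    ResiduallyPIndependentFamily p O (fun i : ↥s => B i) := by
  classical
  intro w hw hw1
  let w' : S → K := fun j => if h : j ∈ s then w ⟨j, h⟩ else 0
  have hw'in : ∀ i : ↥s, w' i = w i := fun i => by
    show (if h : (i : S) ∈ s then w ⟨i, h⟩ else 0) = w i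
    rw [dif_pos i.2]
  have hw'out : ∀ j, j ∉ s → w' j = 0 := fun j hj => by
    show (if h : j ∈ s then w ⟨j, h⟩ else 0) = 0
    rw [dif_neg hj]
  have hsum : ∑ i : ↥s, w i ^ p * B i = ∑ j ∈ s, w' j ^ p * B j := by
    rw [← Finset.sum_coe_sort s]
    exact Finset.sum_congr rfl fun i _ => by rw [hw'in i]
  rw [hsum]
  refine hPI s w' (fun j => ?_) ?_
  · by_cases h : j ∈ s
    · rw [show w' j = w ⟨j, h⟩ from hw'in ⟨j, h⟩]; exact hw _
    · rw [hw'out j h]; exact O.zero_mem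
  · obtain ⟨i, hi⟩ := hw1
    exact ⟨i, i.2, by rw [hw'in i]; exact hi⟩

/-- A finite `p`-spanning family (§B′) is a `p`-spanning family in the sense of §B″. [folklore] -/
theorem isPSpanningFamilyInf_of_fintype {p : ℕ} {k : Type} [Field k] {S : Type} [Fintype S] (b : S → k)
    (hb : IsPSpanningFamily p b) : IsPSpanningFamilyInf p b := fun c => by
  obtain ⟨d, hd⟩ := hb c
  exact ⟨Finset.univ, d, hd⟩

/-- A finite residually `p`-independent family (§B′) is residually `p`-independent in the sense of §B″ (`p ≠ 0`). [folklore] -/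
theorem residuallyPIndependentFamilyInf_of_fintype {p : ℕ} (hp : p ≠ 0) {K : Type} [Field K] (O : ValuationSubring K)
    {S : Type} [Fintype S] (B : S → K) (hPI : ResiduallyPIndependentFamily p O B) :
    ResiduallyPIndependentFamilyInf p O B := by
  classical
  intro s w hw hw1
  let w' : S → K := fun j => if j ∈ s then w j else 0
  have hin : ∀ j ∈ s, w' j = w j := fun j hj => by
    show (if j ∈ s then w j else 0) = w j
    rw [if_pos hj]
  have hout : ∀ j, j ∉ s → w' j = 0 := fun j hj => by
    show (if j ∈ s then w j else 0) = 0
    rw [if_neg hj]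
  have hsum : ∑ j ∈ s, w j ^ p * B j = ∑ j : S, w' j ^ p * B j := by
    have h1 : ∑ j ∈ s, w' j ^ p * B j = ∑ j : S, w' j ^ p * B j :=
      Finset.sum_subset (Finset.subset_univ s) (fun j _ hj => by rw [hout j hj, zero_pow hp, zero_mul])
    rw [← h1]
    exact Finset.sum_congr rfl fun j hj => by rw [hin j hj]
  rw [hsum]
  refine hPI w' (fun j => ?_) ?_
  · by_cases h : j ∈ s
    · rw [hin j h]; exact hw _
    · rw [hout j h]; exact O.zero_mem
  · obtain ⟨i, hi, hvi⟩ := hw1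
    exact ⟨i, by rw [hin i hi]; exact hvi⟩

/-- Finite-product sums against the subtype of a `Finset` (bookkeeping). [folklore] -/
theorem sum_product_univ_eq_sum_subtype {S F : Type} [Fintype F] {N : Type} [AddCommMonoid N] (S₀ : Finset S) (g : S × F → N) :
    ∑ l ∈ S₀ ×ˢ (Finset.univ : Finset F), g l = ∑ l : ↥S₀ × F, g ((l.1 : S), l.2) := by
  classical
  rw [Finset.sum_product, Fintype.sum_prod_type, ← Finset.sum_coe_sort]

/-! ## §D PORT 1′ — the doubly graded data -/

/-- **DG (double grading, term ≤ sum).**  Under (V) for `M`, (P2) for `x, y`, `v (B s) = 1` and RG for the finite family `B`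
over `M`, each term of `Σ_{s,(a,b)} m_{s,ab} B_s x^a y^b` (`m ∈ M`) is bounded by the sum: the inner sums `c_{ab} := Σ_s m_{s,ab} B_s`
have `v(c_{ab}) = max_s v(m_{s,ab}) = v(m_{s₀,ab})` (RG), so the outer terms have pairwise distinct values (✓ `GradedBasis.monomial_values_ne`
with the representatives `m_{s₀,ab} ∈ M`). [folklore] -/
theorem valuation_term_le_double_sum {p : ℕ} (hp : p.Prime) {K : Type} [Field K] (O : ValuationSubring K) (M : Subfield K)
    (hV : ∀ m : K, m ∈ M → m ≠ 0 → ∃ z : K, z ≠ 0 ∧ O.valuation m = O.valuation (z ^ p))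
    {S : Type} [Fintype S] (B : S → K) (hB1 : ∀ s, O.valuation (B s) = 1)
    (hRG : ∀ c : S → K, (∀ i, c i ∈ M) →
      O.valuation (∑ i : S, c i * B i) = Finset.univ.sup (fun i => O.valuation (c i)))
    {x y : K} (hx : x ≠ 0) (hy : y ≠ 0)
    (hP : ∀ a b : ℕ, a < p → b < p → (a ≠ 0 ∨ b ≠ 0) → ∀ z : K, z ≠ 0 → O.valuation (x ^ a * y ^ b) ≠ O.valuation (z ^ p))
    (m : S × (Fin p × Fin p) → K) (hm : ∀ l, m l ∈ M) (l₀ : S × (Fin p × Fin p)) :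
    O.valuation (m l₀ * (B l₀.1 * (x ^ (l₀.2.1 : ℕ) * y ^ (l₀.2.2 : ℕ)))) ≤
      O.valuation (∑ l, m l * (B l.1 * (x ^ (l.2.1 : ℕ) * y ^ (l.2.2 : ℕ)))) := by
  classical
  haveI : NeZero p := ⟨hp.ne_zero⟩
  set mon : Fin p × Fin p → K := fun ab => x ^ (ab.1 : ℕ) * y ^ (ab.2 : ℕ) with hmon
  set c : Fin p × Fin p → K := fun ab => ∑ i : S, m (i, ab) * B i with hc
  have hsum : ∑ l, m l * (B l.1 * (x ^ (l.2.1 : ℕ) * y ^ (l.2.2 : ℕ))) = ∑ ab, c ab * mon ab := by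
    rw [Fintype.sum_prod_type, Finset.sum_comm]
    refine Finset.sum_congr rfl fun ab _ => ?_
    rw [hc, hmon]
    simp only
    rw [Finset.sum_mul]
    exact Finset.sum_congr rfl fun i _ => by ring
  have hvc : ∀ ab, O.valuation (c ab) = Finset.univ.sup (fun i => O.valuation (m (i, ab))) :=
    fun ab => hRG _ (fun i => hm (i, ab))
  -- argmax representative of each non-zero coefficient
  have hrep : ∀ ab, c ab ≠ 0 → ∃ i₀, m (i₀, ab) ≠ 0 ∧ O.valuation (c ab) = O.valuation (m (i₀, ab)) := by
    intro ab hcab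
    have hne : (Finset.univ : Finset S).Nonempty := by
      rw [Finset.univ_nonempty_iff]
      by_contra hS
      apply hcab
      rw [hc]
      exact Finset.sum_eq_zero fun i _ => (hS ⟨i⟩).elim
    obtain ⟨i₀, -, hi₀⟩ := Finset.exists_max_image Finset.univ (fun i => O.valuation (m (i, ab))) hne
    have hsup : Finset.univ.sup (fun i => O.valuation (m (i, ab))) = O.valuation (m (i₀, ab)) :=
      le_antisymm (Finset.sup_le fun i hi => hi₀ i hi) (Finset.le_sup (f := fun i => O.valuation (m (i, ab))) (Finset.mem_univ i₀))
    refine ⟨i₀, ?_, (hvc ab).trans hsup⟩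
    intro h0
    apply hcab
    have : O.valuation (c ab) = 0 := by rw [hvc ab, hsup, h0, map_zero]
    exact (map_eq_zero _).mp this
  -- pairwise distinct values of the `(a, b)`-terms
  have hpw : ∀ i ∈ (Finset.univ : Finset (Fin p × Fin p)), ∀ j ∈ (Finset.univ : Finset (Fin p × Fin p)), i ≠ j →
      c i * mon i ≠ 0 → O.valuation (c i * mon i) ≠ O.valuation (c j * mon j) := by
    intro i _ j _ hij hi0
    have hci : c i ≠ 0 := fun h0 => hi0 (by rw [h0, zero_mul])
    by_cases hcj : c j = 0
    · rw [hcj, zero_mul, map_zero]; exact (Valuation.ne_zero_iff _).mpr hi0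
    obtain ⟨a₀, ha₀, hva₀⟩ := hrep i hci
    obtain ⟨b₀, hb₀, hvb₀⟩ := hrep j hcj
    have hne := GradedBasis.monomial_values_ne hp O.valuation M hV hx hy hP i j hij (m (a₀, i)) (m (b₀, j)) (hm _) (hm _) ha₀ hb₀
    intro heq
    apply hne
    rw [Valuation.map_mul _ (m (a₀, i)), Valuation.map_mul _ (m (b₀, j)), ← hva₀, ← hvb₀, ← Valuation.map_mul,
      ← Valuation.map_mul]
    simpa only [hmon] using heq
  have houter : O.valuation (∑ ab, c ab * mon ab) = Finset.univ.sup (fun ab => O.valuation (c ab * mon ab)) :=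
    GradedBasis.valuation_sum_eq_sup_of_pairwise O.valuation Finset.univ _ hpw
  have hml₀ : m l₀ = m (l₀.1, l₀.2) := by rw [Prod.mk.eta]
  calc O.valuation (m l₀ * (B l₀.1 * (x ^ (l₀.2.1 : ℕ) * y ^ (l₀.2.2 : ℕ))))
        = O.valuation (m l₀) * O.valuation (mon l₀.2) := by
          rw [map_mul, map_mul, hB1, one_mul]
    _ ≤ O.valuation (c l₀.2) * O.valuation (mon l₀.2) := by
          apply mul_le_mul_left
          rw [hvc, hml₀]
          exact Finset.le_sup (f := fun i => O.valuation (m (i, l₀.2))) (Finset.mem_univ l₀.1)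
    _ = O.valuation (c l₀.2 * mon l₀.2) := (map_mul _ _ _).symm
    _ ≤ O.valuation (∑ ab, c ab * mon ab) := by
          rw [houter]; exact Finset.le_sup (f := fun ab => O.valuation (c ab * mon ab)) (Finset.mem_univ l₀.2)
    _ = _ := by rw [hsum]


/-! ## §D∞ PORT 1′_∞ — the doubly graded data for an ARBITRARY residually `p`-independent `p`-spanning family (new) -/

/-- **`K^p`-linear independence of `1, g₀, …, g₀^{p-1}`** for `g₀ ∉ K^p` (`minpoly_{K^p} g₀ = X^p − g₀^p` has degree `p`). [folklore] -/
theorem pthPowers_linearIndependent_powers {p : ℕ} [Fact p.Prime] {K : Type} [Field K] [CharP K p]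
    (g₀ : K) (hg₀ : ∀ c : K, c ^ p ≠ g₀) (ν : Fin p → K) (hν : ∀ i, ν i ∈ (frobenius K p).fieldRange)
    (hsum : ∑ i : Fin p, ν i * g₀ ^ (i : ℕ) = 0) : ∀ i, ν i = 0 := by
  classical
  have hp : p.Prime := Fact.out
  set Kp : Subfield K := (frobenius K p).fieldRange with hKpdef
  set q : Polynomial Kp := ∑ i : Fin p, Polynomial.C (⟨ν i, hν i⟩ : Kp) * Polynomial.X ^ (i : ℕ) with hqdef
  have hq : Polynomial.aeval g₀ q = 0 := by
    rw [hqdef, map_sum]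
    simp only [map_mul, map_pow, Polynomial.aeval_C, Polynomial.aeval_X]
    exact hsum
  by_contra hne
  push Not at hne
  obtain ⟨i₀, hi₀⟩ := hne
  have hcoeff : ∀ i : Fin p, q.coeff i = ⟨ν i, hν i⟩ := by
    intro i
    rw [hqdef, Polynomial.finsetSum_coeff]
    simp only [Polynomial.coeff_C_mul, Polynomial.coeff_X_pow]
    rw [Finset.sum_eq_single i]
    · simp
    · intro j _ hj
      have : (i : ℕ) ≠ (j : ℕ) := fun h => hj (Fin.ext h).symm
      simp [this]
    · intro h; exact absurd (Finset.mem_univ i) h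
  have hq0 : q ≠ 0 := by
    intro h
    have := hcoeff i₀
    rw [h, Polynomial.coeff_zero] at this
    exact hi₀ (by have h' := congrArg Subtype.val this; simpa using h'.symm)
  have hdeg := minpoly.degree_le_of_ne_zero Kp g₀ hq0 hq
  rw [ImmediateValues.minpoly_eq_X_pow_sub_C g₀ hg₀, Polynomial.degree_X_pow_sub_C hp.pos] at hdeg
  have hlt := Polynomial.degree_sum_fin_lt (fun i : Fin p => (⟨ν i, hν i⟩ : Kp))
  exact absurd (hdeg.trans_lt hlt) (lt_irrefl _)

/-- **PORT 1′_∞ (graded data over a ground field of ARBITRARY `p`-rank with a residually `p`-independent `p`-spanning family).**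
`M := K^p(g₀)` with its `p`-th-power values and RG on every FINITE subfamily; `x, y ∈ 𝔪_v` with (P2); generators `t` of `A`; and the
DOUBLE grading on a COMMON FINITE support `S₀ ⊆ S`: every `a ∈ t` is `Σ_{s ∈ S₀,(a,b)} m_{s,ab} B_s x^a y^b` with `m ∈ M` and every piece
in `O`.  NEW INPUT replacing rev 3's dimension count `[K : M] = |S|·p²` (meaningless for infinite `S`): `k·K^p` IS the `K^p`-span of `B`
(a subfield: `x⁻¹ = (x^p)⁻¹ · x^{p-1}`), the `p³` monomials `g₀^i x^a y^b` are `k·K^p`-linearly independent (by RG + DG on a finite common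
support and `K^p`-independence of the powers of `g₀`), hence a `k·K^p`-basis of `K` by (hdeg) `[K : k·K^p] = p³`; expanding the `k·K^p`
coefficients over `B` gives the doubly graded representation.  PROVED. [folklore] -/
theorem port_gradedDataInf (p : ℕ) [Fact p.Prime] {k : Type} [Field k] [CharP k p]
    {K : Type} [Field K] [CharP K p] [Algebra k K] (O : ValuationSubring K) (A : Subalgebra k K)
    (hAO : A.toSubring ≤ O.toSubring) (hAfg : A.FG)
    (g₀ : K) (hg₀ : ∀ c : K, c ^ p ≠ g₀)
    (hdefect : ∀ f₀ : K, ∃ f₁ : K, O.valuation (g₀ - f₁ ^ p) < O.valuation (g₀ - f₀ ^ p))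
    (hP2 : PRankTwoAt p O)
    (hdeg : Module.finrank (Subfield.closure (Set.range (algebraMap k K) ∪ Set.range (frobenius K p))) K = p ^ 3)
    {S : Type} (b : S → k) (hb : IsPSpanningFamilyInf p b)
    (hPI : ResiduallyPIndependentFamilyInf p O (fun s => algebraMap k K (b s))) :
    ∃ (M : Subfield K), (∀ x : K, x ∈ M ↔ ∃ c : Fin p → K, ∑ j, c j ^ p * g₀ ^ (j : ℕ) = x) ∧ g₀ ∈ M ∧
      (∀ x : K, x ^ p ∈ M) ∧ (∀ m : K, m ∈ M → m ≠ 0 → ∃ w : K, w ≠ 0 ∧ O.valuation m = O.valuation (w ^ p)) ∧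
      (∀ (s : Finset S) (c : ↥s → K), (∀ i, c i ∈ M) →
        O.valuation (∑ i : ↥s, c i * algebraMap k K (b i)) = Finset.univ.sup (fun i => O.valuation (c i))) ∧
      (∀ s, O.valuation (algebraMap k K (b s)) = 1) ∧
      ∃ (x y : K), x ≠ 0 ∧ y ≠ 0 ∧ O.valuation x < 1 ∧ O.valuation y < 1 ∧
        (∀ a b : ℕ, a < p → b < p → (a ≠ 0 ∨ b ≠ 0) → ∀ z : K, z ≠ 0 →
          O.valuation (x ^ a * y ^ b) ≠ O.valuation (z ^ p)) ∧
        ∃ (t : Finset K), Algebra.adjoin k (t : Set K) = A ∧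
          ∃ (S₀ : Finset S) (cf : K → S × (Fin p × Fin p) → K), (∀ a ∈ t, ∀ l, cf a l ∈ M) ∧
            (∀ a ∈ t, ∀ l, l.1 ∉ S₀ → cf a l = 0) ∧
            (∀ a ∈ t, ∑ l ∈ S₀ ×ˢ Finset.univ,
              cf a l * (algebraMap k K (b l.1) * (x ^ (l.2.1 : ℕ) * y ^ (l.2.2 : ℕ))) = a) ∧
            (∀ a ∈ t, ∀ l : S × (Fin p × Fin p),
              cf a l * (algebraMap k K (b l.1) * (x ^ (l.2.1 : ℕ) * y ^ (l.2.2 : ℕ))) ∈ O) := by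
  classical
  have hp : p.Prime := Fact.out
  haveI : NeZero p := ⟨hp.ne_zero⟩
  set B : S → K := fun s => algebraMap k K (b s) with hBdef
  -- ## `M = K^p(g₀)` with its `p`-th-power values (✓ ImmediateValues), IR (§C) and RG on finite subfamilies (§C)
  obtain ⟨M, hM, hg₀M, hpM, hV⟩ := ImmediateValues.exists_subfield_immediate_values (p := p) O.valuation g₀ hdefect
  have hIR : ∀ m : K, m ∈ M → O.valuation m = 1 → ∃ w : K, O.valuation (m - w ^ p) < 1 :=
    fun m hm hvm => immediateResidues_of_noBestApprox O g₀ hdefect M hM m hm hvm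
  have hPIs : ∀ s : Finset S, ResiduallyPIndependentFamily p O (fun i : ↥s => B i) :=
    fun s => residuallyPIndependentFamily_restrict O B hPI s
  have hRG : ∀ (s : Finset S) (c : ↥s → K), (∀ i, c i ∈ M) →
      O.valuation (∑ i : ↥s, c i * B i) = Finset.univ.sup (fun i => O.valuation (c i)) :=
    fun s c hc => valuation_sum_mul_family_eq_sup O M hIR (fun i : ↥s => B i) (hPIs s) c hc
  have hB1 : ∀ s, O.valuation (B s) = 1 := fun s =>
    valuation_eq_one_of_residuallyPIndependentFamily O (fun i : ↥({s} : Finset S) => B i) (hPIs {s})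
      ⟨s, Finset.mem_singleton_self s⟩
  have hB0 : ∀ s, B s ≠ 0 := fun s h => by have := hB1 s; rw [h, map_zero] at this; exact zero_ne_one this
  set Kp : Subfield K := (frobenius K p).fieldRange with hKpdef
  have hKpM : ∀ z : K, z ∈ Kp → z ∈ M := by
    intro z hz
    obtain ⟨u, rfl⟩ := RingHom.mem_fieldRange.mp hz
    rw [frobenius_def]; exact hpM u
  have hpowKp : ∀ z : K, z ^ p ∈ Kp := fun z => RingHom.mem_fieldRange.mpr ⟨z, frobenius_def ..⟩
  -- ## the `K^p`-span of `B` is a subfield containing `k` and `K^p`, hence contains `F₀ = k·K^p`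
  set V : Submodule Kp K := Submodule.span Kp (Set.range B) with hVdef
  have hBV : ∀ s, B s ∈ V := fun s => Submodule.subset_span ⟨s, rfl⟩
  have hkV : ∀ c : k, algebraMap k K c ∈ V := by
    intro c
    obtain ⟨s, d, hd⟩ := hb c
    rw [hd, map_sum]
    refine sum_mem fun u _ => ?_
    rw [map_mul, map_pow]
    have : algebraMap k K (d u) ^ p * B u = (⟨algebraMap k K (d u) ^ p, hpowKp _⟩ : Kp) • B u := by
      rw [Subfield.smul_def, smul_eq_mul]
    rw [this]
    exact V.smul_mem _ (hBV u)
  have hBmulV : ∀ s, ∀ y ∈ V, B s * y ∈ V := by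
    intro s y hy
    induction hy using Submodule.span_induction with
    | mem x hx =>
      obtain ⟨t, rfl⟩ := hx
      have : B s * B t = algebraMap k K (b s * b t) := by rw [map_mul]
      rw [this]; exact hkV _
    | zero => rw [mul_zero]; exact V.zero_mem
    | add x y _ _ hx hy => rw [mul_add]; exact V.add_mem hx hy
    | smul a x _ hx => rw [mul_smul_comm]; exact V.smul_mem a hx
  have hmulV : ∀ x ∈ V, ∀ y ∈ V, x * y ∈ V := by
    intro x hx y hy
    induction hx using Submodule.span_induction with
    | mem x hx' => obtain ⟨s, rfl⟩ := hx'; exact hBmulV s y hy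
    | zero => rw [zero_mul]; exact V.zero_mem
    | add x₁ x₂ _ _ h₁ h₂ => rw [add_mul]; exact V.add_mem h₁ h₂
    | smul a x _ hx => rw [smul_mul_assoc]; exact V.smul_mem a hx
  have h1V : (1 : K) ∈ V := by have := hkV 1; rwa [map_one] at this
  have hpowV : ∀ x ∈ V, ∀ n : ℕ, x ^ n ∈ V := by
    intro x hx n
    induction n with
    | zero => rw [pow_zero]; exact h1V
    | succ n ih => rw [pow_succ]; exact hmulV _ ih _ hx
  have hinvV : ∀ x ∈ V, x⁻¹ ∈ V := by
    intro x hx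
    by_cases hx0 : x = 0
    · rw [hx0, inv_zero]; exact V.zero_mem
    have hinvKp : (x ^ p)⁻¹ ∈ Kp := inv_mem (hpowKp x)
    have heq : x⁻¹ = (⟨(x ^ p)⁻¹, hinvKp⟩ : Kp) • x ^ (p - 1) := by
      rw [Subfield.smul_def, smul_eq_mul]
      change x⁻¹ = (x ^ p)⁻¹ * x ^ (p - 1)
      have hxp : x ^ p = x * x ^ (p - 1) := by
        rw [← pow_succ', Nat.sub_add_cancel hp.one_lt.le]
      rw [hxp, mul_inv, mul_assoc, inv_mul_cancel₀ (pow_ne_zero _ hx0), mul_one]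
    rw [heq]
    exact V.smul_mem _ (hpowV x hx _)
  let VF : Subfield K :=
    { carrier := V
      mul_mem' := fun ha hb => hmulV _ ha _ hb
      one_mem' := h1V
      add_mem' := fun ha hb => V.add_mem ha hb
      zero_mem' := V.zero_mem
      neg_mem' := fun ha => V.neg_mem ha
      inv_mem' := fun x hx => hinvV x hx }
  have hF₀V : Subfield.closure (Set.range (algebraMap k K) ∪ Set.range (frobenius K p)) ≤ VF := by
    apply Subfield.closure_le.mpr
    rintro z (⟨c, rfl⟩ | ⟨u, rfl⟩)
    · exact hkV c
    · change frobenius K p u ∈ V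
      have : frobenius K p u = (⟨frobenius K p u, RingHom.mem_fieldRange.mpr ⟨u, rfl⟩⟩ : Kp) • (1 : K) := by
        rw [Subfield.smul_def, smul_eq_mul, mul_one]
      rw [this]
      exact V.smul_mem _ h1V
  have hF₀repr : ∀ f : K, f ∈ Subfield.closure (Set.range (algebraMap k K) ∪ Set.range (frobenius K p)) →
      ∃ (s : Finset S) (ν : S → K), (∀ i, ν i ∈ Kp) ∧ (∀ i ∉ s, ν i = 0) ∧ f = ∑ i ∈ s, ν i * B i := by
    intro f hf
    have hfV : f ∈ V := hF₀V hf
    obtain ⟨c, hc⟩ := (Finsupp.mem_span_range_iff_exists_finsupp).mp hfV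
    refine ⟨c.support, fun i => (c i : K), fun i => (c i).2, fun i hi => ?_, ?_⟩
    · show ((c i : Kp) : K) = 0
      rw [Finsupp.notMem_support_iff.mp hi]; rfl
    · rw [← hc, Finsupp.sum]
      exact Finset.sum_congr rfl fun i _ => Subfield.smul_def _ _
  -- ## (P2), normalised into the maximal ideal of `O` (as in Port 1)
  obtain ⟨x₀, y₀, hx₀, hy₀, hP₀⟩ := hP2
  obtain ⟨x, hx, hvx, hPx⟩ := exists_pRankTwo_lt_one_left hp O hx₀ hP₀
  obtain ⟨y, hy, hvy, hPy⟩ := exists_pRankTwo_lt_one_left hp O hy₀ (pRankTwo_swap O hPx)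
  have hP := pRankTwo_swap O hPy
  -- ## DG on finite subfamilies, `M`-linear independence of `{B_s x^a y^b}` on finite subfamilies
  set mon : Fin p × Fin p → K := fun ab => x ^ (ab.1 : ℕ) * y ^ (ab.2 : ℕ) with hmon
  have hmon0 : ∀ ab, mon ab ≠ 0 := fun ab => mul_ne_zero (pow_ne_zero _ hx) (pow_ne_zero _ hy)
  have hDG : ∀ (S₀ : Finset S) (m : ↥S₀ × (Fin p × Fin p) → K), (∀ l, m l ∈ M) → ∀ l₀,
      O.valuation (m l₀ * (B (l₀.1 : S) * (x ^ (l₀.2.1 : ℕ) * y ^ (l₀.2.2 : ℕ)))) ≤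
        O.valuation (∑ l, m l * (B (l.1 : S) * (x ^ (l.2.1 : ℕ) * y ^ (l.2.2 : ℕ)))) :=
    fun S₀ m hm l₀ => valuation_term_le_double_sum hp O M hV (fun i : ↥S₀ => B i) (fun i => hB1 i) (hRG S₀) hx hy hP m hm l₀
  have hli : ∀ (S₀ : Finset S) (g : ↥S₀ × (Fin p × Fin p) → K), (∀ l, g l ∈ M) →
      ∑ l, g l * (B (l.1 : S) * (x ^ (l.2.1 : ℕ) * y ^ (l.2.2 : ℕ))) = 0 → ∀ l, g l = 0 := by
    intro S₀ g hg hsum l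
    have hle := hDG S₀ g hg l
    rw [hsum, map_zero, le_zero_iff, map_eq_zero] at hle
    rcases mul_eq_zero.mp hle with h1 | h1
    · exact h1
    · exact absurd h1 (mul_ne_zero (hB0 _) (hmon0 l.2))
  -- ## the `p³` monomials `g₀^i x^a y^b` and the REARRANGEMENT identity
  set mon3 : Fin p × (Fin p × Fin p) → K := fun q => g₀ ^ (q.1 : ℕ) * (x ^ (q.2.1 : ℕ) * y ^ (q.2.2 : ℕ)) with hmon3
  have hREARR : ∀ (νν : Fin p × (Fin p × Fin p) → S → K) (S₀ : Finset S),
      ∑ l ∈ S₀ ×ˢ (Finset.univ : Finset (Fin p × Fin p)),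
          (∑ i : Fin p, νν (i, l.2) l.1 * g₀ ^ (i : ℕ)) * (B l.1 * (x ^ (l.2.1 : ℕ) * y ^ (l.2.2 : ℕ))) =
        ∑ q : Fin p × (Fin p × Fin p), (∑ s ∈ S₀, νν q s * B s) * mon3 q := by
    intro νν S₀
    rw [Finset.sum_product, Fintype.sum_prod_type]
    simp only [Finset.sum_mul, hmon3]
    rw [Finset.sum_comm]
    conv_rhs => rw [Finset.sum_comm]
    refine Finset.sum_congr rfl fun ab _ => ?_
    rw [Finset.sum_comm]
    refine Finset.sum_congr rfl fun i _ => Finset.sum_congr rfl fun s _ => ?_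
    ring
  -- ## the `p³` monomials are `F₀`-linearly independent
  set F₀ : Subfield K := Subfield.closure (Set.range (algebraMap k K) ∪ Set.range (frobenius K p)) with hF₀def
  have hli3 : LinearIndependent F₀ mon3 := by
    rw [Fintype.linearIndependent_iff]
    intro f hf
    have hrep := fun q : Fin p × (Fin p × Fin p) => hF₀repr (f q : K) (f q).2
    choose sq ν hνKp hν0 hνeq using hrep
    set S₀ : Finset S := Finset.univ.biUnion sq with hS₀
    have hsub : ∀ q, sq q ⊆ S₀ := fun q => Finset.subset_biUnion_of_mem sq (Finset.mem_univ q)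
    have hν0' : ∀ q s, s ∉ S₀ → ν q s = 0 := fun q s hs => hν0 q s (fun h => hs (hsub q h))
    have hνeq' : ∀ q, (f q : K) = ∑ s ∈ S₀, ν q s * B s := by
      intro q
      rw [hνeq q]
      exact Finset.sum_subset (hsub q) (fun s _ hs => by rw [hν0 q s hs, zero_mul])
    have h0 : ∑ q, (f q : K) * mon3 q = 0 := by
      have : ∑ q, (f q : K) * mon3 q = ∑ q, f q • mon3 q :=
        Finset.sum_congr rfl fun q _ => (Subfield.smul_def (f q) _).symm
      rw [this, hf]
    -- the vanishing `M`-combination of the `B_s x^a y^b`, `s ∈ S₀`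
    set cc : S × (Fin p × Fin p) → K := fun l => ∑ i : Fin p, ν (i, l.2) l.1 * g₀ ^ (i : ℕ) with hcc
    have hccM : ∀ l, cc l ∈ M := fun l => sum_mem fun i _ => mul_mem (hKpM _ (hνKp _ _)) (pow_mem hg₀M _)
    have hsum0 : ∑ l : ↥S₀ × (Fin p × Fin p),
        cc ((l.1 : S), l.2) * (B (l.1 : S) * (x ^ (l.2.1 : ℕ) * y ^ (l.2.2 : ℕ))) = 0 := by
      rw [← sum_product_univ_eq_sum_subtype S₀
        (fun l : S × (Fin p × Fin p) => cc l * (B l.1 * (x ^ (l.2.1 : ℕ) * y ^ (l.2.2 : ℕ))))]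
      rw [hcc, hREARR ν S₀]
      simp only [← hνeq']
      exact h0
    have hcc0 : ∀ s ∈ S₀, ∀ ab, cc (s, ab) = 0 := fun s hs ab =>
      hli S₀ (fun l => cc ((l.1 : S), l.2)) (fun l => hccM _) hsum0 (⟨s, hs⟩, ab)
    have hνzero : ∀ q s, ν q s = 0 := by
      intro q s
      by_cases hs : s ∈ S₀
      · have h := hcc0 s hs q.2
        have hall := pthPowers_linearIndependent_powers g₀ hg₀ (fun i => ν (i, q.2) s) (fun i => hνKp _ _) h q.1
        simpa only [Prod.mk.eta] using hall
      · exact hν0' q s hs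
    intro q
    have hfq : (f q : K) = 0 := by
      rw [hνeq' q]
      exact Finset.sum_eq_zero fun s _ => by rw [hνzero q s, zero_mul]
    exact_mod_cast hfq
  -- ## every `a ∈ K` is an `F₀`-combination of the monomials; expand the coefficients over `B`
  have hN : Module.finrank F₀ K = p ^ 3 := hdeg
  have hcard3 : Fintype.card (Fin p × (Fin p × Fin p)) = p ^ 3 := by
    simp [Fintype.card_prod, Fintype.card_fin]; ring
  have hrepr3 : ∀ a : K, ∃ f : Fin p × (Fin p × Fin p) → F₀, ∑ q, (f q : K) * mon3 q = a := by
    intro a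
    obtain ⟨f, hf⟩ := ImmediateValues.exists_repr_of_linearIndependent_card_eq F₀ hN (pow_pos hp.pos 3) mon3 hli3 hcard3 a
    exact ⟨f, by simpa only [Subfield.smul_def, smul_eq_mul] using hf⟩
  obtain ⟨t, ht⟩ := hAfg
  choose f3 hf3 using hrepr3
  have hrep := fun (a : K) (q : Fin p × (Fin p × Fin p)) => hF₀repr (f3 a q : K) (f3 a q).2
  choose sq ν hνKp hν0 hνeq using hrep
  set S₀ : Finset S := (t ×ˢ (Finset.univ : Finset (Fin p × (Fin p × Fin p)))).biUnion (fun aq => sq aq.1 aq.2) with hS₀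
  have hsub : ∀ a ∈ t, ∀ q, sq a q ⊆ S₀ := fun a ha q =>
    Finset.subset_biUnion_of_mem (fun aq : K × (Fin p × (Fin p × Fin p)) => sq aq.1 aq.2) (x := (a, q))
      (Finset.mem_product.mpr ⟨ha, Finset.mem_univ q⟩)
  set cf : K → S × (Fin p × Fin p) → K := fun a l => ∑ i : Fin p, ν a (i, l.2) l.1 * g₀ ^ (i : ℕ) with hcf
  have hcfM : ∀ a l, cf a l ∈ M := fun a l => sum_mem fun i _ => mul_mem (hKpM _ (hνKp _ _ _)) (pow_mem hg₀M _)
  have hcf0 : ∀ a ∈ t, ∀ l : S × (Fin p × Fin p), l.1 ∉ S₀ → cf a l = 0 := by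
    intro a ha l hl
    refine Finset.sum_eq_zero fun i _ => ?_
    rw [hν0 a (i, l.2) l.1 (fun h => hl (hsub a ha _ h)), zero_mul]
  have hsumcf : ∀ a ∈ t, ∑ l ∈ S₀ ×ˢ Finset.univ, cf a l * (B l.1 * (x ^ (l.2.1 : ℕ) * y ^ (l.2.2 : ℕ))) = a := by
    intro a ha
    have hνeq' : ∀ q, (f3 a q : K) = ∑ s ∈ S₀, ν a q s * B s := fun q => by
      rw [hνeq a q]
      exact Finset.sum_subset (hsub a ha q) (fun s _ hs => by rw [hν0 a q s hs, zero_mul])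
    rw [hcf, hREARR (ν a) S₀]
    simp only [← hνeq']
    exact hf3 a
  refine ⟨M, hM, hg₀M, hpM, hV, hRG, hB1, x, y, hx, hy, hvx, hvy, hP, t, ht, S₀, cf, fun a _ l => hcfM a l, hcf0, hsumcf, ?_⟩
  intro a ha l
  by_cases hl : l.1 ∈ S₀
  · have haA : a ∈ A := by
      rw [← ht]
      exact Algebra.subset_adjoin (Finset.mem_coe.mpr ha)
    have hva : O.valuation a ≤ 1 := (O.valuation_le_one_iff a).mpr (hAO haA)
    have hterm := hDG S₀ (fun l' => cf a ((l'.1 : S), l'.2)) (fun l' => hcfM _ _) (⟨l.1, hl⟩, l.2)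
    rw [← sum_product_univ_eq_sum_subtype S₀
      (fun l : S × (Fin p × Fin p) => cf a l * (B l.1 * (x ^ (l.2.1 : ℕ) * y ^ (l.2.2 : ℕ)))), hsumcf a ha] at hterm
    exact (O.valuation_le_one_iff _).mp (hterm.trans hva)
  · rw [hcf0 a ha l hl, zero_mul]
    exact O.zero_mem

/-! ## §E∞ PORT 2′_∞ — the two-field M-side (F-02 over the SMALL field `k₀ = k^p`, `A` a `k`-model) -/

namespace TwoField

variable {k₀ : Type} [Field k₀] {k : Type} [Field k] {K : Type} [Field K]
  [Algebra k₀ k] [Algebra k₀ K] [Algebra k K] [IsScalarTower k₀ k K]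

/-- `k` is algebraic over a subfield `k₀` over which every constant has its `p`-th power (`p > 0`). [folklore] -/
theorem isAlgebraic_base {p : ℕ} (hp : 0 < p)
    (hFrob : ∀ c : k, ∃ c₀ : k₀, algebraMap k₀ K c₀ = algebraMap k K c ^ p) : Algebra.IsAlgebraic k₀ k := by
  refine ⟨fun c => ?_⟩
  obtain ⟨c₀, hc₀⟩ := hFrob c
  have hc : c ^ p = algebraMap k₀ k c₀ := by
    apply (algebraMap k K).injective
    rw [map_pow, ← IsScalarTower.algebraMap_apply k₀ k K, hc₀]
  exact IsIntegral.isAlgebraic (IsIntegral.of_pow hp (by rw [hc]; exact isIntegral_algebraMap))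

/-- `trdeg_{k₀} K = trdeg_k K` for `k/k₀` algebraic as above. [folklore] -/
theorem trdeg_eq_of_base {p : ℕ} (hp : 0 < p)
    (hFrob : ∀ c : k, ∃ c₀ : k₀, algebraMap k₀ K c₀ = algebraMap k K c ^ p) :
    Algebra.trdeg k₀ K = Algebra.trdeg k K := by
  haveI := isAlgebraic_base (K := K) hp hFrob
  haveI : FaithfulSMul k₀ k := (faithfulSMul_iff_algebraMap_injective k₀ k).mpr (algebraMap k₀ k).injective
  haveI : FaithfulSMul k K := (faithfulSMul_iff_algebraMap_injective k K).mpr (algebraMap k K).injective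
  rw [← trdeg_add_eq k₀ k (A := K), trdeg_eq_zero (R := k₀) (A := k), zero_add]

/-- `dim k₀[S] ≤ dim A` for a finite `S ⊆ K = Frac A`, `A` an affine `k`-domain, `k/k₀` algebraic as above
(`trdeg_{k₀} k₀[S] ≤ trdeg_{k₀} K = trdeg_k K = dim A`). [folklore] -/
theorem ringKrullDim_adjoin_preimage_le₂ {p : ℕ} (hp : 0 < p)
    (hFrob : ∀ c : k, ∃ c₀ : k₀, algebraMap k₀ K c₀ = algebraMap k K c ^ p)
    (A : Subalgebra k K) (hfg : A.FG) [IsFractionRing A K] {d : ℕ}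
    (hdim : ringKrullDim A ≤ d) (S : Set K) (hSfin : S.Finite) :
    ringKrullDim (Algebra.adjoin k₀ ((Subtype.val : IntermediateField.adjoin k₀ S → K) ⁻¹' S)) ≤ d := by
  have hBfg : (Algebra.adjoin k₀ ((Subtype.val : IntermediateField.adjoin k₀ S → K) ⁻¹' S)).FG := by
    refine Subalgebra.fg_def.mpr ⟨_, hSfin.preimage Subtype.val_injective.injOn, rfl⟩
  haveI : Algebra.FiniteType k₀ (Algebra.adjoin k₀ ((Subtype.val : IntermediateField.adjoin k₀ S → K) ⁻¹' S)) :=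
    (Algebra.adjoin k₀ ((Subtype.val : IntermediateField.adjoin k₀ S → K) ⁻¹' S)).fg_iff_finiteType.mp hBfg
  haveI : Algebra.FiniteType k A := A.fg_iff_finiteType.mp hfg
  obtain ⟨s, hsB, htrB⟩ := Literature.RingTheory.KrullDimension.exists_ringKrullDim_eq_and_trdeg_eq k₀
    (Algebra.adjoin k₀ ((Subtype.val : IntermediateField.adjoin k₀ S → K) ⁻¹' S))
  obtain ⟨n, hnA, htrA⟩ := Literature.RingTheory.KrullDimension.exists_ringKrullDim_eq_and_trdeg_eq k A
  haveI : FaithfulSMul k A := (faithfulSMul_iff_algebraMap_injective k A).mpr (algebraMap k A).injective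
  haveI : FaithfulSMul A K := (faithfulSMul_iff_algebraMap_injective A K).mpr (IsFractionRing.injective A K)
  haveI : Algebra.IsAlgebraic A K := IsLocalization.isAlgebraic K (nonZeroDivisors A)
  have htrK : Algebra.trdeg k K = (n : Cardinal) := by
    rw [← trdeg_add_eq k A (A := K), trdeg_eq_zero (R := A) (A := K), add_zero, htrA]
  have htrK₀ : Algebra.trdeg k₀ K = (n : Cardinal) := by rw [trdeg_eq_of_base hp hFrob, htrK]
  have hf : Function.Injective ((IsScalarTower.toAlgHom k₀ (IntermediateField.adjoin k₀ S) K).comp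
      (Algebra.adjoin k₀ ((Subtype.val : IntermediateField.adjoin k₀ S → K) ⁻¹' S)).val) := by
    intro x y hxy
    apply Subtype.ext
    apply Subtype.ext
    simpa using hxy
  have hle : Algebra.trdeg k₀ (Algebra.adjoin k₀ ((Subtype.val : IntermediateField.adjoin k₀ S → K) ⁻¹' S)) ≤
      Algebra.trdeg k₀ K := trdeg_le_of_injective _ hf
  rw [htrB, htrK₀] at hle
  have hsn : s ≤ n := by exact_mod_cast hle
  have hnd : n ≤ d := by
    rw [hnA] at hdim
    exact_mod_cast hdim
  rw [hsB]
  exact_mod_cast hsn.trans hnd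

/-- **The M-side regular model over the SMALL field `k₀`** (F-02 via `.lu3` at `k₀`): for an affine `k`-model `A ⊆ O` of `K` of
dimension `≤ 3` and a finite `S ⊆ O`, a finitely generated `k₀`-subalgebra `A' ⊇ k₀[S]` of `k₀(S)` inside `O` whose localisation at the
centre is regular. [folklore] -/
theorem exists_regular_model_subfield₂ {p : ℕ} (hp : 0 < p)
    (hFrob : ∀ c : k, ∃ c₀ : k₀, algebraMap k₀ K c₀ = algebraMap k K c ^ p)
    (hLU : LocalUniformization3 k₀) (O : ValuationSubring K) (A : Subalgebra k K)
    (hAO : A.toSubring ≤ O.toSubring) (hfg : A.FG) (hfr : IsFractionRing A K) (hdim : ringKrullDim A ≤ 3)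
    (S : Set K) (hSfin : S.Finite) (hSO : ∀ s ∈ S, s ∈ O) :
    ∃ (A' : Subalgebra k₀ (IntermediateField.adjoin k₀ S))
      (h : A'.toSubring ≤ (O.comap (algebraMap (IntermediateField.adjoin k₀ S) K)).toSubring),
      Algebra.adjoin k₀ ((Subtype.val : IntermediateField.adjoin k₀ S → K) ⁻¹' S) ≤ A' ∧ A'.FG ∧
        IsRegularLocalRing (Localization.AtPrime
          (centreIdeal A' (O.comap (algebraMap (IntermediateField.adjoin k₀ S) K)) h)) := by
  haveI := hfr
  have hk₀O : ∀ c : k₀, algebraMap k₀ K c ∈ O := fun c => by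
    rw [IsScalarTower.algebraMap_apply k₀ k K]; exact hAO (A.algebraMap_mem _)
  have hBO := TwistModel.adjoin_preimage_le_comap O hk₀O S hSO
  have hBfg : (Algebra.adjoin k₀ ((Subtype.val : IntermediateField.adjoin k₀ S → K) ⁻¹' S)).FG :=
    Subalgebra.fg_def.mpr ⟨_, hSfin.preimage Subtype.val_injective.injOn, rfl⟩
  have hBfr := TwistModel.isFractionRing_adjoin_preimage (k := k₀) S
  have hBdim := ringKrullDim_adjoin_preimage_le₂ hp hFrob A hfg (d := 3) (by exact_mod_cast hdim) S hSfin
  exact hLU (IntermediateField.adjoin k₀ S) (O.comap (algebraMap (IntermediateField.adjoin k₀ S) K)) _ hBO hBfg hBfr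
    (by exact_mod_cast hBdim)

omit [Algebra k₀ k] [IsScalarTower k₀ k K] in
/-- `a ∈ k[t] ⇒ a^p ∈ k₀[t^p]` (the coefficients' `p`-th powers lie in `k₀`). [folklore] -/
theorem pow_mem_adjoin_image_pow₂ (p : ℕ) [Fact p.Prime] [CharP K p]
    (hFrob : ∀ c : k, ∃ c₀ : k₀, algebraMap k₀ K c₀ = algebraMap k K c ^ p)
    (t : Set K) {a : K} (ha : a ∈ Algebra.adjoin k t) :
    a ^ p ∈ Algebra.adjoin k₀ ((fun x : K => x ^ p) '' t) := by
  induction ha using Algebra.adjoin_induction with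
  | mem x hx => exact Algebra.subset_adjoin ⟨x, hx, rfl⟩
  | algebraMap r =>
      obtain ⟨c₀, hc₀⟩ := hFrob r
      rw [← hc₀]
      exact Subalgebra.algebraMap_mem _ _
  | add x y _ _ hx hy => rw [add_pow_char]; exact add_mem hx hy
  | mul x y _ _ hx hy => rw [mul_pow]; exact mul_mem hx hy

omit [Algebra k₀ k] [IsScalarTower k₀ k K] in
/-- `K^p ⊆ k₀(S)` as soon as `S ⊇ t^p` for a generating set `t` of an affine `k`-model `A` with `Frac A = K`. [folklore] -/
theorem pow_mem_intermediateField_adjoin₂ (p : ℕ) [Fact p.Prime] [CharP K p]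
    (hFrob : ∀ c : k, ∃ c₀ : k₀, algebraMap k₀ K c₀ = algebraMap k K c ^ p)
    (A : Subalgebra k K) [IsFractionRing A K]
    (t : Set K) (ht : Algebra.adjoin k t = A) (S : Set K) (hS : (fun x : K => x ^ p) '' t ⊆ S) (z : K) :
    z ^ p ∈ IntermediateField.adjoin k₀ S := by
  obtain ⟨a, b, hb, rfl⟩ := IsFractionRing.div_surjective (A := A) z
  have hle : Algebra.adjoin k₀ ((fun x : K => x ^ p) '' t) ≤ (IntermediateField.adjoin k₀ S).toSubalgebra :=
    (Algebra.adjoin_mono hS).trans (IntermediateField.algebra_adjoin_le_adjoin k₀ S)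
  have ha' : ((a : K)) ^ p ∈ IntermediateField.adjoin k₀ S :=
    hle (pow_mem_adjoin_image_pow₂ p hFrob t (by rw [ht]; exact a.2))
  have hb' : ((b : K)) ^ p ∈ IntermediateField.adjoin k₀ S :=
    hle (pow_mem_adjoin_image_pow₂ p hFrob t (by rw [ht]; exact b.2))
  rw [show algebraMap A K a / algebraMap A K b = (a : K) / (b : K) from rfl, div_pow]
  exact div_mem ha' hb'

omit [Algebra k₀ k] [IsScalarTower k₀ k K] in
/-- The twist field over the small field: `k₀(t^p ∪ {g₀})` has underlying subfield `K^p(g₀) = Subfield.closure (range frob ∪ {g₀})`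
when `k₀` lands in `K^p`. [folklore] -/
theorem adjoin_twist_toSubfield_eq₂ (p : ℕ) [Fact p.Prime] [CharP K p]
    (hFrob : ∀ c : k, ∃ c₀ : k₀, algebraMap k₀ K c₀ = algebraMap k K c ^ p)
    (hk₀p : ∀ c₀ : k₀, ∃ d : K, algebraMap k₀ K c₀ = d ^ p)
    (A : Subalgebra k K) [IsFractionRing A K] (t : Set K) (ht : Algebra.adjoin k t = A) (g₀ : K) :
    (IntermediateField.adjoin k₀ ((fun x : K => x ^ p) '' t ∪ {g₀})).toSubfield =
      Subfield.closure (Set.range (frobenius K p) ∪ {g₀}) := by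
  rw [IntermediateField.adjoin_toSubfield]
  apply le_antisymm
  · apply Subfield.closure_le.mpr
    rintro x (hx | hx | hx)
    · obtain ⟨c₀, rfl⟩ := hx
      obtain ⟨d, hd⟩ := hk₀p c₀
      refine Subfield.subset_closure (Or.inl ⟨d, ?_⟩)
      rw [frobenius_def, hd]
    · obtain ⟨y, hy, rfl⟩ := hx
      exact Subfield.subset_closure (Or.inl ⟨y, frobenius_def ..⟩)
    · exact Subfield.subset_closure (Or.inr hx)
  · apply Subfield.closure_le.mpr
    rintro x (hx | hx)
    · obtain ⟨z, rfl⟩ := hx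
      have := pow_mem_intermediateField_adjoin₂ p hFrob A t ht ((fun x : K => x ^ p) '' t ∪ {g₀}) Set.subset_union_left z
      rw [frobenius_def]
      exact this
    · exact Subfield.subset_closure (Or.inr (Or.inr hx))

omit [Algebra k₀ k] [IsScalarTower k₀ k K] in
/-- **Closed centre on the M-side model over the small field.**  (hzd) for the affine `k`-model `A = k[t]`, and a `k₀`-subalgebra
`A' ⊆ O ∩ M` of a subfield `M` containing a `p`-th power of every generator: the centre of `O ∩ M` on `A'` is maximal (`k[A' ∪ t] ⊆ O`
contains `A` and is integral over `A'`, the constants of `k` having their `p`-th powers in `k₀ ⊆ A'`). [folklore] -/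
theorem centreIdeal_isMaximal_of_pow_generators₂ {p : ℕ} (hp : 0 < p)
    (hFrob : ∀ c : k, ∃ c₀ : k₀, algebraMap k₀ K c₀ = algebraMap k K c ^ p)
    (O : ValuationSubring K) (A : Subalgebra k K) (hAO : A.toSubring ≤ O.toSubring)
    (t : Set K) (ht : Algebra.adjoin k t = A)
    (hzd : ∀ (T : Subring K) (hT : T ≤ O.toSubring), A.toSubring ≤ T → (subringCentre T O hT).IsMaximal)
    (M : IntermediateField k₀ K) (A' : Subalgebra k₀ M) (h : A'.toSubring ≤ (O.comap (algebraMap M K)).toSubring)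
    (htA' : ∀ a ∈ t, ∃ y ∈ A', algebraMap M K y = a ^ p) :
    (centreIdeal A' (O.comap (algebraMap M K)) h).IsMaximal := by
  have hk : ∀ c : k, algebraMap k K c ∈ O := fun c => hAO (A.algebraMap_mem c)
  set f : M →ₐ[k₀] K := IsScalarTower.toAlgHom k₀ M K with hf_def
  have hf : Function.Injective f := (algebraMap M K).injective
  set B : Subalgebra k₀ K := A'.map f with hB_def
  have hBO : B.toSubring ≤ O.toSubring := by
    intro x hx
    obtain ⟨y, hy, rfl⟩ := Subalgebra.mem_map.mp hx
    exact (ValuationSubring.mem_comap.mp (h hy))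
  have hkB : ∀ c : k, algebraMap k K c ^ p ∈ B := by
    intro c
    obtain ⟨c₀, hc₀⟩ := hFrob c
    rw [← hc₀]
    exact B.algebraMap_mem c₀
  set C : Subalgebra k K := Algebra.adjoin k ((B : Set K) ∪ t) with hC_def
  have hCO : C.toSubring ≤ O.toSubring := by
    intro x hx
    rw [Subalgebra.mem_toSubring] at hx
    change x ∈ O
    induction hx using Algebra.adjoin_induction with
    | mem x hx =>
        rcases hx with hx | hx
        · exact hBO hx
        · exact hAO (by rw [← ht]; exact Algebra.subset_adjoin hx)
    | algebraMap r => exact hk r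
    | add x y _ _ hx hy => exact O.add_mem _ _ hx hy
    | mul x y _ _ hx hy => exact O.mul_mem _ _ hx hy
  have hAC : A ≤ C := by
    rw [← ht]
    exact Algebra.adjoin_mono Set.subset_union_right
  have hBC : B.toSubring ≤ C.toSubring := fun x hx => Algebra.subset_adjoin (Or.inl hx)
  have hmaxC : (subringCentre C.toSubring O hCO).IsMaximal := hzd C.toSubring hCO (fun x hx => hAC hx)
  letI algBC : Algebra B.toSubring C.toSubring := (Subring.inclusion hBC).toAlgebra
  haveI : Algebra.IsIntegral B.toSubring C.toSubring := by
    constructor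
    intro x
    let g : C.toSubring →ₐ[B.toSubring] K :=
      { toRingHom := C.toSubring.subtype
        commutes' := fun b => rfl }
    have hg : Function.Injective g := Subtype.val_injective
    rw [← isIntegral_algHom_iff g hg]
    change IsIntegral B.toSubring (x : K)
    let IC : Subalgebra k K :=
      { carrier := {a : K | IsIntegral B.toSubring a}
        mul_mem' := fun ha hb => ha.mul hb
        one_mem' := isIntegral_one
        add_mem' := fun ha hb => ha.add hb
        zero_mem' := isIntegral_zero
        algebraMap_mem' := fun r => IsIntegral.of_pow hp
          (isIntegral_algebraMap (R := B.toSubring) (A := K) (x := ⟨algebraMap k K r ^ p, hkB r⟩)) }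
    have hCle : C ≤ IC := by
      apply Algebra.adjoin_le
      rintro a (ha | ha)
      · change IsIntegral B.toSubring a
        exact isIntegral_algebraMap (R := B.toSubring) (A := K) (x := ⟨a, ha⟩)
      · change IsIntegral B.toSubring a
        obtain ⟨y, hy, hya⟩ := htA' a ha
        apply IsIntegral.of_pow hp
        rw [← hya]
        have hmem : algebraMap M K y ∈ B := Subalgebra.mem_map.mpr ⟨y, hy, rfl⟩
        exact isIntegral_algebraMap (R := B.toSubring) (A := K) (x := ⟨algebraMap M K y, hmem⟩)
    exact hCle x.2
  have hmaxB' : ((subringCentre C.toSubring O hCO).comap (algebraMap B.toSubring C.toSubring)).IsMaximal :=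
    Ideal.isMaximal_comap_of_isIntegral_of_isMaximal _
  have hcentreB : (subringCentre C.toSubring O hCO).comap (algebraMap B.toSubring C.toSubring) = centreIdeal B O hBO := by
    ext b
    rw [Ideal.mem_comap, mem_subringCentre_iff]
    change O.valuation (b : K) < 1 ↔ b ∈ centreIdeal B O hBO
    rw [centreIdeal, Ideal.mem_comap, ValuationSubring.valuation_lt_one_iff]
    rfl
  have hmaxB : (centreIdeal B O hBO).IsMaximal := hcentreB ▸ hmaxB'
  set e : A' ≃ₐ[k₀] B := A'.equivMapOfInjective f hf with he_def
  have hcentre : centreIdeal A' (O.comap (algebraMap M K)) h = (centreIdeal B O hBO).comap e.toRingEquiv.toRingHom := by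
    ext y
    rw [centreIdeal, Ideal.mem_comap, TwistModel.mem_maximalIdeal_comap_iff, Ideal.mem_comap, centreIdeal, Ideal.mem_comap,
      ValuationSubring.valuation_lt_one_iff, ValuationSubring.valuation_lt_one_iff]
    have hey : ((e y : B) : K) = algebraMap M K (y : M) := by
      rw [he_def, Subalgebra.coe_equivMapOfInjective_apply]
      rfl
    change O.valuation (algebraMap M K (y : M)) < 1 ↔ O.valuation ((e y : B) : K) < 1
    rw [hey]
  rw [hcentre]
  exact Ideal.comap_isMaximal_of_surjective _ e.surjective

/-- **Dimension of the M-side model over the small field**: `A' ⊇ k₀[S]` finitely generated inside `k₀(S)` with `K` algebraic over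
`k₀(S)` has `dim A' = dim A` (both equal `trdeg_k K = trdeg_{k₀} K`). [folklore] -/
theorem ringKrullDim_eq_of_adjoin_le₂ {p : ℕ} (hp : 0 < p)
    (hFrob : ∀ c : k, ∃ c₀ : k₀, algebraMap k₀ K c₀ = algebraMap k K c ^ p)
    (A : Subalgebra k K) (hAfg : A.FG) [IsFractionRing A K]
    (S : Set K) (halg : Algebra.IsAlgebraic (IntermediateField.adjoin k₀ S) K)
    (A' : Subalgebra k₀ (IntermediateField.adjoin k₀ S))
    (hSA' : Algebra.adjoin k₀ ((Subtype.val : IntermediateField.adjoin k₀ S → K) ⁻¹' S) ≤ A') (hA'fg : A'.FG) :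
    ringKrullDim A' = ringKrullDim A := by
  haveI : Algebra.FiniteType k₀ A' := A'.fg_iff_finiteType.mp hA'fg
  haveI : Algebra.FiniteType k A := A.fg_iff_finiteType.mp hAfg
  haveI hfr' : IsFractionRing A' (IntermediateField.adjoin k₀ S) := by
    refine IsFractionRing.of_field _ _ (fun z => ?_)
    obtain ⟨r, hr, s, hs, hz⟩ := IntermediateField.mem_adjoin_iff_div.mp z.2
    have hrM : r ∈ IntermediateField.adjoin k₀ S := IntermediateField.algebra_adjoin_le_adjoin k₀ S hr
    have hsM : s ∈ IntermediateField.adjoin k₀ S := IntermediateField.algebra_adjoin_le_adjoin k₀ S hs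
    refine ⟨⟨⟨r, hrM⟩, hSA' ((TwistModel.mem_adjoin_preimage_iff S _).mpr hr)⟩,
      ⟨⟨s, hsM⟩, hSA' ((TwistModel.mem_adjoin_preimage_iff S _).mpr hs)⟩, ?_⟩
    apply Subtype.ext
    simpa using hz
  obtain ⟨s, hsA', htrA'⟩ := Literature.RingTheory.KrullDimension.exists_ringKrullDim_eq_and_trdeg_eq k₀ A'
  obtain ⟨n, hnA, htrA⟩ := Literature.RingTheory.KrullDimension.exists_ringKrullDim_eq_and_trdeg_eq k A
  haveI : FaithfulSMul k A := (faithfulSMul_iff_algebraMap_injective k A).mpr (algebraMap k A).injective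
  haveI : FaithfulSMul A K := (faithfulSMul_iff_algebraMap_injective A K).mpr (IsFractionRing.injective A K)
  haveI : Algebra.IsAlgebraic A K := IsLocalization.isAlgebraic K (nonZeroDivisors A)
  haveI : FaithfulSMul k₀ A' := (faithfulSMul_iff_algebraMap_injective k₀ A').mpr (algebraMap k₀ A').injective
  haveI : FaithfulSMul A' (IntermediateField.adjoin k₀ S) :=
    (faithfulSMul_iff_algebraMap_injective A' _).mpr (IsFractionRing.injective A' (IntermediateField.adjoin k₀ S))
  haveI : Algebra.IsAlgebraic A' (IntermediateField.adjoin k₀ S) :=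
    IsLocalization.isAlgebraic (IntermediateField.adjoin k₀ S) (nonZeroDivisors A')
  haveI : FaithfulSMul (IntermediateField.adjoin k₀ S) K :=
    (faithfulSMul_iff_algebraMap_injective _ K).mpr (algebraMap (IntermediateField.adjoin k₀ S) K).injective
  haveI := halg
  have htrK : Algebra.trdeg k K = (n : Cardinal) := by
    rw [← trdeg_add_eq k A (A := K), trdeg_eq_zero (R := A) (A := K), add_zero, htrA]
  have htrK₀ : Algebra.trdeg k₀ K = (n : Cardinal) := by rw [trdeg_eq_of_base hp hFrob, htrK]
  have htrM : Algebra.trdeg k₀ (IntermediateField.adjoin k₀ S) = (n : Cardinal) := by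
    rw [← htrK₀, ← trdeg_add_eq k₀ (IntermediateField.adjoin k₀ S) (A := K),
      trdeg_eq_zero (R := IntermediateField.adjoin k₀ S) (A := K), add_zero]
  have htrA'' : Algebra.trdeg k₀ A' = (n : Cardinal) := by
    rw [← htrM, ← trdeg_add_eq k₀ A' (A := IntermediateField.adjoin k₀ S),
      trdeg_eq_zero (R := A') (A := IntermediateField.adjoin k₀ S), add_zero]
  rw [htrA'] at htrA''
  have hsn : s = n := by exact_mod_cast htrA''
  rw [hsA', hnA, hsn]

/-- **The three side obligations of F-32 for the M-side model over the small field**: closed centre, excellence, dimension `3`. [folklore] -/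
theorem model_side_obligations₂ (p : ℕ) [Fact p.Prime] [CharP K p]
    (hFrob : ∀ c : k, ∃ c₀ : k₀, algebraMap k₀ K c₀ = algebraMap k K c ^ p)
    (O : ValuationSubring K) (A : Subalgebra k K)
    (hAO : A.toSubring ≤ O.toSubring) (hAfg : A.FG) [IsFractionRing A K] (hdim : ringKrullDim A = 3)
    (t : Set K) (ht : Algebra.adjoin k t = A)
    (hzd : ∀ (T : Subring K) (hT : T ≤ O.toSubring), A.toSubring ≤ T → (subringCentre T O hT).IsMaximal)
    (S : Set K) (htS : (fun x : K => x ^ p) '' t ⊆ S)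
    (A' : Subalgebra k₀ (IntermediateField.adjoin k₀ S))
    (h : A'.toSubring ≤ (O.comap (algebraMap (IntermediateField.adjoin k₀ S) K)).toSubring)
    (hSA' : Algebra.adjoin k₀ ((Subtype.val : IntermediateField.adjoin k₀ S → K) ⁻¹' S) ≤ A') (hA'fg : A'.FG) :
    (centreIdeal A' (O.comap (algebraMap (IntermediateField.adjoin k₀ S) K)) h).IsMaximal ∧
      IsExcellentRing (Localization.AtPrime (centreIdeal A' (O.comap (algebraMap (IntermediateField.adjoin k₀ S) K)) h)) ∧
      ringKrullDim (Localization.AtPrime (centreIdeal A' (O.comap (algebraMap (IntermediateField.adjoin k₀ S) K)) h)) = 3 := by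
  have hp : 0 < p := (Fact.out : p.Prime).pos
  have htA' : ∀ a ∈ t, ∃ y ∈ A', algebraMap (IntermediateField.adjoin k₀ S) K y = a ^ p := by
    intro a ha
    have haS : a ^ p ∈ S := htS ⟨a, ha, rfl⟩
    refine ⟨⟨a ^ p, IntermediateField.subset_adjoin k₀ S haS⟩, hSA' (Algebra.subset_adjoin haS), rfl⟩
  have hmax := centreIdeal_isMaximal_of_pow_generators₂ hp hFrob O A hAO t ht hzd (IntermediateField.adjoin k₀ S) A' h htA'
  refine ⟨hmax, TwistModel.isExcellentRing_localization_centre _ _ A' h hA'fg, ?_⟩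
  haveI := hmax
  haveI : Algebra.FiniteType k₀ A' := A'.fg_iff_finiteType.mp hA'fg
  have halg : Algebra.IsAlgebraic (IntermediateField.adjoin k₀ S) K :=
    TwistModel.isAlgebraic_of_pow_mem _ hp (pow_mem_intermediateField_adjoin₂ p hFrob A t ht S htS)
  rw [ringKrullDim_localization_atPrime_eq_of_isMaximal k₀ (centreIdeal A' _ h),
    ringKrullDim_eq_of_adjoin_le₂ hp hFrob A hAfg S halg A' hSA' hA'fg, hdim]

/-- **§2 over the small field, assembled**: customer data on the `k`-side + F-02 `.lu3` at `k₀` give, on the twist field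
`k₀(t^p ∪ {g₁})`, a finitely generated `k₀`-model `A' ⊇ k₀[t^p, g₁]` inside `O` whose localisation at the centre satisfies every
hypothesis of F-32 (regular, excellent, `dim = 3`, inside `O`, dominated). [folklore] -/
theorem exists_twist_model₂ (p : ℕ) [Fact p.Prime] [CharP K p]
    (hFrob : ∀ c : k, ∃ c₀ : k₀, algebraMap k₀ K c₀ = algebraMap k K c ^ p)
    (hLU : LocalUniformization3 k₀) (O : ValuationSubring K)
    (A : Subalgebra k K) (hAO : A.toSubring ≤ O.toSubring) (hAfg : A.FG) [IsFractionRing A K] (hdimA : ringKrullDim A = 3)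
    (t : Finset K) (ht : Algebra.adjoin k (t : Set K) = A)
    (hzd : ∀ (T : Subring K) (hT : T ≤ O.toSubring), A.toSubring ≤ T → (subringCentre T O hT).IsMaximal)
    (g₁ : K) (hg₁ : g₁ ∈ O) (S : Set K) (hS : S = (fun x : K => x ^ p) '' (t : Set K) ∪ {g₁}) :
    ∃ (A' : Subalgebra k₀ (IntermediateField.adjoin k₀ S)),
      A'.toSubring ≤ (O.comap (algebraMap (IntermediateField.adjoin k₀ S) K)).toSubring ∧
      Algebra.adjoin k₀ ((Subtype.val : IntermediateField.adjoin k₀ S → K) ⁻¹' S) ≤ A' ∧ A'.FG ∧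
      ∃ _ : IsRegularLocalRing (locAtCentre A'.toSubring (O.comap (algebraMap (IntermediateField.adjoin k₀ S) K))),
        IsExcellentRing (locAtCentre A'.toSubring (O.comap (algebraMap (IntermediateField.adjoin k₀ S) K))) ∧
        ringKrullDim (locAtCentre A'.toSubring (O.comap (algebraMap (IntermediateField.adjoin k₀ S) K))) = 3 ∧
        (∀ r : locAtCentre A'.toSubring (O.comap (algebraMap (IntermediateField.adjoin k₀ S) K)),
          algebraMap (IntermediateField.adjoin k₀ S) K (r : IntermediateField.adjoin k₀ S) ∈ O) ∧
        (∀ r : locAtCentre A'.toSubring (O.comap (algebraMap (IntermediateField.adjoin k₀ S) K)),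
          r ∈ IsLocalRing.maximalIdeal _ ↔
            O.valuation (algebraMap (IntermediateField.adjoin k₀ S) K (r : IntermediateField.adjoin k₀ S)) < 1) := by
  have hp : 0 < p := (Fact.out : p.Prime).pos
  have hSfin : S.Finite := by
    rw [hS]
    exact ((t.finite_toSet).image _).union (Set.finite_singleton _)
  have hSO : ∀ s ∈ S, s ∈ O := by
    intro s hs
    rw [hS] at hs
    rcases hs with ⟨a, ha, rfl⟩ | hs
    · have haA : a ∈ A := by rw [← ht]; exact Algebra.subset_adjoin ha
      exact (pow_mem (hAO haA) p : a ^ p ∈ O.toSubring)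
    · rw [Set.mem_singleton_iff.mp hs]; exact hg₁
  have htS : (fun x : K => x ^ p) '' (t : Set K) ⊆ S := by rw [hS]; exact Set.subset_union_left
  obtain ⟨A', h, hSA', hA'fg, hreg⟩ :=
    exists_regular_model_subfield₂ hp hFrob hLU O A hAO hAfg inferInstance hdimA.le S hSfin hSO
  obtain ⟨hmax, -, -⟩ := model_side_obligations₂ p hFrob O A hAO hAfg hdimA (t : Set K) ht hzd S htS A' h hSA' hA'fg
  have halg : Algebra.IsAlgebraic (IntermediateField.adjoin k₀ S) K :=
    TwistModel.isAlgebraic_of_pow_mem _ hp (pow_mem_intermediateField_adjoin₂ p hFrob A (t : Set K) ht S htS)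
  have hdimA' : ringKrullDim A' = 3 := by rw [ringKrullDim_eq_of_adjoin_le₂ hp hFrob A hAfg S halg A' hSA' hA'fg, hdimA]
  exact ⟨A', h, hSA', hA'fg, TwistModel.locAtCentre_port_inputs O _ A' h hA'fg hmax hreg hdimA'⟩

/-- **Closed centre and dimension `3` for a `k₀`-model containing `p`-th powers of the `k`-generators.** [folklore] -/
theorem centre_closed_and_dim_three_of_pow_mem₂ {p : ℕ} (hp : 0 < p)
    (hFrob : ∀ c : k, ∃ c₀ : k₀, algebraMap k₀ K c₀ = algebraMap k K c ^ p)
    (O : ValuationSubring K) (A : Subalgebra k K) (hAO : A.toSubring ≤ O.toSubring) (hAfg : A.FG) [IsFractionRing A K]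
    (hdimA : ringKrullDim A = 3) (t : Finset K) (ht : Algebra.adjoin k (t : Set K) = A)
    (hzd : ∀ (T : Subring K) (hT : T ≤ O.toSubring), A.toSubring ≤ T → (subringCentre T O hT).IsMaximal)
    (A₂ : Subalgebra k₀ K) (hA₂O : A₂.toSubring ≤ O.toSubring) (hA₂fg : A₂.FG) (hAp : ∀ a ∈ (t : Set K), a ^ p ∈ A₂) :
    (subringCentre A₂.toSubring O hA₂O).IsMaximal ∧ ringKrullDim A₂ = 3 ∧ ringKrullDim (locAtCentre A₂.toSubring O) = 3 := by
  classical
  have hk : ∀ c : k, algebraMap k K c ∈ O := fun c => hAO (A.algebraMap_mem c)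
  have htA : ∀ a ∈ (t : Set K), a ∈ A := fun a ha => by rw [← ht]; exact Algebra.subset_adjoin ha
  have hkA₂ : ∀ c : k, algebraMap k K c ^ p ∈ A₂ := fun c => by
    obtain ⟨c₀, hc₀⟩ := hFrob c; rw [← hc₀]; exact A₂.algebraMap_mem c₀
  obtain ⟨G, hG⟩ := id hA₂fg
  have hGA₂ : ∀ g ∈ (G : Set K), g ∈ A₂ := fun g hg => by rw [← hG]; exact Algebra.subset_adjoin hg
  let C : Subalgebra k K := Algebra.adjoin k ((G : Set K) ∪ ↑t)
  have hCfg : C.FG := ⟨G ∪ t, by rw [Finset.coe_union]⟩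
  have hA₂C : A₂.toSubring ≤ C.toSubring := by
    intro x hx
    have hx' : x ∈ Algebra.adjoin k₀ (G : Set K) := by rw [hG]; exact hx
    change x ∈ C
    clear hx
    induction hx' using Algebra.adjoin_induction with
    | mem x hx => exact Algebra.subset_adjoin (Or.inl hx)
    | algebraMap r => rw [IsScalarTower.algebraMap_apply k₀ k K]; exact C.algebraMap_mem _
    | add x y _ _ hx hy => exact add_mem hx hy
    | mul x y _ _ hx hy => exact mul_mem hx hy
  have hAC : A ≤ C := by
    intro x hx
    rw [← ht] at hx
    exact Algebra.adjoin_mono Set.subset_union_right hx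
  have hCO : C.toSubring ≤ O.toSubring := by
    intro x hx
    rw [Subalgebra.mem_toSubring] at hx
    change x ∈ O
    induction hx using Algebra.adjoin_induction with
    | mem x hx =>
        rcases hx with hx | hx
        · exact hA₂O (hGA₂ x hx)
        · exact hAO (htA x hx)
    | algebraMap r => exact hk r
    | add x y _ _ hx hy => exact O.add_mem _ _ hx hy
    | mul x y _ _ hx hy => exact O.mul_mem _ _ hx hy
  have hmaxC : (subringCentre C.toSubring O hCO).IsMaximal := hzd C.toSubring hCO (fun x hx => hAC hx)
  letI algAC : Algebra A₂.toSubring C.toSubring := (Subring.inclusion hA₂C).toAlgebra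
  have hinj : Function.Injective (algebraMap A₂.toSubring C.toSubring) := fun a b hab =>
    Subtype.ext (congrArg Subtype.val hab :)
  haveI hintAC : Algebra.IsIntegral A₂.toSubring C.toSubring := by
    constructor
    intro x
    let gC : C.toSubring →ₐ[A₂.toSubring] K :=
      { toRingHom := C.toSubring.subtype
        commutes' := fun b => rfl }
    have hgC : Function.Injective gC := Subtype.val_injective
    rw [← isIntegral_algHom_iff gC hgC]
    change IsIntegral A₂.toSubring (x : K)
    let IC : Subalgebra k K :=
      { carrier := {a : K | IsIntegral A₂.toSubring a}
        mul_mem' := fun ha hb => ha.mul hb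
        one_mem' := isIntegral_one
        add_mem' := fun ha hb => ha.add hb
        zero_mem' := isIntegral_zero
        algebraMap_mem' := fun r => IsIntegral.of_pow hp
          (isIntegral_algebraMap (R := A₂.toSubring) (A := K) (x := ⟨algebraMap k K r ^ p, hkA₂ r⟩)) }
    have hCle : C ≤ IC := by
      apply Algebra.adjoin_le
      rintro a (ha | ha)
      · change IsIntegral A₂.toSubring a
        exact isIntegral_algebraMap (R := A₂.toSubring) (A := K) (x := ⟨a, hGA₂ a ha⟩)
      · change IsIntegral A₂.toSubring a
        exact IsIntegral.of_pow hp (isIntegral_algebraMap (R := A₂.toSubring) (A := K) (x := ⟨a ^ p, hAp a ha⟩))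
    exact hCle x.2
  have hmaxA₂ : (subringCentre A₂.toSubring O hA₂O).IsMaximal := by
    have h1 : ((subringCentre C.toSubring O hCO).comap (algebraMap A₂.toSubring C.toSubring)).IsMaximal :=
      Ideal.isMaximal_comap_of_isIntegral_of_isMaximal _
    have h2 : (subringCentre C.toSubring O hCO).comap (algebraMap A₂.toSubring C.toSubring) =
        subringCentre A₂.toSubring O hA₂O := by
      ext a
      rw [Ideal.mem_comap, mem_subringCentre_iff, mem_subringCentre_iff]
      rfl
    rw [← h2]
    exact h1
  have hdimC : ringKrullDim C = 3 := by rw [ringKrullDim_eq_of_fg_of_le hAfg hCfg hAC, hdimA]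
  have hdimA₂ : ringKrullDim A₂ = 3 := by
    have h1 := Literature.RingTheory.KrullDimension.ringKrullDim_eq_of_isIntegral (R := A₂.toSubring) (S := C.toSubring) hinj
    change ringKrullDim A₂.toSubring = 3
    rw [h1]
    exact hdimC
  refine ⟨hmaxA₂, hdimA₂, ?_⟩
  rw [ringKrullDim_locAtCentre_eq_of_isMaximal A₂ hA₂fg O hA₂O hmaxA₂, hdimA₂]


/-! ## PORT 2′_∞ core — the monomialising regular `k₀`-model inside `M` (F-02 over the small field `k₀`, F-32 verbatim), `A` a `k`-model -/

open AlgebraicGeometry CategoryTheory in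
set_option maxHeartbeats 800000 in
/-- **PORT 2 core, two-field version.**  Copy of `Lens5_TPrime.lean` rev 3 `port_monomialModel_core` (itself ✓ `PRankTwoAssembly.port_monomialModel`
without `PerfectField`) in which the affine model `A = k[t]` stays a `k`-algebra while F-02 (`hLU : LocalUniformization3 k₀`) and the whole
M-side (twist field `k₀(t^p ∪ {g₁}) = K^p(g₀^{±1}) = M`, regular model `A'`, re-model `A₂ = k₀[A' ∪ uu]`) live over a SMALL field `k₀ → k`
with `k₀ ⊆ K^p` (`hk₀p`) and `k^p ⊆ k₀` (`hFrob`) — so that `A` need NOT be finitely generated over `k₀` (the point of T′_∞: `[k : k^p] = ∞`).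
Consumes F-02 (`hLU`, via `exists_twist_model₂`) and F-32 (`hEmb`, via ✓ `exists_localRing_monomial_of_embeddedResolution`).
[cite: CossartPiltant2019, Thm. 1.1; CossartJannsenSaito2020, Thm. 1.6.3 (F-32)] -/
theorem port_monomialModel_core₂ (p : ℕ) [Fact p.Prime] [CharP K p]
    (hFrob : ∀ c : k, ∃ c₀ : k₀, algebraMap k₀ K c₀ = algebraMap k K c ^ p)
    (hk₀p : ∀ c₀ : k₀, ∃ d : K, algebraMap k₀ K c₀ = d ^ p)
    (hLU : LocalUniformization3 k₀)
    (hEmb : ∀ (Z : Scheme.{0}) [IsIntegral Z] [IsNoetherian Z], Scheme.IsRegular Z →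
      Scheme.IsExcellent Z → ∀ (X : Set Z), IsClosed X → X ≠ Set.univ → topologicalKrullDim X ≤ 2 →
        ∃ (Z' : Scheme.{0}) (π : Z' ⟶ Z), IsProper π ∧ Function.Surjective π.base ∧
          (∃ U : Z.Opens, (U : Set Z) = Xᶜ ∧ IsIso (π ∣_ U)) ∧
          IsStrictNormalCrossingsDivisor Z' (π.base ⁻¹' X))
    (O : ValuationSubring K) (A : Subalgebra k K)
    (hAO : A.toSubring ≤ O.toSubring) (hAfg : A.FG) [IsFractionRing A K] (hdimA : ringKrullDim A ≤ 3)
    (hdim3 : ringKrullDim (locAtCentre A.toSubring O) = 3)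
    (hzd : ∀ (T : Subring K) (hT : T ≤ O.toSubring), A.toSubring ≤ T → (subringCentre T O hT).IsMaximal)
    (t : Finset K) (ht : Algebra.adjoin k (t : Set K) = A)
    (g₀ : K) (M : Subfield K) (hM : ∀ x : K, x ∈ M ↔ ∃ c : Fin p → K, ∑ j, c j ^ p * g₀ ^ (j : ℕ) = x)
    (F : Finset K) (hFM : ∀ f ∈ F, f ∈ M) (hF0 : ∀ f ∈ F, f ≠ 0) :
    ∃ (A₂ : Subalgebra k₀ K) (_ : A₂.toSubring ≤ O.toSubring), A₂.FG ∧ (∀ a ∈ A, a ^ p ∈ A₂) ∧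
      (∀ r : K, r ∈ locAtCentre A₂.toSubring O → r ∈ M) ∧
      ∃ (_ : IsRegularLocalRing (locAtCentre A₂.toSubring O)) (z : Fin 3 → locAtCentre A₂.toSubring O),
        Ideal.span (Set.range z) = IsLocalRing.maximalIdeal (locAtCentre A₂.toSubring O) ∧
        ringKrullDim (locAtCentre A₂.toSubring O) = 3 ∧ (∀ i, ((z i : K)) ≠ 0) ∧
        ∀ f ∈ F, ∃ (ε : K) (e : Fin 3 → ℤ), ε ∈ locAtCentre A₂.toSubring O ∧ O.valuation ε = 1 ∧
          f = ε * ∏ i, ((z i : K)) ^ (e i) := by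
  classical
  have hp : p.Prime := Fact.out
  have hdimAeq : ringKrullDim A = 3 := ringKrullDim_eq_three_of_locAtCentre O A hAO hdimA hdim3
  have hk : ∀ c : k, algebraMap k K c ∈ O := fun c => hAO (A.algebraMap_mem c)
  have hk₀O : ∀ c : k₀, algebraMap k₀ K c ∈ O := fun c => by
    rw [IsScalarTower.algebraMap_apply k₀ k K]; exact hk _
  -- the `k₀`-subalgebra `O` (for `Algebra.adjoin_le` arguments)
  let Ok : Subalgebra k₀ K := { O.toSubring with algebraMap_mem' := hk₀O }
  have hOk : ∀ x : K, x ∈ Ok ↔ x ∈ O := fun _ => Iff.rfl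
  obtain ⟨g₁, hg₁O, hg₁⟩ := TwistModel.mem_or_inv_mem_valuationSubring O g₀
  -- ## the twist field `k₀(S)`, `S = t^p ∪ {g₁}`, and its regular model (F-02 at `k₀`, `exists_twist_model₂`)
  set S : Set K := (fun x : K => x ^ p) '' (t : Set K) ∪ {g₁} with hSdef
  obtain ⟨A', hA'O', hSA', hA'fg, hreg', hexc, hdim', hRO, hRm⟩ :=
    exists_twist_model₂ p hFrob hLU O A hAO hAfg hdimAeq t ht hzd g₁ hg₁O S hSdef
  set R : Subring (IntermediateField.adjoin k₀ S) :=
    locAtCentre A'.toSubring (O.comap (algebraMap (IntermediateField.adjoin k₀ S) K)) with hRdef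
  haveI : IsRegularLocalRing R := hreg'
  haveI : IsScalarTower R (IntermediateField.adjoin k₀ S) K := IsScalarTower.of_algebraMap_eq (fun _ => rfl)
  have halgR : ∀ r : R, algebraMap R K r = ((r : IntermediateField.adjoin k₀ S) : K) := fun _ => rfl
  -- ## `k₀(S)` has underlying subfield `M = K^p(g₀)` (`adjoin_twist_toSubfield_eq₂`)
  have hM'sub : (IntermediateField.adjoin k₀ S).toSubfield = Subfield.closure (Set.range (frobenius K p) ∪ {g₀}) := by
    rw [hSdef, adjoin_twist_toSubfield_eq₂ p hFrob hk₀p A (t : Set K) ht g₁]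
    rcases hg₁ with h | h
    · rw [h]
    · rw [h, TwistModel.subfield_closure_union_inv_eq]
  have hM'M : ∀ x : K, x ∈ IntermediateField.adjoin k₀ S ↔ x ∈ M := by
    intro x
    rw [← IntermediateField.mem_toSubfield, hM'sub]
    constructor
    · intro hx
      refine (Subfield.closure_le (t := M)).mpr ?_ hx
      rintro y (⟨c, rfl⟩ | hy)
      · refine (hM _).mpr ⟨fun j => if (j : ℕ) = 0 then c else 0, ?_⟩
        rw [Finset.sum_eq_single (⟨0, hp.pos⟩ : Fin p)]
        · simp [frobenius_def]
        · intro j _ hj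
          have hj' : (j : ℕ) ≠ 0 := fun h => hj (Fin.ext h)
          simp [hj', hp.ne_zero]
        · intro h; exact absurd (Finset.mem_univ _) h
      · rw [Set.mem_singleton_iff.mp hy]
        refine (hM _).mpr ⟨fun j => if (j : ℕ) = 1 then 1 else 0, ?_⟩
        rw [Finset.sum_eq_single (⟨1, hp.one_lt⟩ : Fin p)]
        · simp
        · intro j _ hj
          have hj' : (j : ℕ) ≠ 1 := fun h => hj (Fin.ext h)
          simp [hj', hp.ne_zero]
        · intro h; exact absurd (Finset.mem_univ _) h
    · intro hx
      obtain ⟨c, rfl⟩ := (hM x).mp hx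
      have hg₀c : g₀ ∈ Subfield.closure (Set.range (frobenius K p) ∪ {g₀}) := Subfield.subset_closure (Or.inr rfl)
      refine sum_mem fun j _ => mul_mem ?_ (pow_mem hg₀c _)
      exact Subfield.subset_closure (Or.inl ⟨c j, frobenius_def _ _⟩)
  -- ## every `f ∈ F` is a quotient of two non-zero elements of `k₀[S]`, which lift to `R`
  have hFfrac : ∀ f ∈ F, ∃ c d : K, c ∈ Algebra.adjoin k₀ S ∧ d ∈ Algebra.adjoin k₀ S ∧ c ≠ 0 ∧ d ≠ 0 ∧ f = c / d := by
    intro f hf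
    have hfM' : f ∈ IntermediateField.adjoin k₀ S := (hM'M f).mpr (hFM f hf)
    obtain ⟨c, hc, d, hd, hcd⟩ := IntermediateField.mem_adjoin_iff_div.mp hfM'
    have hd0 : d ≠ 0 := by
      rintro rfl
      rw [div_zero] at hcd
      exact hF0 f hf hcd
    have hc0 : c ≠ 0 := by
      rintro rfl
      rw [zero_div] at hcd
      exact hF0 f hf hcd
    exact ⟨c, d, hc, hd, hc0, hd0, hcd⟩
  choose! cF dF hcF hdF hcF0 hdF0 hFeq using hFfrac
  have hpre : ∀ c : K, c ∈ Algebra.adjoin k₀ S → ∃ r : R, algebraMap R K r = c := by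
    intro c hc
    have hcM' : c ∈ IntermediateField.adjoin k₀ S := IntermediateField.algebra_adjoin_le_adjoin k₀ S hc
    have h1 : (⟨c, hcM'⟩ : IntermediateField.adjoin k₀ S) ∈ A' :=
      hSA' ((TwistModel.mem_adjoin_preimage_iff S ⟨c, hcM'⟩).mpr hc)
    exact ⟨⟨⟨c, hcM'⟩, le_locAtCentre A'.toSubring _ h1⟩, rfl⟩
  have hcpre : ∀ f ∈ F, ∃ r : R, algebraMap R K r = cF f := fun f hf => hpre _ (hcF f hf)
  have hdpre : ∀ f ∈ F, ∃ r : R, algebraMap R K r = dF f := fun f hf => hpre _ (hdF f hf)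
  choose! rc hrc using hcpre
  choose! rd hrd using hdpre
  -- ## the element to monomialise: `xR = g · ∏_f c_f d_f`, `0 ≠ g ∈ 𝔪_R`
  have hmne : maximalIdeal R ≠ ⊥ := by
    intro h
    have hf : IsField R := (IsLocalRing.isField_iff_maximalIdeal_eq).mpr h
    have h0 := ringKrullDim_eq_zero_of_isField hf
    rw [hdim'] at h0
    norm_num at h0
  obtain ⟨g, hgm, hg0⟩ := Submodule.exists_mem_ne_zero_of_ne_bot hmne
  set xR : R := g * ∏ f ∈ F, (rc f * rd f) with hxRdef
  have hxR0 : xR ≠ 0 := by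
    refine mul_ne_zero hg0 (Finset.prod_ne_zero_iff.mpr fun f hf => mul_ne_zero ?_ ?_)
    · intro h
      exact hcF0 f hf (by rw [← hrc f hf, h, map_zero])
    · intro h
      exact hdF0 f hf (by rw [← hrd f hf, h, map_zero])
  have hxRm : xR ∈ maximalIdeal R := Ideal.mul_mem_right _ _ hgm
  -- ## F-32 on the M-side model
  have hRO' : ∀ r : R, algebraMap R K r ∈ O := fun r => hRO r
  have hRm' : ∀ r : R, r ∈ maximalIdeal R ↔ O.valuation (algebraMap R K r) < 1 := fun r => hRm r
  obtain ⟨uu, huuM', huuO, R', _, _, _, hinj, hR'O, hR'm, hlow, hup, d, z, α, u, hu, hdimR', hspan, hfact⟩ :=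
    exists_localRing_monomial_of_embeddedResolution hEmb (R := R) (K := IntermediateField.adjoin k₀ S) (E := K)
      Subtype.val_injective hexc hdim' O
      hRO' hRm' xR hxR0 hxRm
  -- ## RE-MODEL on the `K`-side: `T = R[uu]`, `B = A'` read in `K`, `A₂ = k₀[B ∪ uu]`, `locAtCentre T O = locAtCentre A₂ O`
  let T : Subring K := (Algebra.adjoin R (uu : Set K)).toSubring
  have hTO : T ≤ O.toSubring := fun w hw => huuO w hw
  have hTR : ∀ w ∈ T, w ∈ Set.range (algebraMap R' K) := fun w hw => hlow w hw
  have hRT : ∀ r : R, algebraMap R K r ∈ T := fun r => (Algebra.adjoin R (uu : Set K)).algebraMap_mem r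
  have huuO' : ∀ w ∈ (uu : Set K), w ∈ O := fun w hw => huuO w (Algebra.subset_adjoin hw)
  set φ : IntermediateField.adjoin k₀ S →ₐ[k₀] K := IsScalarTower.toAlgHom k₀ (IntermediateField.adjoin k₀ S) K with hφdef
  have hφ : ∀ y : IntermediateField.adjoin k₀ S, φ y = (y : K) := fun _ => rfl
  set B : Subalgebra k₀ K := A'.map φ with hBdef
  have hBfg : B.FG := hA'fg.map φ
  have hBO : ∀ x ∈ (B : Set K), x ∈ O := by
    intro x hx
    obtain ⟨y, hy, rfl⟩ := Subalgebra.mem_map.mp hx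
    exact ValuationSubring.mem_comap.mp (hA'O' hy)
  set A₂ : Subalgebra k₀ K := Algebra.adjoin k₀ ((B : Set K) ∪ ↑uu) with hA₂def
  have hA₂fg : A₂.FG := fg_adjoin_subalgebra_union B hBfg uu
  have hBA₂ : B ≤ A₂ := fun x hx => Algebra.subset_adjoin (Or.inl hx)
  have huuA₂ : ∀ w ∈ (uu : Set K), w ∈ A₂ := fun w hw => Algebra.subset_adjoin (Or.inr hw)
  have hA₂Ok : A₂ ≤ Ok := Algebra.adjoin_le (Set.union_subset hBO huuO')
  have hA₂O : A₂.toSubring ≤ O.toSubring := fun x hx => hA₂Ok hx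
  -- values in `O ∩ k₀(S)` are read in `K`
  have hval1 : ∀ y : IntermediateField.adjoin k₀ S, y ∈ O.comap (algebraMap (IntermediateField.adjoin k₀ S) K) →
      ((O.comap (algebraMap (IntermediateField.adjoin k₀ S) K)).valuation y = 1 ↔
        O.valuation (algebraMap (IntermediateField.adjoin k₀ S) K y) = 1) := by
    intro y hy
    have hyO : algebraMap (IntermediateField.adjoin k₀ S) K y ∈ O := ValuationSubring.mem_comap.mp hy
    have hlt := TwistModel.valuation_comap_lt_one_iff O (IntermediateField.adjoin k₀ S) y hy
    have hle' : (O.comap (algebraMap (IntermediateField.adjoin k₀ S) K)).valuation y ≤ 1 :=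
      ((O.comap (algebraMap (IntermediateField.adjoin k₀ S) K)).valuation_le_one_iff y).mpr hy
    have hle : O.valuation (algebraMap (IntermediateField.adjoin k₀ S) K y) ≤ 1 := (O.valuation_le_one_iff _).mpr hyO
    constructor
    · intro h1
      rcases hle.lt_or_eq with h | h
      · have h' := hlt.mpr h
        rw [h1] at h'
        exact absurd h' (lt_irrefl _)
      · exact h
    · intro h1
      rcases hle'.lt_or_eq with h | h
      · have h' := hlt.mp h
        rw [h1] at h'
        exact absurd h' (lt_irrefl _)
      · exact h
  have hrangeR : Set.range (algebraMap R K) = (locAtCentre B.toSubring O : Set K) := by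
    ext x
    constructor
    · rintro ⟨r, rfl⟩
      obtain ⟨y, hy, w, hw, hw1, hr⟩ := (mem_locAtCentre_iff).mp r.2
      have hyB : (y : K) ∈ B := Subalgebra.mem_map.mpr ⟨y, hy, rfl⟩
      have hwB : (w : K) ∈ B := Subalgebra.mem_map.mpr ⟨w, hw, rfl⟩
      have hw1' : O.valuation (w : K) = 1 := (hval1 w (hA'O' hw)).mp hw1
      refine (mem_locAtCentre_iff).mpr ⟨y, hyB, w, hwB, hw1', ?_⟩
      rw [halgR, hr]
      push_cast
      rfl
    · intro hx
      obtain ⟨y, hy, w, hw, hw1, rfl⟩ := (mem_locAtCentre_iff).mp hx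
      obtain ⟨y', hy', rfl⟩ := Subalgebra.mem_map.mp hy
      obtain ⟨w', hw', rfl⟩ := Subalgebra.mem_map.mp hw
      have hw'1 : (O.comap (algebraMap (IntermediateField.adjoin k₀ S) K)).valuation w' = 1 := (hval1 w' (hA'O' hw')).mpr hw1
      refine ⟨⟨y' / w', (mem_locAtCentre_iff).mpr ⟨y', hy', w', hw', hw'1, rfl⟩⟩, ?_⟩
      rw [halgR]
      push_cast
      rfl
  have hT : T = Subring.closure ((locAtCentre B.toSubring O : Set K) ∪ ↑uu) := by
    change (Algebra.adjoin R (uu : Set K)).toSubring = _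
    rw [Algebra.adjoin_eq_ring_closure, hrangeR]
  have hR₂eq : locAtCentre T O = locAtCentre A₂.toSubring O := by
    rw [hT, Summit.ResolutionOfSingularities.ResolutionOfSingularities.Theorems.PfaffLine.locAtCentre_closure_locAtCentre_union,
      Subalgebra.coe_toSubring, closure_subalgebra_union_eq]
  -- regular data transported to `R₂ := locAtCentre A₂ O` along `R' ≅ range = R₂`
  set R₂ : Subring K := locAtCentre A₂.toSubring O with hR₂def
  have hrange0 : (algebraMap R' K).range = locAtCentre T O :=
    Summit.ResolutionOfSingularities.ResolutionOfSingularities.Theorems.RadicialJung.CleanModels.range_eq_locAtCentre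
      (algebraMap R' K) O T hTR hR'm hup
  have hrange : (algebraMap R' K).range = R₂ := hrange0.trans hR₂eq
  obtain ⟨hreg₂, z₂, u₂, hz₂, hu₂K, hspan₂, hdim₂, hu₂⟩ :=
    Summit.ResolutionOfSingularities.ResolutionOfSingularities.Theorems.RadicialJung.CleanModels.regular_data_of_range_eq
      (algebraMap R' K) hinj R₂ hrange z hspan hdimR' u hu
  haveI := hreg₂
  have hR₂O : R₂ ≤ O.toSubring := locAtCentre_le hA₂O
  have hTR₂ : T ≤ R₂ := le_of_le_of_eq (le_locAtCentre T O) hR₂eq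
  -- ## `S ⊆ B`, hence `t^p ⊆ A₂` and `A^p ⊆ A₂`
  have hSB : ∀ s ∈ S, s ∈ B := by
    intro s hs
    have hsM' : s ∈ IntermediateField.adjoin k₀ S := IntermediateField.subset_adjoin k₀ S hs
    have h1 : (⟨s, hsM'⟩ : IntermediateField.adjoin k₀ S) ∈ A' :=
      hSA' (Algebra.subset_adjoin
        (show (⟨s, hsM'⟩ : IntermediateField.adjoin k₀ S) ∈ (Subtype.val : IntermediateField.adjoin k₀ S → K) ⁻¹' S from hs))
    exact Subalgebra.mem_map.mpr ⟨⟨s, hsM'⟩, h1, rfl⟩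
  have hAp : ∀ a ∈ A, a ^ p ∈ A₂ := by
    intro a ha
    have ha' : a ∈ Algebra.adjoin k (t : Set K) := by rw [ht]; exact ha
    have h1 := pow_mem_adjoin_image_pow₂ p hFrob (t : Set K) ha'
    refine (Algebra.adjoin_le ?_ : Algebra.adjoin k₀ ((fun x : K => x ^ p) '' (t : Set K)) ≤ A₂) h1
    intro s hs
    exact hBA₂ (hSB s (by rw [hSdef]; exact Or.inl hs))
  -- ## `d = 3`: `centre_closed_and_dim_three_of_pow_mem₂`
  have htpA₂ : ∀ a ∈ (t : Set K), a ^ p ∈ A₂ := fun a ha => hAp a (by rw [← ht]; exact Algebra.subset_adjoin ha)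
  obtain ⟨-, -, hdimR₂'⟩ :=
    centre_closed_and_dim_three_of_pow_mem₂ hp.pos hFrob O A hAO hAfg hdimAeq t ht hzd A₂ hA₂O hA₂fg htpA₂
  have hdimR₂ : ringKrullDim R₂ = 3 := hdimR₂'
  have hd3 : d = 3 := by
    have h := hdim₂.symm.trans hdimR₂
    exact_mod_cast h
  subst hd3
  -- ## `z₂` is a regular system of parameters; `xR = u₂ ∏ z₂^α` in `R₂`
  have hd' : (maximalIdeal R₂).spanFinrank = 3 := by
    have h := IsRegularLocalRing.spanFinrank_maximalIdeal (R := R₂)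
    rw [hdim₂] at h
    exact_mod_cast h
  have hzr : IsRsopPart z₂ := isRsopPart_comp_of_rsop hd' z₂ hspan₂ id Function.injective_id
  have hz0 : ∀ i, (z₂ i : K) ≠ 0 := fun i h => hzr.ne_zero i (Subtype.ext h)
  let ψ : R →+* R₂ := (algebraMap R K).codRestrict R₂ (fun r => hTR₂ (hRT r))
  have hψK : ∀ r : R, ((ψ r : R₂) : K) = algebraMap R K r := fun _ => rfl
  have hfact₂ : ψ xR = u₂ * ∏ i, z₂ i ^ α i := by
    apply Subtype.ext
    rw [hψK, hfact]
    push_cast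
    simp only [hu₂K, hz₂]
  -- ## `locAtCentre A₂ O ⊆ M`
  let MR : Subalgebra R K :=
    { (IntermediateField.adjoin k₀ S).toSubalgebra.toSubring with
      algebraMap_mem' := fun r : R => ((r : IntermediateField.adjoin k₀ S)).2 }
  have huuMR : (uu : Set K) ⊆ (MR : Set K) := by
    intro w hw
    obtain ⟨y, rfl⟩ := huuM' hw
    exact y.2
  have hTM' : ∀ x ∈ T, x ∈ IntermediateField.adjoin k₀ S := fun x hx =>
    (Algebra.adjoin_le huuMR : Algebra.adjoin R (uu : Set K) ≤ MR) hx
  have hR₂M : ∀ r : K, r ∈ locAtCentre A₂.toSubring O → r ∈ M := by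
    intro r hr
    have hr' : r ∈ locAtCentre T O := (le_of_eq hR₂eq.symm) hr
    obtain ⟨y, hy, w, hw, -, rfl⟩ := mem_locAtCentre_iff.mp hr'
    exact (hM'M _).mp (div_mem (hTM' y hy) (hTM' w hw))
  -- ## assemble
  refine ⟨A₂, hA₂O, hA₂fg, hAp, hR₂M, hreg₂, z₂, hspan₂, hdimR₂, hz0, ?_⟩
  intro f hf
  have hsplit_c : xR = rc f * (g * rd f * ∏ f' ∈ F.erase f, (rc f' * rd f')) := by
    rw [hxRdef, ← Finset.mul_prod_erase F (fun f' => rc f' * rd f') hf]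
    ring
  have hsplit_d : xR = rd f * (g * rc f * ∏ f' ∈ F.erase f, (rc f' * rd f')) := by
    rw [hxRdef, ← Finset.mul_prod_erase F (fun f' => rc f' * rd f') hf]
    ring
  have hdvd_c : ψ (rc f) ∣ ∏ i, z₂ i ^ α i :=
    (hu₂.dvd_mul_left).mp ⟨ψ (g * rd f * ∏ f' ∈ F.erase f, (rc f' * rd f')), by rw [← map_mul, ← hsplit_c, hfact₂]⟩
  have hdvd_d : ψ (rd f) ∣ ∏ i, z₂ i ^ α i :=
    (hu₂.dvd_mul_left).mp ⟨ψ (g * rc f * ∏ f' ∈ F.erase f, (rc f' * rd f')), by rw [← map_mul, ← hsplit_d, hfact₂]⟩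
  obtain ⟨c₁, β, hcβ⟩ := CossartPiltantMonomial.exists_eq_units_mul_prod_pow_of_dvd (fun i => hzr.prime i) α hdvd_c
  obtain ⟨c₂, γ, hdγ⟩ := CossartPiltantMonomial.exists_eq_units_mul_prod_pow_of_dvd (fun i => hzr.prime i) α hdvd_d
  have hcK : cF f = ((c₁ : R₂) : K) * ∏ i, (z₂ i : K) ^ β i := by
    have h := congrArg (fun w : R₂ => (w : K)) hcβ
    simp only [hψK, hrc f hf] at h
    rw [h]
    push_cast
    rfl
  have hdK : dF f = ((c₂ : R₂) : K) * ∏ i, (z₂ i : K) ^ γ i := by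
    have h := congrArg (fun w : R₂ => (w : K)) hdγ
    simp only [hψK, hrd f hf] at h
    rw [h]
    push_cast
    rfl
  let u' : R₂ := (c₁ * c₂⁻¹ : R₂ˣ)
  have hu' : IsUnit u' := Units.isUnit _
  let e : Fin 3 → ℤ := fun i => (β i : ℤ) - (γ i : ℤ)
  have hc₂0 : ((c₂ : R₂) : K) ≠ 0 := fun h => by
    have : ((c₂ : R₂) : K) * ((↑(c₂⁻¹ : R₂ˣ) : R₂) : K) = 1 := by
      rw [← Subring.coe_mul, ← Units.val_mul, mul_inv_cancel, Units.val_one, Subring.coe_one]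
    rw [h, zero_mul] at this
    exact zero_ne_one this
  have hu'K : (u' : K) = ((c₁ : R₂) : K) * (((c₂ : R₂) : K))⁻¹ := by
    have hinv : ((↑(c₂⁻¹ : R₂ˣ) : R₂) : K) = (((c₂ : R₂) : K))⁻¹ := by
      refine (eq_inv_of_mul_eq_one_right ?_)
      rw [← Subring.coe_mul, ← Units.val_mul, mul_inv_cancel, Units.val_one, Subring.coe_one]
    change (((c₁ * c₂⁻¹ : R₂ˣ) : R₂) : K) = _
    rw [Units.val_mul, Subring.coe_mul, hinv]
  have hprod : (∏ i, (z₂ i : K) ^ (e i)) = (∏ i, (z₂ i : K) ^ β i) / ∏ i, (z₂ i : K) ^ γ i := by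
    rw [← Finset.prod_div_distrib]
    refine Finset.prod_congr rfl fun i _ => ?_
    rw [zpow_sub₀ (hz0 i), zpow_natCast, zpow_natCast]
  refine ⟨(u' : K), e, u'.2, valuation_eq_one_of_isUnit_of_le O hR₂O hu', ?_⟩
  calc f = cF f / dF f := hFeq f hf
    _ = (u' : K) * ∏ i, (z₂ i : K) ^ (e i) := by
        rw [hcK, hdK, hu'K, hprod, mul_div_mul_comm, div_eq_mul_inv]

end TwoField

open AlgebraicGeometry CategoryTheory in
/-- **PORT 2′_∞ (monomialising model over `k₀ = k^p`, ARBITRARY imperfect `k`).**  Same OUTPUT as `Lens5_TPrime.lean` rev 3 `port_monomialModel'`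
(generators `G₂ ⊆ O`, the subring `C = k^p[G₂]`, `T := locAtCentre C O ⊆ M` with a regular system of parameters `z` monomialising `F`), but
WITHOUT the finite `p`-spanning family `b` of rev 3: instead of re-basing `A` to `k₀ := k^p` (which needs `[k : k^p] < ∞`), the two-field
core `TwoField.port_monomialModel_core₂` keeps `A` a `k`-algebra and runs F-02 / F-32 on the `k^p`-side (`k^p(t^p, g₁) = K^p(g₀)` has
transcendence degree `3` over `k^p` for ANY `k`).  PROVED; consumes `hLU : LocalUniformization3 ↥(frobenius k p).fieldRange` and `hEmb`.
[cite: CossartPiltant2019, Thm. 1.1; CossartJannsenSaito2020, Thm. 1.6.3 (F-32)] -/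
theorem port_monomialModelInf (p : ℕ) [Fact p.Prime] {k : Type} [Field k] [CharP k p]
    {K : Type} [Field K] [Algebra k K] (hLU : LocalUniformization3 ↥(frobenius k p).fieldRange)
    (hEmb : ∀ (Z : Scheme.{0}) [IsIntegral Z] [IsNoetherian Z], Scheme.IsRegular Z →
      Scheme.IsExcellent Z → ∀ (X : Set Z), IsClosed X → X ≠ Set.univ → topologicalKrullDim X ≤ 2 →
        ∃ (Z' : Scheme.{0}) (π : Z' ⟶ Z), IsProper π ∧ Function.Surjective π.base ∧
          (∃ U : Z.Opens, (U : Set Z) = Xᶜ ∧ IsIso (π ∣_ U)) ∧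
          IsStrictNormalCrossingsDivisor Z' (π.base ⁻¹' X))
    (O : ValuationSubring K) (A : Subalgebra k K)
    (hAO : A.toSubring ≤ O.toSubring) (hAfg : A.FG) [IsFractionRing A K] (hdimA : ringKrullDim A ≤ 3)
    (hdim3 : ringKrullDim (locAtCentre A.toSubring O) = 3)
    (hzd : ∀ (T : Subring K) (hT : T ≤ O.toSubring), A.toSubring ≤ T → (subringCentre T O hT).IsMaximal)
    (g₀ : K) (M : Subfield K) (hM : ∀ x : K, x ∈ M ↔ ∃ c : Fin p → K, ∑ j, c j ^ p * g₀ ^ (j : ℕ) = x)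
    (F : Finset K) (hFM : ∀ f ∈ F, f ∈ M) (hF0 : ∀ f ∈ F, f ≠ 0) :
    ∃ (G₂ : Finset K) (C : Subring K), (∀ g ∈ G₂, g ∈ O) ∧
      C = Subring.closure (Set.range (fun c : k => algebraMap k K c ^ p) ∪ (G₂ : Set K)) ∧
      (∀ a ∈ A, a ^ p ∈ C) ∧ (∀ r : K, r ∈ locAtCentre C O → r ∈ M) ∧
      ∃ (z : Fin 3 → K), (∀ i, z i ∈ locAtCentre C O) ∧ (∀ i, O.valuation (z i) < 1) ∧ (∀ i, z i ≠ 0) ∧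
        (∀ r : K, r ∈ locAtCentre C O → O.valuation r < 1 →
          ∃ b : Fin 3 → K, (∀ i, b i ∈ locAtCentre C O) ∧ r = ∑ i, b i * z i) ∧
        ∀ f ∈ F, ∃ (ε : K) (e : Fin 3 → ℤ), ε ∈ locAtCentre C O ∧ O.valuation ε = 1 ∧
          f = ε * ∏ i, z i ^ e i := by
  classical
  have hp : p.Prime := Fact.out
  haveI : CharP K p := charP_of_injective_algebraMap (algebraMap k K).injective p
  -- ## the small field `k₀ = k^p ⊆ k`, acting on `K` through `k`
  set k₀ : Subfield k := (frobenius k p).fieldRange with hk₀def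
  letI : Algebra k₀ K := Algebra.compHom K k₀.subtype
  haveI inst1 := IsScalarTower.of_algebraMap_eq (R := k₀) (S := k) (A := K) (fun _ => rfl)
  have halg₀ : ∀ c : k₀, algebraMap k₀ K c = algebraMap k K (c : k) := fun _ => rfl
  have hFrob : ∀ c : k, ∃ c₀ : k₀, algebraMap k₀ K c₀ = algebraMap k K c ^ p := fun c =>
    ⟨⟨c ^ p, RingHom.mem_fieldRange.mpr ⟨c, frobenius_def _ _⟩⟩, by rw [halg₀, map_pow]⟩
  have hk₀p : ∀ c₀ : k₀, ∃ d : K, algebraMap k₀ K c₀ = d ^ p := fun c₀ => by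
    obtain ⟨d, hd⟩ := RingHom.mem_fieldRange.mp c₀.2
    refine ⟨algebraMap k K d, ?_⟩
    rw [halg₀, ← map_pow, ← frobenius_def, hd]
  obtain ⟨t, ht⟩ := id hAfg
  -- ## the two-field core
  obtain ⟨A₂, hA₂O, hA₂fg, hAp, hR₂M, hreg₂, z₂, hspan₂, hdimR₂, hz0, hfac⟩ :=
    TwoField.port_monomialModel_core₂ p hFrob hk₀p hLU hEmb O A hAO hAfg hdimA hdim3 hzd t ht g₀ M hM F hFM hF0
  haveI := hreg₂
  -- ## conversion to `K`-terms
  obtain ⟨G₂, hG₂⟩ := hA₂fg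
  have hC : A₂.toSubring = Subring.closure (Set.range (fun c : k => algebraMap k K c ^ p) ∪ (G₂ : Set K)) := by
    rw [← hG₂, Algebra.adjoin_eq_ring_closure]
    congr 1
    ext x
    simp only [Set.mem_union, Set.mem_range]
    constructor
    · rintro (⟨c, rfl⟩ | hx)
      · obtain ⟨d, hd⟩ := RingHom.mem_fieldRange.mp c.2
        refine Or.inl ⟨d, ?_⟩
        rw [← map_pow, ← frobenius_def, hd, halg₀]
      · exact Or.inr hx
    · rintro (⟨c, rfl⟩ | hx)
      · refine Or.inl ⟨⟨c ^ p, RingHom.mem_fieldRange.mpr ⟨c, frobenius_def _ _⟩⟩, ?_⟩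
        rw [halg₀, map_pow]
      · exact Or.inr hx
  have hG₂O : ∀ g ∈ G₂, g ∈ O := fun g hg =>
    hA₂O (show g ∈ A₂ by rw [← hG₂]; exact Algebra.subset_adjoin hg)
  have hApC : ∀ a ∈ A, a ^ p ∈ A₂.toSubring := fun a ha => hAp a ha
  refine ⟨G₂, A₂.toSubring, hG₂O, hC, hApC, hR₂M, fun i => (z₂ i : K), fun i => (z₂ i).2, ?_, hz0, ?_, ?_⟩
  · intro i
    have hi : z₂ i ∈ maximalIdeal _ := by rw [← hspan₂]; exact Ideal.subset_span ⟨i, rfl⟩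
    exact (mem_maximalIdeal_locAtCentre_iff hA₂O _).mp hi
  · intro r hr hvr
    have hm : (⟨r, hr⟩ : locAtCentre A₂.toSubring O) ∈ maximalIdeal _ :=
      (mem_maximalIdeal_locAtCentre_iff hA₂O _).mpr hvr
    rw [← hspan₂, Ideal.mem_span_range_iff_exists_fun] at hm
    obtain ⟨b, hb⟩ := hm
    refine ⟨fun i => (b i : K), fun i => (b i).2, ?_⟩
    have h := congrArg (fun w : locAtCentre A₂.toSubring O => (w : K)) hb
    simp only at h
    rw [← h]
    push_cast
    rfl
  · intro f hf
    obtain ⟨ε, e, hε, hεv, hfe⟩ := hfac f hf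
    exact ⟨ε, e, hε, hεv, hfe⟩


/-! ## §F∞ The base change `T⁺ = Σ_s b_s T` for an ARBITRARY `p`-spanning family (finitely supported sums; new) -/

/-- **Base-change lemma, arbitrary `p`-rank.**  With `C = k^p[G₂]`, `T := locAtCentre C O ⊆ M` with parameters `z` spanning `𝔪_T`, and
`A₂ := k[G₂]`: `A₂` is the `C`-SPAN of the family `B = b` (a `C`-submodule closed under products: `B_s B_t ∈ k = Σ_fin k^p b_u`),
`T⁺ := locAtCentre A₂ O = Σ_fin B_s T` (Frobenius on finite sums: denominators have `p`-th powers in `C`), `𝔪_{T⁺} = (z) T⁺` (by RG on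
the finite support of an element of value `< 1`), `dim T⁺ = 3` (✓ `centre_closed_and_dim_three_of_pow_mem`), hence `T⁺` is REGULAR with
the same regular system of parameters.  PROVED. [folklore] -/
theorem basechange_modelInf (p : ℕ) [Fact p.Prime] {k : Type} [Field k] [CharP k p] {K : Type} [Field K] [Algebra k K]
    (O : ValuationSubring K) (A : Subalgebra k K) (hAO : A.toSubring ≤ O.toSubring) (hAfg : A.FG) [IsFractionRing A K]
    (hdimA : ringKrullDim A ≤ 3) (hdim3 : ringKrullDim (locAtCentre A.toSubring O) = 3)
    (hzd : ∀ (T : Subring K) (hT : T ≤ O.toSubring), A.toSubring ≤ T → (subringCentre T O hT).IsMaximal)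
    (t : Finset K) (ht : Algebra.adjoin k (t : Set K) = A)
    (M : Subfield K) {S : Type} (b : S → k) (hb : IsPSpanningFamilyInf p b)
    (hRG : ∀ (s : Finset S) (c : ↥s → K), (∀ i, c i ∈ M) →
      O.valuation (∑ i : ↥s, c i * algebraMap k K (b i)) = Finset.univ.sup (fun i => O.valuation (c i)))
    (G₂ : Finset K) (hG₂O : ∀ g ∈ G₂, g ∈ O) (C : Subring K)
    (hC : C = Subring.closure (Set.range (fun c : k => algebraMap k K c ^ p) ∪ (G₂ : Set K)))
    (hApC : ∀ a ∈ A, a ^ p ∈ C) (hCM : ∀ r : K, r ∈ locAtCentre C O → r ∈ M)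
    (z : Fin 3 → K) (hzC : ∀ i, z i ∈ locAtCentre C O) (hzv : ∀ i, O.valuation (z i) < 1)
    (hzspan : ∀ r : K, r ∈ locAtCentre C O → O.valuation r < 1 →
      ∃ b : Fin 3 → K, (∀ i, b i ∈ locAtCentre C O) ∧ r = ∑ i, b i * z i) :
    ∃ (A₂ : Subalgebra k K) (_ : A₂.toSubring ≤ O.toSubring), A₂.FG ∧ (∀ a ∈ A, a ^ p ∈ A₂) ∧
      C ≤ A₂.toSubring ∧
      (∀ r : K, r ∈ locAtCentre A₂.toSubring O →
        ∃ (s : Finset S) (c : S → K), (∀ i, c i ∈ locAtCentre C O) ∧ (∀ i ∉ s, c i = 0) ∧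
          r = ∑ i ∈ s, c i * algebraMap k K (b i)) ∧
      ∃ (_ : IsRegularLocalRing (locAtCentre A₂.toSubring O)) (zT : Fin 3 → locAtCentre A₂.toSubring O),
        (∀ i, (zT i : K) = z i) ∧
        Ideal.span (Set.range zT) = IsLocalRing.maximalIdeal (locAtCentre A₂.toSubring O) ∧
        ringKrullDim (locAtCentre A₂.toSubring O) = 3 := by
  classical
  have hp : p.Prime := Fact.out
  haveI : CharP K p := charP_of_injective_algebraMap (algebraMap k K).injective p
  have hk : ∀ c : k, algebraMap k K c ∈ O := fun c => hAO (A.algebraMap_mem c)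
  have htA : ∀ a ∈ (t : Set K), a ∈ A := fun a ha => by rw [← ht]; exact Algebra.subset_adjoin ha
  set B : S → K := fun s => algebraMap k K (b s) with hBdef
  set A₂ : Subalgebra k K := Algebra.adjoin k (G₂ : Set K) with hA₂def
  -- (a) `A₂ ⊆ O`, finitely generated, contains `C` (hence the `p`-th powers of `A`)
  let Oₖ : Subalgebra k K := { O.toSubring with algebraMap_mem' := fun c => hk c }
  have hA₂Ok : A₂ ≤ Oₖ := Algebra.adjoin_le (fun g hg => hG₂O g (Finset.mem_coe.mp hg))
  have hA₂O : A₂.toSubring ≤ O.toSubring := fun x hx => hA₂Ok hx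
  have hA₂fg : A₂.FG := ⟨G₂, rfl⟩
  have hCA₂ : C ≤ A₂.toSubring := by
    rw [hC, Subring.closure_le]
    rintro x (⟨c, rfl⟩ | hx)
    · exact A₂.pow_mem (A₂.algebraMap_mem c) p
    · exact Algebra.subset_adjoin hx
  have hApA₂ : ∀ a ∈ A, a ^ p ∈ A₂ := fun a ha => hCA₂ (hApC a ha)
  have hG₂C : ∀ g ∈ G₂, g ∈ C := fun g hg => by rw [hC]; exact Subring.subset_closure (Or.inr (Finset.mem_coe.mpr hg))
  have hkC : ∀ c : k, algebraMap k K c ^ p ∈ C := fun c => by rw [hC]; exact Subring.subset_closure (Or.inl ⟨c, rfl⟩)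
  -- (e1)+(e2) `A₂ ⊆ Σ_fin C · B_s`: the `C`-span of the family is closed under products and contains `G₂` and the constants
  set V : Submodule C K := Submodule.span C (Set.range B) with hVdef
  have hBV : ∀ s, B s ∈ V := fun s => Submodule.subset_span ⟨s, rfl⟩
  have hkV : ∀ c : k, algebraMap k K c ∈ V := by
    intro c
    obtain ⟨s, d, hd⟩ := hb c
    rw [hd, map_sum]
    refine sum_mem fun u _ => ?_
    rw [map_mul, map_pow]
    have : algebraMap k K (d u) ^ p * B u = (⟨algebraMap k K (d u) ^ p, hkC _⟩ : C) • B u := by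
      rw [Subring.smul_def, smul_eq_mul]
    rw [this]
    exact V.smul_mem _ (hBV u)
  have h1V : (1 : K) ∈ V := by have := hkV 1; rwa [map_one] at this
  have hCV : ∀ x ∈ C, x ∈ V := fun x hx => by
    have : x = (⟨x, hx⟩ : C) • (1 : K) := by rw [Subring.smul_def, smul_eq_mul, mul_one]
    rw [this]; exact V.smul_mem _ h1V
  have hBmulV : ∀ s, ∀ y ∈ V, B s * y ∈ V := by
    intro s y hy
    induction hy using Submodule.span_induction with
    | mem x hx =>
      obtain ⟨u, rfl⟩ := hx
      have : B s * B u = algebraMap k K (b s * b u) := by rw [map_mul]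
      rw [this]; exact hkV _
    | zero => rw [mul_zero]; exact V.zero_mem
    | add x y _ _ hx hy => rw [mul_add]; exact V.add_mem hx hy
    | smul a x _ hx => rw [mul_smul_comm]; exact V.smul_mem a hx
  have hmulV : ∀ x ∈ V, ∀ y ∈ V, x * y ∈ V := by
    intro x hx y hy
    induction hx using Submodule.span_induction with
    | mem x hx' => obtain ⟨s, rfl⟩ := hx'; exact hBmulV s y hy
    | zero => rw [zero_mul]; exact V.zero_mem
    | add x₁ x₂ _ _ h₁ h₂ => rw [add_mul]; exact V.add_mem h₁ h₂
    | smul a x _ hx => rw [smul_mul_assoc]; exact V.smul_mem a hx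
  have hA₂V : ∀ x ∈ A₂, x ∈ V := by
    intro x hx
    rw [hA₂def] at hx
    induction hx using Algebra.adjoin_induction with
    | mem x hx => exact hCV x (hG₂C x (Finset.mem_coe.mp hx))
    | algebraMap c => exact hkV c
    | add x y _ _ hx hy => exact V.add_mem hx hy
    | mul x y _ _ hx hy => exact hmulV x hx y hy
  have hrepr : ∀ x ∈ A₂, ∃ (s : Finset S) (c : S → K), (∀ i, c i ∈ C) ∧ (∀ i ∉ s, c i = 0) ∧
      x = ∑ i ∈ s, c i * B i := by
    intro x hx
    obtain ⟨c, hc⟩ := (Finsupp.mem_span_range_iff_exists_finsupp).mp (hA₂V x hx)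
    refine ⟨c.support, fun i => (c i : K), fun i => (c i).2, fun i hi => ?_, ?_⟩
    · show ((c i : C) : K) = 0
      rw [Finsupp.notMem_support_iff.mp hi]; rfl
    · rw [← hc, Finsupp.sum]
      exact Finset.sum_congr rfl fun i _ => Subring.smul_def _ _
  -- (e3) `T⁺ = Σ_fin B_s · locAtCentre C O` (denominators have `p`-th powers in `C`)
  have hfrobC : ∀ x ∈ A₂, x ^ p ∈ C := by
    intro x hx
    obtain ⟨s, c, hcC, -, rfl⟩ := hrepr x hx
    rw [sum_pow_char]
    exact sum_mem fun i _ => by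
      rw [mul_pow]
      exact mul_mem (C.pow_mem (hcC i) p) (hkC (b i))
  have hTspan : ∀ r : K, r ∈ locAtCentre A₂.toSubring O →
      ∃ (s : Finset S) (c : S → K), (∀ i, c i ∈ locAtCentre C O) ∧ (∀ i ∉ s, c i = 0) ∧
        r = ∑ i ∈ s, c i * B i := by
    intro r hr
    obtain ⟨y, hy, w, hw, hwv, rfl⟩ := mem_locAtCentre_iff.mp hr
    have hw0 : w ≠ 0 := ne_zero_of_valuation_eq_one hwv
    have hywA₂ : y * w ^ (p - 1) ∈ A₂ := mul_mem hy (pow_mem hw _)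
    obtain ⟨s, e, heC, he0, he⟩ := hrepr _ hywA₂
    have hwpC : w ^ p ∈ C := hfrobC w hw
    have hwpv : O.valuation (w ^ p) = 1 := by rw [map_pow, hwv, one_pow]
    refine ⟨s, fun i => e i / w ^ p, fun i => mem_locAtCentre_iff.mpr ⟨e i, heC i, w ^ p, hwpC, hwpv, rfl⟩,
      fun i hi => by show e i / w ^ p = 0; rw [he0 i hi, zero_div], ?_⟩
    have hp1 : w ^ p = w ^ (p - 1) * w := by rw [← pow_succ, Nat.sub_add_cancel hp.one_le]
    have key : y / w = (y * w ^ (p - 1)) / w ^ p := by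
      rw [hp1]
      field_simp
    rw [key, he, Finset.sum_div]
    exact Finset.sum_congr rfl fun i _ => by rw [mul_div_right_comm]
  -- (f) `T⁺`: local, Noetherian, `dim = 3`, `𝔪 = (z)`, regular
  haveI hTloc : IsLocalRing (locAtCentre A₂.toSubring O) := isLocalRing_locAtCentre hA₂O
  haveI : IsLocalization.AtPrime (locAtCentre A₂.toSubring O) (subringCentre A₂.toSubring O hA₂O) :=
    isLocalization_locAtCentre hA₂O
  letI : Algebra k A₂.toSubring := inferInstanceAs (Algebra k A₂)
  haveI : Algebra.FiniteType k A₂.toSubring := (A₂.fg_iff_finiteType.mp hA₂fg : Algebra.FiniteType k A₂)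
  haveI hTnoeth : IsNoetherianRing (locAtCentre A₂.toSubring O) :=
    IsLocalization.isNoetherianRing (subringCentre A₂.toSubring O hA₂O).primeCompl (locAtCentre A₂.toSubring O)
      (Algebra.FiniteType.isNoetherianRing k A₂.toSubring)
  have hdimAeq : ringKrullDim A = 3 := ringKrullDim_eq_three_of_locAtCentre O A hAO hdimA hdim3
  obtain ⟨-, -, hdimT⟩ := centre_closed_and_dim_three_of_pow_mem hp.pos O A hAO hAfg hdimAeq t ht hzd A₂ hA₂O hA₂fg
    (fun a ha => hApA₂ a (htA a ha))
  have hTT : locAtCentre C O ≤ locAtCentre A₂.toSubring O := locAtCentre_mono O hCA₂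
  set zT : Fin 3 → locAtCentre A₂.toSubring O := fun i => ⟨z i, hTT (hzC i)⟩ with hzTdef
  have hBA₂ : ∀ s, B s ∈ A₂ := fun s => A₂.algebraMap_mem (b s)
  have hBT : ∀ s, B s ∈ locAtCentre A₂.toSubring O := fun s => le_locAtCentre _ O (hBA₂ s)
  have hspan : Ideal.span (Set.range zT) = maximalIdeal (locAtCentre A₂.toSubring O) := by
    apply le_antisymm
    · rw [Ideal.span_le]
      rintro _ ⟨i, rfl⟩
      exact (mem_maximalIdeal_locAtCentre_iff hA₂O _).mpr (hzv i)
    · intro r hr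
      have hvr : O.valuation (r : K) < 1 := (mem_maximalIdeal_locAtCentre_iff hA₂O r).mp hr
      obtain ⟨s, c, hcT, -, hcr⟩ := hTspan _ r.2
      have hcM : ∀ i, c i ∈ M := fun i => hCM _ (hcT i)
      have hcr' : (r : K) = ∑ i : ↥s, c i * B i := by rw [hcr, ← Finset.sum_coe_sort]
      have hsup : Finset.univ.sup (fun i : ↥s => O.valuation (c i)) < 1 := by
        rw [← hRG s (fun i => c i) (fun i => hcM i), ← hcr']; exact hvr
      have hci : ∀ i : ↥s, O.valuation (c i) < 1 := fun i =>
        lt_of_le_of_lt (Finset.le_sup (f := fun i : ↥s => O.valuation (c i)) (Finset.mem_univ i)) hsup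
      choose bb hbbT hbb using fun i : ↥s => hzspan (c i) (hcT i) (hci i)
      have hrsum : r = ∑ i : ↥s, ∑ j : Fin 3,
          ((⟨bb i j, hTT (hbbT i j)⟩ : locAtCentre A₂.toSubring O) * ⟨B i, hBT i⟩) * zT j := by
        apply Subtype.ext
        push_cast
        rw [hcr']
        refine Finset.sum_congr rfl fun i _ => ?_
        rw [hbb i, Finset.sum_mul]
        refine Finset.sum_congr rfl fun j _ => ?_
        simp only [hzTdef]
        ring
      rw [hrsum]
      exact Ideal.sum_mem _ fun i _ => Ideal.sum_mem _ fun j _ => Ideal.mul_mem_left _ _ (Ideal.subset_span ⟨j, rfl⟩)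
  have hdimT3 : ringKrullDim (locAtCentre A₂.toSubring O) = ((3 : ℕ) : WithBot ℕ∞) := by rw [hdimT]; norm_cast
  have hreg : IsRegularLocalRing (locAtCentre A₂.toSubring O) := by
    refine IsRegularLocalRing.of_spanFinrank_maximalIdeal_le _ ?_
    rw [hdimT3, ← hspan]
    have hgen : (Ideal.span (Set.range zT)).spanFinrank ≤ 3 := by
      refine (Submodule.spanFinrank_span_le_ncard_of_finite (Set.finite_range _)).trans ?_
      rw [← Set.image_univ]
      refine (Set.ncard_image_le Set.finite_univ).trans ?_
      rw [Set.ncard_univ, Nat.card_eq_fintype_card, Fintype.card_fin]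
    exact_mod_cast hgen
  exact ⟨A₂, hA₂O, hA₂fg, hApA₂, hCA₂, hTspan, hreg, zT, fun i => rfl, hspan, hdimT⟩


/-! ## §G∞ PORT 4′_∞ — the regular chart algebra and a regular parameter in `M` by graded descent on a FINITE SUPPORT (new tail) -/

/-- **PORT 4′_∞ (regular parameter in the twist field, base of ARBITRARY `p`-rank).**  Port 4′ with the graded structure
`T⁺ = Σ_fin B_s T₀` on FINITELY SUPPORTED sums (`hTspan`, `T₀ ⊆ M`) and RG on finite subfamilies; same conclusion.  Proof = Port 4b
(a)–(e) verbatim, then the tail (f)″ run on the COMMON finite support `S₀ := ⋃_{e ∈ supp q} supp(λ_e)` of the coefficients of the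
regular parameter `ψ = Σ_e λ_e u^e`: `ψ = Σ_{s ∈ S₀} B_s ψ_s`, `ψ_s ∈ T₀[u_{≥ρ}] ⊆ S ∩ M`, `v(ψ) = max v(ψ_s) < 1` puts every `ψ_s` in
`𝔪_S`, and `ψ ∉ 𝔪_S²` forces some `ψ_s ∉ 𝔪_S²`.  PROVED. [folklore] -/
theorem port_regularParameterInf (p : ℕ) [Fact p.Prime] {k : Type} [Field k] [CharP k p]
    {K : Type} [Field K] [Algebra k K] (O : ValuationSubring K) (A : Subalgebra k K)
    (hAO : A.toSubring ≤ O.toSubring) (hAfg : A.FG) [IsFractionRing A K] (hdimA : ringKrullDim A ≤ 3)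
    (hdim3 : ringKrullDim (locAtCentre A.toSubring O) = 3)
    (hzd : ∀ (T : Subring K) (hT : T ≤ O.toSubring), A.toSubring ≤ T → (subringCentre T O hT).IsMaximal)
    (M : Subfield K) (A₂ : Subalgebra k K) (hA₂O : A₂.toSubring ≤ O.toSubring) (hA₂fg : A₂.FG)
    (_hApA₂ : ∀ a ∈ A, a ^ p ∈ A₂)
    {S : Type} (b : S → k) (T₀ : Subring K) (hT₀M : ∀ r : K, r ∈ T₀ → r ∈ M)
    (hT₀S : T₀ ≤ locAtCentre A₂.toSubring O)
    (hTspan : ∀ r : K, r ∈ locAtCentre A₂.toSubring O →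
      ∃ (s : Finset S) (c : S → K), (∀ i, c i ∈ T₀) ∧ (∀ i ∉ s, c i = 0) ∧
        r = ∑ i ∈ s, c i * algebraMap k K (b i))
    (hRG : ∀ (s : Finset S) (c : ↥s → K), (∀ i, c i ∈ M) →
      O.valuation (∑ i : ↥s, c i * algebraMap k K (b i)) = Finset.univ.sup (fun i => O.valuation (c i)))
    (hreg₂ : IsRegularLocalRing (locAtCentre A₂.toSubring O)) (z : Fin 3 → locAtCentre A₂.toSubring O)
    (hz : Ideal.span (Set.range z) = IsLocalRing.maximalIdeal (locAtCentre A₂.toSubring O))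
    (_hdimT : ringKrullDim (locAtCentre A₂.toSubring O) = 3)
    (t : Finset K) (ht : Algebra.adjoin k (t : Set K) = A)
    (ρ : ℕ) (hρ : ρ = 1 ∨ ρ = 2) (u : Fin 3 → K) (hu0 : ∀ j, u j ≠ 0)
    (hupos : ∀ j : Fin 3, (j : ℕ) < ρ → O.valuation (u j) < 1)
    (huzero : ∀ j : Fin 3, ρ ≤ (j : ℕ) → O.valuation (u j) = 1)
    (huM : ∀ j : Fin 3, ρ ≤ (j : ℕ) → u j ∈ M)
    (hzu : ∀ i : Fin 3, ∃ (ε : K) (d : Fin 3 → ℤ), ε ∈ locAtCentre A₂.toSubring O ∧ O.valuation ε = 1 ∧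
      (∀ j : Fin 3, (j : ℕ) < ρ → 0 ≤ d j) ∧ (∃ j : Fin 3, (j : ℕ) < ρ ∧ 0 < d j) ∧ ((z i : K)) = ε * ∏ j, u j ^ d j)
    {ι : Type} [Fintype ι]
    (htu : ∀ a ∈ t, ∃ (ν : ι → K) (d : ι → Fin 3 → ℤ),
      (∀ l, ν l = 0 ∨ (ν l ∈ locAtCentre A₂.toSubring O ∧ O.valuation (ν l) = 1)) ∧
      (∀ l, ∀ j : Fin 3, (j : ℕ) < ρ → 0 ≤ d l j) ∧ a = ∑ l, ν l * ∏ j, u j ^ d l j) :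
    ∃ (A'' : Subalgebra k K), A''.toSubring ≤ O.toSubring ∧ A ≤ A'' ∧ A''.FG ∧
      ∃ (_ : IsRegularLocalRing (locAtCentre A''.toSubring O)) (ψ : locAtCentre A''.toSubring O),
        ψ ∈ IsLocalRing.maximalIdeal (locAtCentre A''.toSubring O) ∧
        ψ ∉ (IsLocalRing.maximalIdeal (locAtCentre A''.toSubring O)) ^ 2 ∧ (ψ : K) ∈ M := by
  classical
  /- (rev 4, res-B-lens-5 g10) PORT 4 PROVED — memo §13 (a)–(f) with ONE simplification: the maximality of `𝔫` (§13 (c1), Zariski) is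
  not needed; `P := κ_T[U]_𝔫` at the PRIME `𝔫 = F⁻¹(𝔪)` is a regular local domain whose dimension is pinned to `3 - ρ` by the surjection
  `P ↠ S⧸𝔞` and Krull (`localization_mvPolynomial_regular_of_surjective`). -/
  have hρ3 : ρ ≤ 3 := by rcases hρ with rfl | rfl <;> norm_num
  obtain ⟨gens₂, hgens₂⟩ := hA₂fg
  have hk : ∀ c : k, algebraMap k K c ∈ A₂ := fun c => A₂.algebraMap_mem c
  have hgensA₂ : ∀ g ∈ gens₂, g ∈ A₂ := fun g hg => by
    rw [← hgens₂]; exact Algebra.subset_adjoin (Finset.mem_coe.mpr hg)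
  have htA : ∀ a ∈ t, a ∈ A := fun a ha => by
    rw [← ht]; exact Algebra.subset_adjoin (Finset.mem_coe.mpr ha)
  have huO : ∀ j, u j ∈ O := fun j => (O.valuation_le_one_iff _).mp (by
    by_cases hj : (j : ℕ) < ρ
    · exact (hupos j hj).le
    · exact (huzero j (not_lt.mp hj)).le)
  have huinvO : ∀ j : Fin 3, ρ ≤ (j : ℕ) → (u j)⁻¹ ∈ O := fun j hj =>
    (O.valuation_le_one_iff _).mp (by rw [map_inv₀, huzero j hj, inv_one])
  -- §13 (a): the chart algebra `A'' = k[gens A₂, u, u_{≥ρ}⁻¹, t]` and its local ring `S = locAtCentre A'' O`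
  set Z : Finset (Fin 3) := Finset.univ.filter (fun j => ρ ≤ (j : ℕ)) with hZdef
  have hZ : ∀ j : Fin 3, j ∈ Z ↔ ρ ≤ (j : ℕ) := fun j => by simp [hZdef]
  set G : Finset K := gens₂ ∪ Finset.univ.image u ∪ Z.image (fun j => (u j)⁻¹) ∪ t with hGdef
  have hGgens : ∀ g ∈ gens₂, g ∈ G := fun g hg => by
    rw [hGdef]; exact Finset.mem_union_left _ (Finset.mem_union_left _ (Finset.mem_union_left _ hg))
  have hGu : ∀ j, u j ∈ G := fun j => by
    rw [hGdef]
    exact Finset.mem_union_left _ (Finset.mem_union_left _ (Finset.mem_union_right _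
      (Finset.mem_image.mpr ⟨j, Finset.mem_univ _, rfl⟩)))
  have hGuinv : ∀ j : Fin 3, ρ ≤ (j : ℕ) → (u j)⁻¹ ∈ G := fun j hj => by
    rw [hGdef]
    exact Finset.mem_union_left _ (Finset.mem_union_right _ (Finset.mem_image.mpr ⟨j, (hZ j).mpr hj, rfl⟩))
  have hGt : ∀ a ∈ t, a ∈ G := fun a ha => by rw [hGdef]; exact Finset.mem_union_right _ ha
  have hGcases : ∀ x ∈ G, x ∈ gens₂ ∨ (∃ j, x = u j) ∨ (∃ j : Fin 3, ρ ≤ (j : ℕ) ∧ x = (u j)⁻¹) ∨ x ∈ t := by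
    intro x hx
    rw [hGdef] at hx
    rcases Finset.mem_union.mp hx with hx | hx
    · rcases Finset.mem_union.mp hx with hx | hx
      · rcases Finset.mem_union.mp hx with hx | hx
        · exact Or.inl hx
        · obtain ⟨j, -, rfl⟩ := Finset.mem_image.mp hx
          exact Or.inr (Or.inl ⟨j, rfl⟩)
      · obtain ⟨j, hj, rfl⟩ := Finset.mem_image.mp hx
        exact Or.inr (Or.inr (Or.inl ⟨j, (hZ j).mp hj, rfl⟩))
    · exact Or.inr (Or.inr (Or.inr hx))
  set A'' : Subalgebra k K := Algebra.adjoin k (G : Set K) with hA''def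
  have hGA'' : ∀ x ∈ G, x ∈ A'' := fun x hx => Algebra.subset_adjoin (Finset.mem_coe.mpr hx)
  let Oₖ : Subalgebra k K :=
    { O.toSubring with algebraMap_mem' := fun c => hA₂O (A₂.algebraMap_mem c) }
  have hGO : (G : Set K) ⊆ (Oₖ : Set K) := by
    intro x hx
    change x ∈ O
    rcases hGcases x (Finset.mem_coe.mp hx) with hx | ⟨j, rfl⟩ | ⟨j, hj, rfl⟩ | hx
    · exact hA₂O (hgensA₂ x hx)
    · exact huO j
    · exact huinvO j hj
    · exact hAO (htA x hx)
  have hA''O : A''.toSubring ≤ O.toSubring := fun x hx => (Algebra.adjoin_le hGO : A'' ≤ Oₖ) hx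
  have hAA'' : A ≤ A'' := by
    rw [← ht]; exact Algebra.adjoin_le fun x hx => hGA'' x (hGt x (Finset.mem_coe.mp hx))
  have hA₂A'' : A₂ ≤ A'' := by
    rw [← hgens₂]; exact Algebra.adjoin_le fun x hx => hGA'' x (hGgens x (Finset.mem_coe.mp hx))
  have hA''fg : A''.FG := ⟨G, hA''def.symm⟩
  have huA'' : ∀ j, u j ∈ A'' := fun j => hGA'' _ (hGu j)
  have huS : ∀ j, u j ∈ locAtCentre A''.toSubring O := fun j => le_locAtCentre _ O (huA'' j)
  have hTS : locAtCentre A₂.toSubring O ≤ locAtCentre A''.toSubring O := locAtCentre_mono O (fun x hx => hA₂A'' hx)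
  haveI hSloc : IsLocalRing (locAtCentre A''.toSubring O) := isLocalRing_locAtCentre hA''O
  haveI : IsLocalization.AtPrime (locAtCentre A''.toSubring O) (subringCentre A''.toSubring O hA''O) :=
    isLocalization_locAtCentre hA''O
  letI : Algebra k A''.toSubring := inferInstanceAs (Algebra k A'')
  haveI : Algebra.FiniteType k A''.toSubring := (A''.fg_iff_finiteType.mp hA''fg : Algebra.FiniteType k A'')
  haveI hSnoeth : IsNoetherianRing (locAtCentre A''.toSubring O) :=
    IsLocalization.isNoetherianRing (subringCentre A''.toSubring O hA''O).primeCompl (locAtCentre A''.toSubring O)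
      (Algebra.FiniteType.isNoetherianRing k A''.toSubring)
  -- `dim S = 3`: the centre is closed (hzd) and `dim A'' = dim A = 3`
  have hdimAeq : ringKrullDim A = 3 := ringKrullDim_eq_three_of_locAtCentre O A hAO hdimA hdim3
  have hdimA'' : ringKrullDim A'' = 3 := by
    rw [Summit.ResolutionOfSingularities.ResolutionOfSingularities.Theorems.RadicialJung.CleanModels.ringKrullDim_eq_of_fg_of_le
      hAfg hA''fg hAA'', hdimAeq]
  have hmaxS : (subringCentre A''.toSubring O hA''O).IsMaximal := hzd A''.toSubring hA''O (fun x hx => hAA'' hx)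
  have hdimS : ringKrullDim (locAtCentre A''.toSubring O) = 3 := by
    rw [Summit.ResolutionOfSingularities.ResolutionOfSingularities.Theorems.RadicialJung.CleanModels.ringKrullDim_locAtCentre_eq_of_isMaximal
      A'' hA''fg O hA''O hmaxS, hdimA'']
  have hdimS3 : ringKrullDim (locAtCentre A''.toSubring O) = ((3 : ℕ) : WithBot ℕ∞) := by rw [hdimS]; norm_cast
  -- §13 (b): `𝔞 := (u_{<ρ})` contains `𝔪_T · S`
  set uS : Fin 3 → locAtCentre A''.toSubring O := fun j => ⟨u j, huS j⟩ with huSdef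
  set uρ : Fin ρ → locAtCentre A''.toSubring O := fun i => uS (Fin.castLE hρ3 i) with huρdef
  have huρ : ∀ i, uρ i ∈ maximalIdeal (locAtCentre A''.toSubring O) := fun i =>
    (mem_maximalIdeal_locAtCentre_iff hA''O _).mpr (hupos (Fin.castLE hρ3 i) (by simp))
  have huS𝔞 : ∀ j : Fin 3, (j : ℕ) < ρ → uS j ∈ Ideal.span (Set.range uρ) := fun j hj =>
    Ideal.subset_span ⟨⟨j, hj⟩, congrArg uS (Fin.ext rfl)⟩
  set ι : locAtCentre A₂.toSubring O →+* locAtCentre A''.toSubring O := Subring.inclusion hTS with hιdef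
  have hιval : ∀ a, ((ι a : locAtCentre A''.toSubring O) : K) = a := fun a => rfl
  have hzS : ∀ i : Fin 3, ι (z i) ∈ Ideal.span (Set.range uρ) := by
    intro i
    obtain ⟨ε, d, hεT, hεv, hdnn, ⟨j₀, hj₀, hdj₀⟩, hzi⟩ := hzu i
    set d' : Fin 3 → ℤ := Function.update d j₀ (d j₀ - 1) with hd'def
    have hd'j₀ : d' j₀ = d j₀ - 1 := by rw [hd'def, Function.update_self]
    have hd'ne : ∀ j, j ≠ j₀ → d' j = d j := fun j hj => by rw [hd'def, Function.update_of_ne hj]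
    have hd'nn : ∀ j : Fin 3, (j : ℕ) < ρ → 0 ≤ d' j := by
      intro j hj
      by_cases hjj : j = j₀
      · rw [hjj, hd'j₀]; omega
      · rw [hd'ne j hjj]; exact hdnn j hj
    have hw'mem : ε * ∏ j, u j ^ d' j ∈ locAtCentre A''.toSubring O := by
      refine mul_mem (hTS hεT) (prod_mem fun j _ => ?_)
      by_cases hj : (j : ℕ) < ρ
      · exact zpow_mem_of_nonneg (huS j) (hd'nn j hj)
      · exact zpow_mem_of_inv_mem (huS j) (inv_mem_locAtCentre (huS j) (huzero j (not_lt.mp hj))) (d' j)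
    have he : ∏ j ∈ Finset.univ.erase j₀, u j ^ d' j = ∏ j ∈ Finset.univ.erase j₀, u j ^ d j :=
      Finset.prod_congr rfl fun j hj => by rw [hd'ne j (Finset.ne_of_mem_erase hj)]
    have hsplit : ε * ∏ j, u j ^ d j = (ε * ∏ j, u j ^ d' j) * u j₀ := by
      rw [← Finset.mul_prod_erase Finset.univ (fun j => u j ^ d j) (Finset.mem_univ j₀),
        ← Finset.mul_prod_erase Finset.univ (fun j => u j ^ d' j) (Finset.mem_univ j₀)]
      show ε * (u j₀ ^ d j₀ * ∏ j ∈ Finset.univ.erase j₀, u j ^ d j) =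
        ε * (u j₀ ^ d' j₀ * ∏ j ∈ Finset.univ.erase j₀, u j ^ d' j) * u j₀
      rw [he, hd'j₀, zpow_sub_one₀ (hu0 j₀)]
      have h0 : (u j₀)⁻¹ * u j₀ = 1 := inv_mul_cancel₀ (hu0 j₀)
      calc ε * (u j₀ ^ d j₀ * ∏ j ∈ Finset.univ.erase j₀, u j ^ d j)
          = ε * (u j₀ ^ d j₀ * ((u j₀)⁻¹ * u j₀) * ∏ j ∈ Finset.univ.erase j₀, u j ^ d j) := by rw [h0, mul_one]
        _ = ε * (u j₀ ^ d j₀ * (u j₀)⁻¹ * ∏ j ∈ Finset.univ.erase j₀, u j ^ d j) * u j₀ := by ring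
    have hιz : ι (z i) = ⟨ε * ∏ j, u j ^ d' j, hw'mem⟩ * uS j₀ := by
      apply Subtype.ext
      show ((z i : K)) = (ε * ∏ j, u j ^ d' j) * u j₀
      rw [hzi, hsplit]
    rw [hιz]
    exact Ideal.mul_mem_left _ _ (huS𝔞 j₀ hj₀)
  -- §13 (c): `E := S ⧸ 𝔞` is local; `F₁ : κ_T → E` (`𝔪_T ↦ 0`), `F : κ_T[U_{≥ρ}] → E`, `𝔫 := F⁻¹ 𝔪_E`, `P := κ_T[U]_𝔫`
  have h𝔞m : Ideal.span (Set.range uρ) ≤ maximalIdeal (locAtCentre A''.toSubring O) := by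
    rw [Ideal.span_le]; rintro _ ⟨i, rfl⟩; exact huρ i
  have h𝔞top : Ideal.span (Set.range uρ) ≠ ⊤ := fun h =>
    (maximalIdeal.isMaximal (locAtCentre A''.toSubring O)).ne_top (top_le_iff.mp (h ▸ h𝔞m))
  haveI : Nontrivial (locAtCentre A''.toSubring O ⧸ Ideal.span (Set.range uρ)) :=
    Ideal.Quotient.nontrivial_iff.mpr h𝔞top
  haveI : IsLocalRing (locAtCentre A''.toSubring O ⧸ Ideal.span (Set.range uρ)) :=
    IsLocalRing.of_surjective' (Ideal.Quotient.mk _) Ideal.Quotient.mk_surjective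
  have hkill : ∀ a ∈ maximalIdeal (locAtCentre A₂.toSubring O),
      ((Ideal.Quotient.mk (Ideal.span (Set.range uρ))).comp ι) a = 0 := by
    have hmap : (maximalIdeal (locAtCentre A₂.toSubring O)).map ι ≤ Ideal.span (Set.range uρ) := by
      rw [← hz, Ideal.map_span, Ideal.span_le]
      rintro _ ⟨_, ⟨i, rfl⟩, rfl⟩
      exact hzS i
    intro a ha
    rw [RingHom.comp_apply, Ideal.Quotient.eq_zero_iff_mem]
    exact hmap (Ideal.mem_map_of_mem ι ha)
  set F₁ : ResidueField (locAtCentre A₂.toSubring O) →+* (locAtCentre A''.toSubring O ⧸ Ideal.span (Set.range uρ)) :=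
    Ideal.Quotient.lift (maximalIdeal (locAtCentre A₂.toSubring O))
      ((Ideal.Quotient.mk (Ideal.span (Set.range uρ))).comp ι) hkill with hF₁def
  have hF₁ : ∀ a, F₁ (residue _ a) = Ideal.Quotient.mk _ (ι a) := fun a => by
    rw [hF₁def]; exact Ideal.Quotient.lift_mk _ _ _
  set zI : Fin (3 - ρ) → Fin 3 := fun i => ⟨ρ + (i : ℕ), by have := i.2; omega⟩ with hzIdef
  have hzIval : ∀ i, ((zI i : Fin 3) : ℕ) = ρ + (i : ℕ) := fun i => rfl
  have hzIρ : ∀ i, ρ ≤ ((zI i : Fin 3) : ℕ) := fun i => by rw [hzIval]; omega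
  set F : MvPolynomial (Fin (3 - ρ)) (ResidueField (locAtCentre A₂.toSubring O)) →+*
      (locAtCentre A''.toSubring O ⧸ Ideal.span (Set.range uρ)) :=
    MvPolynomial.eval₂Hom F₁ (fun i => Ideal.Quotient.mk (Ideal.span (Set.range uρ)) (uS (zI i))) with hFdef
  have hFC : ∀ r, F (MvPolynomial.C r) = F₁ r := fun r => by rw [hFdef]; exact MvPolynomial.eval₂Hom_C _ _ r
  have hFX : ∀ i, F (MvPolynomial.X i) = Ideal.Quotient.mk (Ideal.span (Set.range uρ)) (uS (zI i)) := fun i => by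
    rw [hFdef]; exact MvPolynomial.eval₂Hom_X' _ _ i
  set 𝔫 : Ideal (MvPolynomial (Fin (3 - ρ)) (ResidueField (locAtCentre A₂.toSubring O))) :=
    (maximalIdeal (locAtCentre A''.toSubring O ⧸ Ideal.span (Set.range uρ))).comap F with h𝔫def
  haveI h𝔫prime : 𝔫.IsPrime := Ideal.IsPrime.comap F
  obtain ⟨hunit, h𝔫u⟩ := primeCompl_comap_maximalIdeal F
  -- the normal form on `A''`: `R₀ := T[u] ⊆ S`, `w := ∏_{j ≥ ρ} u_j`, every `x ∈ A''` has `x · w^N ∈ R₀`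
  set R₀ : Subring K := Subring.closure ((locAtCentre A₂.toSubring O : Set K) ∪ Set.range u) with hR₀def
  have hTR₀ : ∀ x ∈ locAtCentre A₂.toSubring O, x ∈ R₀ := fun x hx => by
    rw [hR₀def]; exact Subring.subset_closure (Or.inl hx)
  have huR₀ : ∀ j, u j ∈ R₀ := fun j => by rw [hR₀def]; exact Subring.subset_closure (Or.inr ⟨j, rfl⟩)
  have hR₀S : R₀ ≤ locAtCentre A''.toSubring O := by
    rw [hR₀def, Subring.closure_le]
    rintro x (hx | ⟨j, rfl⟩)
    · exact hTS hx
    · exact huS j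
  set w : K := ∏ j ∈ Z, u j with hwdef
  have hwv : O.valuation w = 1 := by
    rw [hwdef, map_prod]; exact Finset.prod_eq_one fun j hj => huzero j ((hZ j).mp hj)
  have hwR₀ : w ∈ R₀ := by rw [hwdef]; exact prod_mem fun j _ => huR₀ j
  have huinv : ∀ j ∈ Z, NF R₀ w (u j)⁻¹ := by
    intro j hj
    refine ⟨1, ?_⟩
    rw [pow_one, hwdef, ← Finset.mul_prod_erase Z u hj, inv_mul_cancel_left₀ (hu0 j)]
    exact prod_mem fun i _ => huR₀ i
  have hNF : ∀ x ∈ A'', NF R₀ w x := by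
    intro x hx
    rw [hA''def] at hx
    induction hx using Algebra.adjoin_induction with
    | mem x hx =>
      rcases hGcases x (Finset.mem_coe.mp hx) with hx | ⟨j, rfl⟩ | ⟨j, hj, rfl⟩ | hx
      · exact NF.of_mem (hTR₀ x (le_locAtCentre _ O (hgensA₂ x hx)))
      · exact NF.of_mem (huR₀ j)
      · exact huinv j ((hZ j).mpr hj)
      · obtain ⟨ν, d, hν, hd, rfl⟩ := htu x hx
        refine NF.sum _ _ hwR₀ fun l _ => NF.mul ?_ (NF.prod _ _ fun j _ => ?_)
        · rcases hν l with h0 | ⟨hνT, -⟩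
          · rw [h0]; exact NF.zero
          · exact NF.of_mem (hTR₀ _ hνT)
        · by_cases hj : (j : ℕ) < ρ
          · exact (NF.of_mem (huR₀ j)).zpow_of_nonneg (hd l j hj)
          · exact (NF.of_mem (huR₀ j)).zpow (huinv j ((hZ j).mpr (not_lt.mp hj))) (d l j)
    | algebraMap c => exact NF.of_mem (hTR₀ _ (le_locAtCentre _ O (hk c)))
    | add x y hx hy ihx ihy => exact ihx.add hwR₀ ihy
    | mul x y hx hy ihx ihy => exact ihx.mul ihy
  -- (c2) normal form of the fractions `s = y / x ∈ S` and the preimages under `F`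
  have hloc : ∀ s : locAtCentre A''.toSubring O, ∃ b c : locAtCentre A''.toSubring O,
      b ∈ {s : locAtCentre A''.toSubring O | (s : K) ∈ R₀} ∧ c ∈ {s : locAtCentre A''.toSubring O | (s : K) ∈ R₀} ∧
      IsUnit (Ideal.Quotient.mk (Ideal.span (Set.range uρ)) c) ∧ s * c - b ∈ Ideal.span (Set.range uρ) := by
    intro s
    obtain ⟨y, hy, x, hx, hxv, hs⟩ := (mem_locAtCentre_iff).mp s.2
    obtain ⟨N₁, hN₁⟩ := hNF y hy
    obtain ⟨N₂, hN₂⟩ := hNF x hx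
    have hb : y * w ^ N₁ * w ^ N₂ ∈ R₀ := R₀.mul_mem hN₁ (R₀.pow_mem hwR₀ N₂)
    have hc : x * w ^ N₂ * w ^ N₁ ∈ R₀ := R₀.mul_mem hN₂ (R₀.pow_mem hwR₀ N₁)
    refine ⟨⟨_, hR₀S hb⟩, ⟨_, hR₀S hc⟩, hb, hc, ?_, ?_⟩
    · refine IsUnit.map _ (notMem_maximalIdeal.mp fun hm => ?_)
      have hlt : O.valuation (x * w ^ N₂ * w ^ N₁) < 1 := (mem_maximalIdeal_locAtCentre_iff hA''O _).mp hm
      rw [map_mul, map_mul, map_pow, map_pow, hxv, hwv, one_pow, one_pow, mul_one, mul_one] at hlt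
      exact lt_irrefl _ hlt
    · have h0 : x ≠ 0 := ne_zero_of_valuation_eq_one hxv
      have hzero : s * ⟨_, hR₀S hc⟩ - ⟨_, hR₀S hb⟩ = (0 : locAtCentre A''.toSubring O) := by
        apply Subtype.ext
        show (s : K) * (x * w ^ N₂ * w ^ N₁) - y * w ^ N₁ * w ^ N₂ = 0
        rw [hs, sub_eq_zero]
        calc y / x * (x * w ^ N₂ * w ^ N₁) = (y / x * x) * (w ^ N₂ * w ^ N₁) := by ring
          _ = y * w ^ N₁ * w ^ N₂ := by rw [div_mul_cancel₀ y h0]; ring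
      rw [hzero]; exact Ideal.zero_mem _
  have hF : ∀ b ∈ {s : locAtCentre A''.toSubring O | (s : K) ∈ R₀},
      Ideal.Quotient.mk (Ideal.span (Set.range uρ)) b ∈ F.range := by
    have key : ∀ x ∈ R₀, ∃ hx : x ∈ locAtCentre A''.toSubring O,
        Ideal.Quotient.mk (Ideal.span (Set.range uρ)) ⟨x, hx⟩ ∈ F.range := by
      intro x hx
      rw [hR₀def] at hx
      induction hx using Subring.closure_induction with
      | mem x hx =>
        rcases hx with hx | ⟨j, rfl⟩
        · refine ⟨hTS hx, RingHom.mem_range.mpr ⟨MvPolynomial.C (residue _ ⟨x, hx⟩), ?_⟩⟩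
          rw [hFC, hF₁]
          rfl
        · by_cases hj : (j : ℕ) < ρ
          · refine ⟨huS j, RingHom.mem_range.mpr ⟨0, ?_⟩⟩
            rw [map_zero]
            exact (Ideal.Quotient.eq_zero_iff_mem.mpr (huS𝔞 j hj)).symm
          · have hj3 : (j : ℕ) - ρ < 3 - ρ := by have := j.2; omega
            refine ⟨huS j, RingHom.mem_range.mpr ⟨MvPolynomial.X ⟨(j : ℕ) - ρ, hj3⟩, ?_⟩⟩
            rw [hFX]
            have hjj : zI ⟨(j : ℕ) - ρ, hj3⟩ = j := Fin.ext (by rw [hzIval]; simp only; omega)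
            rw [hjj]
      | zero => exact ⟨Subring.zero_mem _, RingHom.mem_range.mpr ⟨0, by rw [map_zero]; exact (map_zero _).symm⟩⟩
      | one => exact ⟨Subring.one_mem _, RingHom.mem_range.mpr ⟨1, by rw [map_one]; exact (map_one _).symm⟩⟩
      | add x y hx hy ihx ihy =>
        obtain ⟨hxS, hx'⟩ := ihx
        obtain ⟨hyS, hy'⟩ := ihy
        obtain ⟨qx, hqx⟩ := RingHom.mem_range.mp hx'
        obtain ⟨qy, hqy⟩ := RingHom.mem_range.mp hy'
        exact ⟨add_mem hxS hyS, RingHom.mem_range.mpr ⟨qx + qy, by rw [map_add, hqx, hqy, ← map_add]; rfl⟩⟩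
      | neg x hx ih =>
        obtain ⟨hxS, hx'⟩ := ih
        obtain ⟨qx, hqx⟩ := RingHom.mem_range.mp hx'
        exact ⟨neg_mem hxS, RingHom.mem_range.mpr ⟨-qx, by rw [map_neg, hqx, ← map_neg]; rfl⟩⟩
      | mul x y hx hy ihx ihy =>
        obtain ⟨hxS, hx'⟩ := ihx
        obtain ⟨hyS, hy'⟩ := ihy
        obtain ⟨qx, hqx⟩ := RingHom.mem_range.mp hx'
        obtain ⟨qy, hqy⟩ := RingHom.mem_range.mp hy'
        exact ⟨mul_mem hxS hyS, RingHom.mem_range.mpr ⟨qx * qy, by rw [map_mul, hqx, hqy, ← map_mul]; rfl⟩⟩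
    intro b hb
    obtain ⟨hbS, h⟩ := key (b : K) hb
    exact h
  have hf : Function.Surjective (IsLocalization.lift (S := Localization.AtPrime 𝔫) hunit) :=
    lift_surjective_of_normal_form (P := Localization.AtPrime 𝔫) _ _ hloc F hF 𝔫 hunit h𝔫u
  -- §13 (d): `P` is a regular local domain of dimension `3 - ρ` (pinned by the surjection)
  have hEdim : ((3 - ρ : ℕ) : WithBot ℕ∞) ≤ ringKrullDim (locAtCentre A''.toSubring O ⧸ Ideal.span (Set.range uρ)) :=
    natCast_sub_le_ringKrullDim_quotient_span (n := 3) hdimS3 uρ huρ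
  obtain ⟨hPreg, hPdom, hdimP⟩ :=
    localization_mvPolynomial_regular_of_surjective (ResidueField (locAtCentre A₂.toSubring O)) (3 - ρ) 𝔫 _ hf hEdim
  -- §13 (e): the criterion — `S` is REGULAR and lifts of regular parameters of `P` are regular parameters of `S`
  obtain ⟨hregS, -, -, hlift1, hlift2⟩ :=
    regular_of_regular_quotient (n := 3) (ρ := ρ) hdimS3 hρ3 uρ huρ hdimP (IsLocalization.lift hunit) hf
  -- §13 (f): a generator `q ∈ 𝔫` mapping to a regular parameter of `P`, its lift `ψ ∈ T[u_{≥ρ}] ⊆ S`, and `ψ ∈ M`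
  have hdimP0 : ringKrullDim (Localization.AtPrime 𝔫) ≠ 0 := by
    rw [hdimP]
    have h : (3 - ρ : ℕ) ≠ 0 := by omega
    exact_mod_cast h
  obtain ⟨q, hq𝔫, hq1, hq2⟩ := exists_generator_map_not_mem_sq hdimP0 (algebraMap _ (Localization.AtPrime 𝔫))
    (𝔫 : Set (MvPolynomial (Fin (3 - ρ)) (ResidueField (locAtCentre A₂.toSubring O))))
    (by rw [Ideal.span_eq]; exact Localization.AtPrime.map_eq_maximalIdeal)
  have hres : ∀ e : Fin (3 - ρ) →₀ ℕ, ∃ c : locAtCentre A₂.toSubring O, residue _ c = q.coeff e := fun e =>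
    Ideal.Quotient.mk_surjective (q.coeff e)
  choose lam hlam using hres
  set ψ : locAtCentre A''.toSubring O := ∑ e ∈ q.support, ι (lam e) * ∏ i, uS (zI i) ^ (e i) with hψdef
  have hψF : Ideal.Quotient.mk (Ideal.span (Set.range uρ)) ψ = F q := by
    rw [hψdef, map_sum, hFdef, MvPolynomial.coe_eval₂Hom, MvPolynomial.eval₂_eq']
    refine Finset.sum_congr rfl fun e _ => ?_
    rw [map_mul, map_prod, ← hlam e, hF₁]
    simp only [map_pow]
  have hψπ : Ideal.Quotient.mk (Ideal.span (Set.range uρ)) ψ =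
      IsLocalization.lift (S := Localization.AtPrime 𝔫) hunit (algebraMap _ (Localization.AtPrime 𝔫) q) := by
    rw [IsLocalization.lift_eq]; exact hψF
  -- §13 (f)″ GRADED DESCENT (new in PORT 4′): the components of `ψ ∈ T⁺[u_{≥ρ}] = Σ_s B_s T₀[u_{≥ρ}]`
  have hlamspan : ∀ e, ∃ (s : Finset S) (c : S → K), (∀ i, c i ∈ T₀) ∧ (∀ i ∉ s, c i = 0) ∧
      ((lam e : locAtCentre A₂.toSubring O) : K) = ∑ i ∈ s, c i * algebraMap k K (b i) := fun e => hTspan _ (lam e).2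
  choose sc cc hccT₀ hcc0 hcc using hlamspan
  set S₀ : Finset S := q.support.biUnion sc with hS₀def
  have hsub : ∀ e ∈ q.support, sc e ⊆ S₀ := fun e he => Finset.subset_biUnion_of_mem sc he
  have hcc' : ∀ e ∈ q.support, ((lam e : locAtCentre A₂.toSubring O) : K) =
      ∑ i : ↥S₀, cc e i * algebraMap k K (b i) := by
    intro e he
    rw [hcc e, Finset.sum_subset (hsub e he) (fun i _ hi => by rw [hcc0 e i hi, zero_mul]), ← Finset.sum_coe_sort]
  have hT₀S' : ∀ r, r ∈ T₀ → r ∈ locAtCentre A''.toSubring O := fun r hr => hTS (hT₀S hr)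
  have hBS : ∀ s, algebraMap k K (b s) ∈ locAtCentre A''.toSubring O := fun s => hTS (le_locAtCentre _ O (hk (b s)))
  set ψc : ↥S₀ → locAtCentre A''.toSubring O := fun i =>
    ∑ e ∈ q.support, (⟨cc e i, hT₀S' _ (hccT₀ e i)⟩ : locAtCentre A''.toSubring O) * ∏ j, uS (zI j) ^ (e j) with hψcdef
  have hψK : ((ψ : locAtCentre A''.toSubring O) : K) =
      ∑ e ∈ q.support, ((lam e : locAtCentre A₂.toSubring O) : K) * ∏ j, u (zI j) ^ (e j) := by
    rw [hψdef]; push_cast; rfl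
  have hψcK : ∀ i : ↥S₀, ((ψc i : locAtCentre A''.toSubring O) : K) =
      ∑ e ∈ q.support, cc e i * ∏ j, u (zI j) ^ (e j) := by
    intro i; rw [hψcdef]; push_cast; rfl
  have hψsumK : ((ψ : locAtCentre A''.toSubring O) : K) =
      ∑ i : ↥S₀, ((ψc i : locAtCentre A''.toSubring O) : K) * algebraMap k K (b i) := by
    rw [hψK]
    have h1 : ∑ e ∈ q.support, ((lam e : locAtCentre A₂.toSubring O) : K) * ∏ j, u (zI j) ^ (e j) =
        ∑ e ∈ q.support, (∑ i : ↥S₀, cc e i * algebraMap k K (b i)) * ∏ j, u (zI j) ^ (e j) :=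
      Finset.sum_congr rfl fun e he => by rw [hcc' e he]
    rw [h1]
    simp_rw [hψcK, Finset.sum_mul]
    rw [Finset.sum_comm]
    refine Finset.sum_congr rfl fun i _ => Finset.sum_congr rfl fun e _ => ?_
    ring
  have hψS : ψ = ∑ i : ↥S₀, ψc i * (⟨algebraMap k K (b i), hBS i⟩ : locAtCentre A''.toSubring O) := by
    apply Subtype.ext
    rw [hψsumK]; push_cast; rfl
  have hψcM : ∀ i : ↥S₀, ((ψc i : locAtCentre A''.toSubring O) : K) ∈ M := fun i => by
    rw [hψcK]
    exact sum_mem fun e _ => mul_mem (hT₀M _ (hccT₀ e i)) (prod_mem fun j _ => pow_mem (huM _ (hzIρ j)) _)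
  have hψ1 : ψ ∈ maximalIdeal (locAtCentre A''.toSubring O) := hlift1 ψ _ hψπ hq1
  have hψ2 : ψ ∉ (maximalIdeal (locAtCentre A''.toSubring O)) ^ 2 := hlift2 ψ _ hψπ hq2
  have hvψ : O.valuation ((ψ : locAtCentre A''.toSubring O) : K) < 1 := (mem_maximalIdeal_locAtCentre_iff hA''O ψ).mp hψ1
  have hsup : Finset.univ.sup (fun i : ↥S₀ => O.valuation ((ψc i : locAtCentre A''.toSubring O) : K)) < 1 := by
    rw [← hRG S₀ _ hψcM, ← hψsumK]; exact hvψ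
  have hψc1 : ∀ i : ↥S₀, ψc i ∈ maximalIdeal (locAtCentre A''.toSubring O) := fun i =>
    (mem_maximalIdeal_locAtCentre_iff hA''O _).mpr (lt_of_le_of_lt
      (Finset.le_sup (f := fun i : ↥S₀ => O.valuation ((ψc i : locAtCentre A''.toSubring O) : K)) (Finset.mem_univ i)) hsup)
  have hψc2 : ∃ i : ↥S₀, ψc i ∉ (maximalIdeal (locAtCentre A''.toSubring O)) ^ 2 := by
    by_contra hall
    push Not at hall
    exact hψ2 (by rw [hψS]; exact Ideal.sum_mem _ fun i _ => Ideal.mul_mem_right _ _ (hall i))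
  obtain ⟨i₁, hi₁⟩ := hψc2
  exact ⟨A'', hA''O, hAA'', hA''fg, hregS, ψc i₁, hψc1 i₁, hi₁, hψcM i₁⟩


/-! ## §H∞ THE COMPOSITION (kernel-checked): PORTS 1′_∞, 2′_∞, §F∞, 3 (verbatim), 4′_∞ and the exit lemma give THEOREM T′_∞'s
slice; T′_fin's slice (rev 3) is the corollary `S` finite, and T′₁'s the corollary `S := Fin p`, `b i := θ^i`. -/

section Composition

open AlgebraicGeometry CategoryTheory

/-- **THEOREM T′_∞'s slice from the ports** — modulo F-02 in LU³ form (`hLU3`, applied to the field `k^p`) and F-32 (`hEmb`).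
SORRY-FREE (composition and every port); data flow = the file header.  `hreg`, `hnd` unused (as in T, T′_fin). [folklore] -/
theorem cleanLU3DefectPRankTwoSepInf_of_ports (p : ℕ) [Fact p.Prime]
    (hLU3 : ∀ (k : Type) [Field k], LocalUniformization3 k)
    (hEmb : ∀ (Z : Scheme.{0}) [IsIntegral Z] [IsNoetherian Z], Scheme.IsRegular Z →
      Scheme.IsExcellent Z → ∀ (X : Set Z), IsClosed X → X ≠ Set.univ → topologicalKrullDim X ≤ 2 →
        ∃ (Z' : Scheme.{0}) (π : Z' ⟶ Z), IsProper π ∧ Function.Surjective π.base ∧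
          (∃ U : Z.Opens, (U : Set Z) = Xᶜ ∧ IsIso (π ∣_ U)) ∧
          IsStrictNormalCrossingsDivisor Z' (π.base ⁻¹' X)) :
    CleanLU3DefectPRankTwoSepInfAt p := by
  intro k _ _ K _ _ O A hAO hAfg hFrac hdimA hreg hdim3 hzd g₀ hg₀ hdefect htd hnd hP2 hsep S b hb hPI
  classical
  haveI := hFrac
  have hp : p.Prime := Fact.out
  haveI : CharP K p := charP_of_injective_algebraMap (algebraMap k K).injective p
  have hk : ∀ c : k, algebraMap k K c ∈ O := fun c => hAO (A.algebraMap_mem c)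
  -- `[K : k·K^p] = p³` (§A)
  have hdimAeq : ringKrullDim A = 3 := ringKrullDim_eq_three_of_locAtCentre O A hAO hdimA hdim3
  have hdeg : Module.finrank (Subfield.closure (Set.range (algebraMap k K) ∪ Set.range (frobenius K p))) K = p ^ 3 :=
    PDegreeSep.pDegreeThreeOfSepGenerated p k K A hAfg hFrac hdimAeq hsep
  -- §1′_∞ graded data on a common finite support `S₀ ⊆ S` (with `v B_s = 1`)
  obtain ⟨M, hM, hg₀M, hpM, hV, hRG, hBv, x, y, hx, hy, hvx, hvy, hP, t, ht, S₀, cf, hcfM, hcf0, hsum, hcfO⟩ :=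
    port_gradedDataInf p O A hAO hAfg g₀ hg₀ hdefect hP2 hdeg b hb hPI
  -- the finite set to monomialise: `x^p`, `y^p` and the non-zero graded coefficients of the generators
  set F : Finset K := (insert (x ^ p) (insert (y ^ p)
    ((t ×ˢ (S₀ ×ˢ (Finset.univ : Finset (Fin p × Fin p)))).image (fun q => cf q.1 q.2)))).filter (fun f => f ≠ 0)
    with hFdef
  have hFM : ∀ f ∈ F, f ∈ M := by
    intro f hf
    rw [hFdef, Finset.mem_filter, Finset.mem_insert, Finset.mem_insert, Finset.mem_image] at hf
    rcases hf with ⟨rfl | rfl | ⟨q, hq, rfl⟩, -⟩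
    · exact hpM x
    · exact hpM y
    · exact hcfM q.1 (Finset.mem_product.mp hq).1 q.2
  have hF0 : ∀ f ∈ F, f ≠ 0 := fun f hf => (Finset.mem_filter.mp hf).2
  have hxpF : x ^ p ∈ F := Finset.mem_filter.mpr ⟨by simp, pow_ne_zero _ hx⟩
  have hypF : y ^ p ∈ F := Finset.mem_filter.mpr ⟨by simp, pow_ne_zero _ hy⟩
  have hcfF : ∀ a ∈ t, ∀ l, cf a l ≠ 0 → cf a l ∈ F := by
    intro a ha l hne
    have hl : l.1 ∈ S₀ := by_contra fun hl => hne (hcf0 a ha l hl)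
    refine Finset.mem_filter.mpr ⟨Finset.mem_insert_of_mem (Finset.mem_insert_of_mem ?_), hne⟩
    exact Finset.mem_image.mpr ⟨(a, l), Finset.mem_product.mpr ⟨ha,
      Finset.mem_product.mpr ⟨hl, Finset.mem_univ _⟩⟩, rfl⟩
  -- §2′_∞ the monomialising `k^p`-model inside `M` (two-field M-side)
  obtain ⟨G₂, C, hG₂O, hC, hApC, hCM, z, hzC, hzv, hz0, hzspan, hmono⟩ :=
    port_monomialModelInf p (hLU3 _) hEmb O A hAO hAfg hdimA hdim3 hzd g₀ M hM F hFM hF0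
  -- §F∞ the base change `T⁺ = locAtCentre k[G₂] O`, regular with parameters `z`
  obtain ⟨A₂, hA₂O, hA₂fg, hApA₂, hCA₂, hTspan, hreg₂, zT, hzT, hzspanT, hdimT⟩ :=
    basechange_modelInf p O A hAO hAfg hdimA hdim3 hzd t ht M b hb hRG G₂ hG₂O C hC hApC hCM z hzC hzv hzspan
  haveI := hreg₂
  have hTT : locAtCentre C O ≤ locAtCentre A₂.toSubring O := locAtCentre_mono O hCA₂
  have hBA₂ : ∀ s, algebraMap k K (b s) ∈ A₂ := fun s => A₂.algebraMap_mem (b s)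
  have hBT : ∀ s, algebraMap k K (b s) ∈ locAtCentre A₂.toSubring O := fun s => le_locAtCentre _ O (hBA₂ s)
  choose! ε ex hεT hεv hfeq using hmono
  have hzM : ∀ i, z i ∈ M := fun i => hCM _ (hzC i)
  have hzV : ∀ i, ∃ w : K, w ≠ 0 ∧ O.valuation (z i) = O.valuation (w ^ p) := fun i => hV _ (hzM i) (hz0 i)
  have hxA : x ^ p = ε (x ^ p) * ∏ i, z i ^ ex (x ^ p) i := hfeq _ hxpF
  have hyB : y ^ p = ε (y ^ p) * ∏ i, z i ^ ex (y ^ p) i := hfeq _ hypF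
  -- exponent data of the non-zero graded pieces (the `B_s` factor is a unit and is dropped)
  set pieces : Finset (K × (S × (Fin p × Fin p))) :=
    (t ×ˢ (S₀ ×ˢ (Finset.univ : Finset (Fin p × Fin p)))).filter (fun q => cf q.1 q.2 ≠ 0) with hpieces
  set E : Finset ((Fin 3 → ℤ) × (Fin p × Fin p)) := pieces.image (fun q => (ex (cf q.1 q.2), q.2.2)) with hEdef
  have hE : ∀ e ∈ E, O.valuation ((∏ i, z i ^ e.1 i) * (x ^ (e.2.1 : ℕ) * y ^ (e.2.2 : ℕ))) ≤ 1 := by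
    intro e he
    obtain ⟨q, hq, rfl⟩ := Finset.mem_image.mp he
    obtain ⟨hq1, hq2⟩ := Finset.mem_filter.mp hq
    have hat : q.1 ∈ t := (Finset.mem_product.mp hq1).1
    have hF' : cf q.1 q.2 ∈ F := hcfF q.1 hat q.2 hq2
    have hval : O.valuation (cf q.1 q.2 * (algebraMap k K (b q.2.1) * (x ^ (q.2.2.1 : ℕ) * y ^ (q.2.2.2 : ℕ)))) ≤ 1 :=
      (O.valuation_le_one_iff _).mpr (hcfO q.1 hat q.2)
    rw [hfeq _ hF', map_mul, map_mul, map_mul, hεv _ hF', hBv, one_mul, one_mul, ← map_mul] at hval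
    simpa using hval
  -- §3 the toric chart (VERBATIM)
  obtain ⟨ρ, hρ, c, a, b', u, ha, hb', hu, hupos, huzero, hzu, hEu⟩ :=
    port_toricChart p O A hAO hAfg hdimA hdim3 htd hx hy hP z hz0 hzv hzV (ε (x ^ p)) (ε (y ^ p))
      (hεv _ hxpF) (hεv _ hypF) (ex (x ^ p)) (ex (y ^ p)) hxA hyB E hE
  -- (PB0): the value-zero chart monomials involve no `x`, `y`, hence lie in `M`
  have hab0 : ∀ j : Fin 3, ρ ≤ (j : ℕ) → a j = 0 ∧ b' j = 0 := by
    intro j hj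
    obtain ⟨W, hW0, hW⟩ := exists_valuation_prod_zpow_eq O z hzV (c j)
    exact exponents_eq_zero_of_valuation_eq_one O hP (ha j) (hb' j) hW0 hW (by rw [← hu j]; exact huzero j hj)
  have huM : ∀ j : Fin 3, ρ ≤ (j : ℕ) → u j ∈ M := by
    intro j hj
    obtain ⟨ha0, hb0⟩ := hab0 j hj
    rw [hu j, ha0, hb0, pow_zero, pow_zero, mul_one, mul_one]
    exact prod_mem fun i _ => zpow_mem (hzM i) _
  have hu0 : ∀ j, u j ≠ 0 := by
    intro j
    rw [hu j]
    exact mul_ne_zero (Finset.prod_ne_zero_iff.mpr fun i _ => zpow_ne_zero _ (hz0 i))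
      (mul_ne_zero (pow_ne_zero _ hx) (pow_ne_zero _ hy))
  -- the unit factors `α^i β^j` are units of `T⁺`
  have hunit : ∀ (ia ib : ℤ), ε (x ^ p) ^ ia * ε (y ^ p) ^ ib ∈ locAtCentre A₂.toSubring O ∧
      O.valuation (ε (x ^ p) ^ ia * ε (y ^ p) ^ ib) = 1 := fun ia ib =>
    ⟨mul_mem (zpow_mem_locAtCentre (hTT (hεT _ hxpF)) (hεv _ hxpF) ia)
        (zpow_mem_locAtCentre (hTT (hεT _ hypF)) (hεv _ hypF) ib),
      by rw [map_mul, map_zpow₀, map_zpow₀, hεv _ hxpF, hεv _ hypF, one_zpow, one_zpow, one_mul]⟩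
  have hzu' : ∀ i : Fin 3, ∃ (ε' : K) (d : Fin 3 → ℤ), ε' ∈ locAtCentre A₂.toSubring O ∧ O.valuation ε' = 1 ∧
      (∀ j : Fin 3, (j : ℕ) < ρ → 0 ≤ d j) ∧ (∃ j : Fin 3, (j : ℕ) < ρ ∧ 0 < d j) ∧
      ((zT i : K)) = ε' * ∏ j, u j ^ d j := by
    intro i
    obtain ⟨d, ia, ib, hd, hdpos, hzi⟩ := hzu i
    refine ⟨_, d, (hunit ia ib).1, (hunit ia ib).2, hd, hdpos, ?_⟩
    rw [hzT i, hzi]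
  -- the generators of `A` as unit-weighted sums of chart monomials with `d_{<ρ} ≥ 0`
  choose! dE iaE ibE hdE hkerE hmonE using hEu
  have htu' : ∀ a₀ ∈ t, ∃ (ν : ↥(S₀ ×ˢ (Finset.univ : Finset (Fin p × Fin p))) → K)
      (d : ↥(S₀ ×ˢ (Finset.univ : Finset (Fin p × Fin p))) → Fin 3 → ℤ),
      (∀ l, ν l = 0 ∨ (ν l ∈ locAtCentre A₂.toSubring O ∧ O.valuation (ν l) = 1)) ∧
      (∀ l, ∀ j : Fin 3, (j : ℕ) < ρ → 0 ≤ d l j) ∧ a₀ = ∑ l, ν l * ∏ j, u j ^ d l j := by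
    intro a₀ ha₀
    have hmemE : ∀ l : ↥(S₀ ×ˢ (Finset.univ : Finset (Fin p × Fin p))), cf a₀ l ≠ 0 → (ex (cf a₀ l), l.1.2) ∈ E :=
      fun l hne => Finset.mem_image.mpr ⟨(a₀, (l : S × (Fin p × Fin p))),
        Finset.mem_filter.mpr ⟨Finset.mem_product.mpr ⟨ha₀, l.2⟩, hne⟩, rfl⟩
    refine ⟨fun l => if cf a₀ l = 0 then 0 else
        ε (cf a₀ l) * (ε (x ^ p) ^ iaE (ex (cf a₀ l), l.1.2) * ε (y ^ p) ^ ibE (ex (cf a₀ l), l.1.2) *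
          algebraMap k K (b l.1.1)),
      fun l => if cf a₀ l = 0 then 0 else dE (ex (cf a₀ l), l.1.2), ?_, ?_, ?_⟩
    · intro l
      by_cases h0 : cf a₀ l = 0
      · exact Or.inl (by simp [h0])
      · refine Or.inr ?_
        simp only [h0, if_false]
        have hF' := hcfF a₀ ha₀ l h0
        exact ⟨mul_mem (hTT (hεT _ hF')) (mul_mem (hunit _ _).1 (hBT l.1.1)),
          by rw [map_mul, map_mul, hεv _ hF', (hunit _ _).2, hBv, one_mul, one_mul]⟩
    · intro l j hj
      by_cases h0 : cf a₀ l = 0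
      · simp [h0]
      · simp only [h0, if_false]
        exact hdE _ (hmemE l h0) j hj
    · conv_lhs => rw [← hsum a₀ ha₀, ← Finset.sum_coe_sort]
      refine Finset.sum_congr rfl fun l _ => ?_
      by_cases h0 : cf a₀ l = 0
      · simp [h0]
      · simp only [h0, if_false]
        have hF' := hcfF a₀ ha₀ l h0
        have hmon := hmonE _ (hmemE l h0)
        simp only at hmon
        calc cf a₀ l * (algebraMap k K (b l.1.1) * (x ^ (l.1.2.1 : ℕ) * y ^ (l.1.2.2 : ℕ)))
            = (ε (cf a₀ l) * ∏ i, z i ^ ex (cf a₀ l) i) *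
                (algebraMap k K (b l.1.1) * (x ^ (l.1.2.1 : ℕ) * y ^ (l.1.2.2 : ℕ))) := by
              rw [← hfeq _ hF']
          _ = ε (cf a₀ l) * algebraMap k K (b l.1.1) *
                ((∏ i, z i ^ ex (cf a₀ l) i) * (x ^ (l.1.2.1 : ℕ) * y ^ (l.1.2.2 : ℕ))) := by
              ring
          _ = ε (cf a₀ l) * (ε (x ^ p) ^ iaE (ex (cf a₀ l), l.1.2) * ε (y ^ p) ^ ibE (ex (cf a₀ l), l.1.2) *
                algebraMap k K (b l.1.1)) * ∏ j, u j ^ dE (ex (cf a₀ l), l.1.2) j := by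
              rw [hmon]; ring
  -- §G∞ the regular chart algebra and its regular parameter in `M` (graded descent on a finite support)
  obtain ⟨A'', hA''O, hAA'', hA''fg, hreg'', ψ, hψ1, hψ2, hψM⟩ :=
    port_regularParameterInf p O A hAO hAfg hdimA hdim3 hzd M A₂ hA₂O hA₂fg hApA₂ b
      (locAtCentre C O) hCM hTT hTspan hRG hreg₂ zT hzspanT hdimT t ht ρ hρ u hu0 hupos huzero huM hzu' htu'
  -- exit: clean form (3) (VERBATIM)
  obtain ⟨cM, hcM⟩ := (hM _).mp hψM
  exact cleanLUConcl_of_parameter O A A'' hA''O hAA'' hA''fg hreg'' g₀ ψ hψ1 hψ2 cM hcM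

/-- The same with F-02 consumed in its main-theorem form `CossartPiltant2019` (✓ `CossartPiltant2019.lu3`). [folklore] -/
theorem cleanLU3DefectPRankTwoSepInf_of_cossartPiltant2019 (p : ℕ) [Fact p.Prime]
    (hCP : CossartPiltant2019.{0})
    (hEmb : ∀ (Z : Scheme.{0}) [IsIntegral Z] [IsNoetherian Z], Scheme.IsRegular Z →
      Scheme.IsExcellent Z → ∀ (X : Set Z), IsClosed X → X ≠ Set.univ → topologicalKrullDim X ≤ 2 →
        ∃ (Z' : Scheme.{0}) (π : Z' ⟶ Z), IsProper π ∧ Function.Surjective π.base ∧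
          (∃ U : Z.Opens, (U : Set Z) = Xᶜ ∧ IsIso (π ∣_ U)) ∧
          IsStrictNormalCrossingsDivisor Z' (π.base ⁻¹' X)) :
    CleanLU3DefectPRankTwoSepInfAt p :=
  cleanLU3DefectPRankTwoSepInf_of_ports p (fun k _ => hCP.lu3 k) hEmb

/-- **T′_fin ⊂ T′_∞**: the finite-`p`-rank slice of rev 3 (`Lens5_TPrime.lean`) is the case `S` finite of the new slice (a finite
family is finitely supported; §B″ conversions). [folklore] -/
theorem cleanLU3DefectPRankTwoSepFin_of_sepInf (p : ℕ) [Fact p.Prime]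
    (hInf : CleanLU3DefectPRankTwoSepInfAt p) : CleanLU3DefectPRankTwoSepFinAt p := by
  intro k _ _ K _ _ O A hAO hAfg hFrac hdimA hreg hdim3 hzd g₀ hg₀ hdefect htd hnd hP2 hsep S _ b hb hPI
  have hp : p.Prime := Fact.out
  exact hInf k K O A hAO hAfg hFrac hdimA hreg hdim3 hzd g₀ hg₀ hdefect htd hnd hP2 hsep S b
    (isPSpanningFamilyInf_of_fintype b hb)
    (residuallyPIndependentFamilyInf_of_fintype hp.ne_zero O (fun s => algebraMap k K (b s)) hPI)

/-- **THEOREM T′_fin's slice** (rev 3's theorem), now a corollary of T′_∞. [folklore] -/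
theorem cleanLU3DefectPRankTwoSepFin_of_cossartPiltant2019 (p : ℕ) [Fact p.Prime]
    (hCP : CossartPiltant2019.{0})
    (hEmb : ∀ (Z : Scheme.{0}) [IsIntegral Z] [IsNoetherian Z], Scheme.IsRegular Z →
      Scheme.IsExcellent Z → ∀ (X : Set Z), IsClosed X → X ≠ Set.univ → topologicalKrullDim X ≤ 2 →
        ∃ (Z' : Scheme.{0}) (π : Z' ⟶ Z), IsProper π ∧ Function.Surjective π.base ∧
          (∃ U : Z.Opens, (U : Set Z) = Xᶜ ∧ IsIso (π ∣_ U)) ∧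
          IsStrictNormalCrossingsDivisor Z' (π.base ⁻¹' X)) :
    CleanLU3DefectPRankTwoSepFinAt p :=
  cleanLU3DefectPRankTwoSepFin_of_sepInf p (cleanLU3DefectPRankTwoSepInf_of_cossartPiltant2019 p hCP hEmb)

/-- **T′₁ ⊂ T′_fin**: the `p`-rank-one slice is the case `S := Fin p`, `b i := θ^i` of the finite-`p`-rank slice. [folklore] -/
theorem cleanLU3DefectPRankTwoSepRkOne_of_sepFin (p : ℕ) [Fact p.Prime]
    (hFin : CleanLU3DefectPRankTwoSepFinAt p) : CleanLU3DefectPRankTwoSepRkOneAt p := by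
  intro k _ _ K _ _ O A hAO hAfg hFrac hdimA hreg hdim3 hzd g₀ hg₀ hdefect htd hnd hP2 hsep θ hθ hPI
  refine hFin k K O A hAO hAfg hFrac hdimA hreg hdim3 hzd g₀ hg₀ hdefect htd hnd hP2 hsep (Fin p)
    (fun i => θ ^ (i : ℕ)) (fun c => hθ c) ?_
  intro w hw hw1
  simpa only [map_pow] using hPI w hw hw1


/-- **THEOREM T′₁'s slice** (`p`-rank one), now a corollary of T′_∞ via T′_fin; same statement as `Lens5_TPrime.lean` rev 1 / rev 3. [folklore] -/
theorem cleanLU3DefectPRankTwoSepRkOne_of_cossartPiltant2019 (p : ℕ) [Fact p.Prime]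
    (hCP : CossartPiltant2019.{0})
    (hEmb : ∀ (Z : Scheme.{0}) [IsIntegral Z] [IsNoetherian Z], Scheme.IsRegular Z →
      Scheme.IsExcellent Z → ∀ (X : Set Z), IsClosed X → X ≠ Set.univ → topologicalKrullDim X ≤ 2 →
        ∃ (Z' : Scheme.{0}) (π : Z' ⟶ Z), IsProper π ∧ Function.Surjective π.base ∧
          (∃ U : Z.Opens, (U : Set Z) = Xᶜ ∧ IsIso (π ∣_ U)) ∧
          IsStrictNormalCrossingsDivisor Z' (π.base ⁻¹' X)) :
    CleanLU3DefectPRankTwoSepRkOneAt p :=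
  cleanLU3DefectPRankTwoSepRkOne_of_sepFin p (cleanLU3DefectPRankTwoSepFin_of_cossartPiltant2019 p hCP hEmb)


end Composition

/-! ## §I (rev 2) THEOREM T″ — the slice stated with «`κ_v/k` SEPARABLE» (Mathlib's `Algebra.IsSeparable`) in place of the family `b`

Bridge B1 (Mac Lane 1939, separable direction) IN KERNEL: if the residue field `κ_v = O/𝔪_v` is separable over `k` (for ANY `k`-algebra
structure on `κ_v` compatible with `k → O → κ_v`), then EVERY `k^p`-linearly independent family of constants is residually `p`-independent along
`v` (§B″ (RPI∞)); the proof is Mathlib's linear disjointness of a separable and a purely inseparable extension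
(`IntermediateField.linearDisjoint_of_isPurelyInseparable_of_isSeparable`, applied to `κ_v^p ⊇ k^p` separable and `k ⊇ k^p` purely inseparable
inside `κ_v`, after transporting `κ_v/k` to `κ_v^p/k^p` along the two Frobenius isomorphisms).  Since every field has a `k^p`-basis
(`exists_pBasisFamilyInf`), T′_∞ yields **T″**: `stub_cleanLU3DefectNonDiscrete` on {(P2)} × {`K/k` separably generated} × {`κ_v/k` separable},
with NO auxiliary family in the statement. -/

/-- **Mac Lane's criterion, separable direction (elementary form).**  If `κ/k` is a separable field extension in characteristic `p` and
`b : S → k` is `k^p`-linearly independent (no non-trivial relation `Σ d_s^p b_s = 0` in `k`), then the images of the `b_s` in `κ` are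
`κ^p`-linearly independent (no non-trivial relation `Σ e_s^p b_s = 0` in `κ`).  [MacLane 1939, Thm. 11; Mathlib linear disjointness] -/
theorem pow_linearIndependent_of_isSeparable (p : ℕ) [Fact p.Prime] {k κ : Type} [Field k] [CharP k p] [Field κ] [Algebra k κ]
    [Algebra.IsSeparable k κ] {S : Type} (b : S → k)
    (hbli : ∀ (s₀ : Finset S) (d : S → k), ∑ i ∈ s₀, d i ^ p * b i = 0 → ∀ i ∈ s₀, d i = 0)
    (s₀ : Finset S) (e : S → κ) (he : ∑ i ∈ s₀, e i ^ p * algebraMap k κ (b i) = 0) : ∀ i ∈ s₀, e i = 0 := by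
  classical
  have hp : p.Prime := Fact.out
  haveI : ExpChar k p := ExpChar.prime hp
  haveI : CharP κ p := ((algebraMap k κ).charP_iff_charP p).mp inferInstance
  haveI : ExpChar κ p := ExpChar.prime hp
  -- ## the small field `F = k^p ⊆ k` and the tower `F → k → κ` (canonical `Subfield` instances)
  set F : Subfield k := (frobenius k p).fieldRange with hFdef
  haveI : CharP F p := ((algebraMap F k).charP_iff_charP p).mpr inferInstance
  haveI : ExpChar F p := ExpChar.prime hp
  have halgF : ∀ x : F, algebraMap F κ x = algebraMap k κ (x : k) := fun _ => rfl
  -- ## `k/F` is purely inseparable (of height one)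
  haveI : IsPurelyInseparable F k := by
    rw [isPurelyInseparable_iff_pow_mem F p]
    intro x
    refine ⟨1, ⟨⟨x ^ p, RingHom.mem_fieldRange.mpr ⟨x, frobenius_def _ _⟩⟩, ?_⟩⟩
    rw [pow_one]; rfl
  -- ## `κ^p` as an intermediate field of `κ/F`
  have hmemSp : ∀ x : F, algebraMap F κ x ∈ (frobenius κ p).fieldRange := fun x => by
    obtain ⟨c, hc⟩ := RingHom.mem_fieldRange.mp x.2
    refine RingHom.mem_fieldRange.mpr ⟨algebraMap k κ c, ?_⟩
    rw [frobenius_def, ← map_pow, ← frobenius_def, hc, halgF]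
  let Sp : IntermediateField F κ := ((frobenius κ p).fieldRange).toIntermediateField hmemSp
  have hmemSp_iff : ∀ y : κ, y ∈ Sp ↔ y ∈ (frobenius κ p).fieldRange := fun _ => Iff.rfl
  -- ## `Sp/F` is separable: transport `κ/k` along the two Frobenius isomorphisms `k ≃ F`, `κ ≃ Sp`
  haveI : Algebra.IsSeparable F Sp := by
    let φ₁ : k →+* F := (frobenius k p).codRestrict F (fun x => RingHom.mem_fieldRange.mpr ⟨x, rfl⟩)
    have hφ₁ : Function.Bijective φ₁ := by
      refine ⟨φ₁.injective, fun y => ?_⟩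
      obtain ⟨x, hx⟩ := RingHom.mem_fieldRange.mp y.2
      exact ⟨x, Subtype.ext hx⟩
    let e₁ : k ≃+* F := RingEquiv.ofBijective φ₁ hφ₁
    let φ₂ : κ →+* Sp := (frobenius κ p).codRestrict Sp (fun y => (hmemSp_iff _).mpr (RingHom.mem_fieldRange.mpr ⟨y, rfl⟩))
    have hφ₂ : Function.Bijective φ₂ := by
      refine ⟨φ₂.injective, fun y => ?_⟩
      obtain ⟨x, hx⟩ := RingHom.mem_fieldRange.mp ((hmemSp_iff _).mp y.2)
      exact ⟨x, Subtype.ext hx⟩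
    let e₂ : κ ≃+* Sp := RingEquiv.ofBijective φ₂ hφ₂
    have he : (algebraMap F Sp).comp (e₁ : k →+* F) = (e₂ : κ →+* Sp).comp (algebraMap k κ) := by
      ext c
      show algebraMap F κ (φ₁ c) = (φ₂ (algebraMap k κ c) : κ)
      rw [halgF]
      show algebraMap k κ (frobenius k p c) = frobenius κ p (algebraMap k κ c)
      rw [frobenius_def, frobenius_def, map_pow]
    exact Algebra.IsSeparable.of_equiv_equiv e₁ e₂ he
  -- ## linear disjointness (Mathlib) and the transfer of linear independence from `F` to `Sp = κ^p`
  have H : Sp.LinearDisjoint k := IntermediateField.linearDisjoint_of_isPurelyInseparable_of_isSeparable (E := k) Sp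
  have hbF : LinearIndependent F b := by
    rw [linearIndependent_iff']
    intro s g hg i hi
    have hroot : ∀ j, ∃ d : k, d ^ p = (g j : k) := fun j => by
      obtain ⟨d, hd⟩ := RingHom.mem_fieldRange.mp (g j).2
      exact ⟨d, by rw [← hd, frobenius_def]⟩
    choose d hd using hroot
    have hrel : ∑ j ∈ s, d j ^ p * b j = 0 := by
      rw [← hg]
      exact Finset.sum_congr rfl fun j _ => by rw [hd, Subfield.smul_def, smul_eq_mul]
    have := hbli s d hrel i hi
    apply Subtype.ext
    rw [← hd i, this, zero_pow hp.ne_zero]; rfl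
  have hbSp : LinearIndependent Sp (algebraMap k κ ∘ b) := H.linearIndependent_right' hbF
  -- ## read off the elementary statement
  intro i hi
  rw [linearIndependent_iff'] at hbSp
  let g : S → Sp := fun j => ⟨e j ^ p, (hmemSp_iff _).mpr (RingHom.mem_fieldRange.mpr ⟨e j, frobenius_def _ _⟩)⟩
  have hg : ∑ j ∈ s₀, g j • (algebraMap k κ ∘ b) j = 0 := by
    rw [← he]
    exact Finset.sum_congr rfl fun j _ => by rw [IntermediateField.smul_def, smul_eq_mul]; rfl
  have h2 : e i ^ p = 0 := congrArg Subtype.val (hbSp s₀ g hg i hi)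
  exact (pow_eq_zero_iff hp.ne_zero).mp h2

/-- **Bridge B1 (Mac Lane), separable direction, along a valuation.**  Let the constants be `v`-integral (`hk`) and let `κ_v = O/𝔪_v` carry
ANY `k`-algebra structure compatible with `k → O → κ_v` (`hcomp`).  If `κ_v/k` is SEPARABLE, then every `k^p`-linearly independent family
`b` of constants is residually `p`-independent along `v` (§B″ (RPI∞)): a relation `Σ w_s^p b_s ∈ 𝔪_v` with some `w_s` a unit would reduce to a
non-trivial `κ_v^p`-relation among the `b̄_s`, excluded by `pow_linearIndependent_of_isSeparable`. [MacLane 1939; folklore] -/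
theorem residuallyPIndependentFamilyInf_of_isSeparable (p : ℕ) [Fact p.Prime] {k K : Type} [Field k] [CharP k p]
    [Field K] [Algebra k K] (O : ValuationSubring K) (hk : ∀ c : k, algebraMap k K c ∈ O)
    [Algebra k (IsLocalRing.ResidueField O)]
    (hcomp : ∀ (c : k) (h : algebraMap k K c ∈ O),
      algebraMap k (IsLocalRing.ResidueField O) c = IsLocalRing.residue O ⟨algebraMap k K c, h⟩)
    [Algebra.IsSeparable k (IsLocalRing.ResidueField O)]
    {S : Type} (b : S → k)
    (hbli : ∀ (s₀ : Finset S) (d : S → k), ∑ i ∈ s₀, d i ^ p * b i = 0 → ∀ i ∈ s₀, d i = 0) :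
    ResiduallyPIndependentFamilyInf p O (fun s => algebraMap k K (b s)) := by
  classical
  intro s₀ w hw hw1
  let wO : S → O := fun j => ⟨w j, hw j⟩
  let BO : S → O := fun j => ⟨algebraMap k K (b j), hk (b j)⟩
  set xO : O := ∑ j ∈ s₀, wO j ^ p * BO j with hxOdef
  have hx : (xO : K) = ∑ j ∈ s₀, w j ^ p * algebraMap k K (b j) := by
    rw [hxOdef]; push_cast; rfl
  have hle : O.valuation (∑ j ∈ s₀, w j ^ p * algebraMap k K (b j)) ≤ 1 := by
    rw [← hx]; exact (O.valuation_le_one_iff _).mpr xO.2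
  by_contra hne
  have hlt : O.valuation (∑ j ∈ s₀, w j ^ p * algebraMap k K (b j)) < 1 := lt_of_le_of_ne hle hne
  rw [← hx, ← O.valuation_lt_one_iff] at hlt
  have hres : IsLocalRing.residue O xO = 0 := (IsLocalRing.residue_eq_zero_iff _).mpr hlt
  have hsum : ∑ j ∈ s₀, IsLocalRing.residue O (wO j) ^ p * algebraMap k (IsLocalRing.ResidueField O) (b j) = 0 := by
    rw [← hres, hxOdef, map_sum]
    exact Finset.sum_congr rfl fun j _ => by rw [map_mul, map_pow, hcomp (b j) (hk (b j))]
  have hall := pow_linearIndependent_of_isSeparable p b hbli s₀ (fun j => IsLocalRing.residue O (wO j)) hsum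
  obtain ⟨i, hi, hvi⟩ := hw1
  have hmax : wO i ∈ IsLocalRing.maximalIdeal O := (IsLocalRing.residue_eq_zero_iff _).mp (hall i hi)
  have hlt1 : O.valuation (w i) < 1 := (O.valuation_lt_one_iff _).mp hmax
  exact absurd hvi hlt1.ne

/-- **Every field of characteristic `p` has a `k^p`-basis**, i.e. a family `b` which is `p`-spanning with finitely supported sums (§B″ (SPAN∞))
AND `k^p`-linearly independent (`Module.Free.chooseBasis` over the subfield `k^p`). [folklore] -/
theorem exists_pBasisFamilyInf (p : ℕ) [Fact p.Prime] (k : Type) [Field k] [CharP k p] :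
    ∃ (S : Type) (b : S → k), IsPSpanningFamilyInf p b ∧
      ∀ (s₀ : Finset S) (d : S → k), ∑ i ∈ s₀, d i ^ p * b i = 0 → ∀ i ∈ s₀, d i = 0 := by
  classical
  have hp : p.Prime := Fact.out
  let kp : Subfield k := (frobenius k p).fieldRange
  let B := Module.Free.chooseBasis kp k
  have hroot : ∀ x : kp, ∃ d : k, d ^ p = (x : k) := fun x => by
    obtain ⟨d, hd⟩ := RingHom.mem_fieldRange.mp x.2
    exact ⟨d, by rw [← hd, frobenius_def]⟩
  choose rt hrt using hroot
  refine ⟨Module.Free.ChooseBasisIndex kp k, fun i => B i,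
    fun c => ⟨(B.repr c).support, fun i => rt (B.repr c i), ?_⟩, fun s₀ d hd i hi => ?_⟩
  · conv_lhs => rw [← B.linearCombination_repr c, Finsupp.linearCombination_apply, Finsupp.sum]
    refine Finset.sum_congr rfl fun i _ => ?_
    rw [hrt, Subfield.smul_def, smul_eq_mul]
  · have hli := B.linearIndependent
    rw [linearIndependent_iff'] at hli
    let g : Module.Free.ChooseBasisIndex kp k → kp := fun j => ⟨d j ^ p, RingHom.mem_fieldRange.mpr ⟨d j, frobenius_def _ _⟩⟩
    have hg : ∑ j ∈ s₀, g j • B j = 0 := by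
      rw [← hd]
      exact Finset.sum_congr rfl fun j _ => by rw [Subfield.smul_def, smul_eq_mul]
    have h2 : d i ^ p = 0 := congrArg Subtype.val (hli s₀ g hg i hi)
    exact (pow_eq_zero_iff hp.ne_zero).mp h2

/-- **THEOREM T″'s slice**: `stub_cleanLU3DefectNonDiscrete` at `p` on {`[Γ : pΓ] = p²`, `K/k` separably generated, `κ_v/k` SEPARABLE} — the
last condition stated with Mathlib's `Algebra.IsSeparable` for any `k`-algebra structure on `κ_v = IsLocalRing.ResidueField O` compatible with
`k → O → κ_v`; NO `PerfectField k`, NO finiteness of `[k : k^p]`, NO auxiliary family. [folklore] -/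
def CleanLU3DefectPRankTwoSepResAt (p : ℕ) : Prop :=
    ∀ (k : Type) [Field k] [CharP k p] (K : Type) [Field K] [Algebra k K]
    (O : ValuationSubring K) (A : Subalgebra k K), A.toSubring ≤ O.toSubring → A.FG → IsFractionRing A K →
    ringKrullDim A ≤ 3 → IsRegularLocalRing (locAtCentre A.toSubring O) →
    ringKrullDim (locAtCentre A.toSubring O) = 3 →
    (∀ (T : Subring K) (hT : T ≤ O.toSubring), A.toSubring ≤ T → (subringCentre T O hT).IsMaximal) →
    ∀ g₀ : K, (∀ c : K, c ^ p ≠ g₀) →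
    (∀ f₀ : K, ∃ f₁ : K, O.valuation (g₀ - f₁ ^ p) < O.valuation (g₀ - f₀ ^ p)) →
    (∀ hk : ∀ c : k, algebraMap k K c ∈ O, transcendenceDefect k O hk ≠ 0) →
    ¬ (∃ π : K, π ≠ 0 ∧ (∀ x : K, O.valuation x < 1 → O.valuation x ≤ O.valuation π) ∧
      (∀ x : K, x ≠ 0 → ∃ n : ℕ, O.valuation π ^ n ≤ O.valuation x)) →
    PRankTwoAt p O → SepGenerated k K →
    ∀ [Algebra k (IsLocalRing.ResidueField O)],
      (∀ (c : k) (h : algebraMap k K c ∈ O),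
        algebraMap k (IsLocalRing.ResidueField O) c = IsLocalRing.residue O ⟨algebraMap k K c, h⟩) →
      Algebra.IsSeparable k (IsLocalRing.ResidueField O) →
    CleanLUConcl p k K O A g₀

/-- **T″ ⊂ T′_∞**: over ANY ground field, «`κ_v/k` separable» supplies T′_∞'s family — a `k^p`-basis of `k` (`exists_pBasisFamilyInf`),
residually `p`-independent by Bridge B1 (`residuallyPIndependentFamilyInf_of_isSeparable`). [folklore] -/
theorem cleanLU3DefectPRankTwoSepRes_of_sepInf (p : ℕ) [Fact p.Prime] (hInf : CleanLU3DefectPRankTwoSepInfAt p) :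
    CleanLU3DefectPRankTwoSepResAt p := by
  intro k _ _ K _ _ O A hAO hAfg hFrac hdimA hreg hdim3 hzd g₀ hg₀ hdefect htd hnd hP2 hsep _ hcomp hks
  have hk : ∀ c : k, algebraMap k K c ∈ O := fun c => hAO (A.algebraMap_mem c)
  obtain ⟨S, b, hb, hbli⟩ := exists_pBasisFamilyInf p k
  exact hInf k K O A hAO hAfg hFrac hdimA hreg hdim3 hzd g₀ hg₀ hdefect htd hnd hP2 hsep S b hb
    (residuallyPIndependentFamilyInf_of_isSeparable p O hk hcomp b hbli)

open AlgebraicGeometry CategoryTheory in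
/-- **THEOREM T″ (kernel-checked)**: F-02 (CP 2019, LU³ form over the field `k^p`) and F-32 give `stub_cleanLU3DefectNonDiscrete` on
{`[Γ : pΓ] = p²`} × {`K/k` separably generated} × {`κ_v/k` separable} for an ARBITRARY ground field `k` of characteristic `p` — no auxiliary
family, no `PerfectField k`, no finiteness of `[k : k^p]`.  OURS · CANDIDATE · counted 0; resolution in char p NOT proved. [folklore] -/
theorem cleanLU3DefectPRankTwoSepRes_of_cossartPiltant2019 (p : ℕ) [Fact p.Prime]
    (hCP : CossartPiltant2019.{0})
    (hEmb : ∀ (Z : Scheme.{0}) [IsIntegral Z] [IsNoetherian Z], Scheme.IsRegular Z →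
      Scheme.IsExcellent Z → ∀ (X : Set Z), IsClosed X → X ≠ Set.univ → topologicalKrullDim X ≤ 2 →
        ∃ (Z' : Scheme.{0}) (π : Z' ⟶ Z), IsProper π ∧ Function.Surjective π.base ∧
          (∃ U : Z.Opens, (U : Set Z) = Xᶜ ∧ IsIso (π ∣_ U)) ∧
          IsStrictNormalCrossingsDivisor Z' (π.base ⁻¹' X)) :
    CleanLU3DefectPRankTwoSepResAt p :=
  cleanLU3DefectPRankTwoSepRes_of_sepInf p (cleanLU3DefectPRankTwoSepInf_of_cossartPiltant2019 p hCP hEmb)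


end Summit.ResolutionOfSingularities.ResolutionOfSingularities.Cruxes.DescentPerfectToAll.CpSibling.TPrimeInf

end
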